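import Literature.Computability.QuantumComplexity.DesignAnticoncentration
import Literature.Computability.QuantumComplexity.IQPAnticoncentration
import Literature.Probability.HypothesisTesting.UniformityTestingLowerBound
import Literature.Probability.HypothesisTesting.CollisionUniformityTester
import Literature.Probability.HypothesisTesting.IdentityTestingLowerBound
import Mathlib.Analysis.SpecialFunctions.Pow.Real
import Mathlib.Analysis.SpecialFunctions.Log.Base
import Mathlib.Analysis.MeanInequalities
import Mathlib.Data.Multiset.Sort
import HarnessLib

/-!
# Sample complexity of certifying flat distributions from classical samples (Hangleiter–Kliesch–Eisert–Gogolin 2019)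

Topic `Literature/Computability/QuantumComplexity` (pub-qadeq lane, CLAIMS §5: the verification
vocabulary of the sampling rows E-01…E-16 — why the random-circuit / boson-sampling / IQP
experiments are scored by cross-entropy-type benchmarks that use the IDEAL probabilities rather than
by a test on the samples alone; companion of `Literature/Barriers/QuantumAdvantage/LinearXEBSpoofing.lean`,
whose docstring cites Theorem 7 of this source, and of `IQPAnticoncentration.lean`, whose
second-moment bound is the input of Theorem 7a).

HONEST FRAMING: instance-level adjudication of specific advantage claims; no claim about BQP vs
BPP or the summit.  This file formalises the elementary chain of the source — quasi-norm bounds,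
Rényi-entropy inequalities, Markov — and stated its dependence on Valiant–Valiant's identity-testing
theorem EXPLICITLY AS A HYPOTHESIS (`VVLowerBoundAt`, through v10; PROVED for every target in v11); it proves
nothing about any device and contains no complexity-class statement.

## Source, verbatim (held text `paper:arxiv-1812.01023`, 17 pp.; page/line locators of that text)

D. Hangleiter, M. Kliesch, J. Eisert, C. Gogolin, *Sample complexity of device-independently certified
“quantum supremacy”*, Phys. Rev. Lett. **122**, 210502 (2019) = arXiv:1812.01023 [HangleiterEtAl2019].

* §II (p0004 L45–60): “For any vector `x ∈ ℝⁿ` we define `∥x∥_∞ := max_{i∈[n]} |x_i|` and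
  `∥x∥_p := (Σ_i |x_i|^p)^{1/p}` for `0 < p < ∞` and take `∥x∥₀ := |{i ∈ [n] : x_i ≠ 0}|` …
  `H_α(P) := (α/(1−α)) log ∥P∥_α` (5).  We refer to `H_∞(P) = −log max_{i∈[n]} p_i` as the min-entropy
  of `P`.”  (“By log we denote the logarithm to basis 2.”)
* Definition 1 (p0004 L73–85): “We call `T : E^s → {0, 1}` an `ϵ`-certification test of `P` from `s`
  samples if … `Q = P ⇒ Pr_{S∼Q^s}[T(S) = 1] ≥ 2/3` (6), `∥P − Q∥₁ > ϵ ⇒ Pr_{S∼Q^s}[T(S) = 1] < 1/3` (7).”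
* §III (p0005 L57–63): “(i) let `P^{−max}` be the vector obtained from `P` by setting the largest entry to
  zero, and (ii) let `P_{−ϵ}` be the vector obtained from `P` by iteratively setting the smallest entries
  to zero, while the sum of the removed entries remains upper bounded by `ϵ > 0`.”
* Theorem 2 (Optimal certification tests [36] = Valiant–Valiant) (p0005 L75–86): “There exist constants
  `c₁, c₂ > 0` such that for any `ϵ > 0` and any target distribution `P`, there exists an
  `ϵ`-certification test from `c₁ max{1/ϵ, ϵ^{−2} ∥P^{−max}_{−ϵ/16}∥_{2/3}}` many samples, but there exists
  no `ϵ`-certification test from fewer than `c₂ max{1/ϵ, ϵ^{−2} ∥P^{−max}_{−2ϵ}∥_{2/3}}` samples.”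
* Lemma 3 (p0005 L93–112, eq. (8)):
  `2^{½H_∞(P)} (1 − ϵ − 2^{−H_∞(P)})^{3/2} ≤ ∥P^{−max}_{−ϵ}∥_{2/3} ≤ (1 − 2^{−H_∞(P)}) ∥P^{−max}_{−ϵ}∥₀^{1/2}`,
  with its proof (p0006 L2–42): the concavity step (11) `x^{2/3} ≥ x_*^{−1/3} x` for `0 ≤ x ≤ x_*`,
  (12)–(13) `∥P̃∥_{2/3}^{2/3} ≥ ∥P̃∥_∞^{−1/3} ∥P̃∥₁`, “both `∥P^{−max}_{−ϵ}∥_∞ ≤ ∥P∥_∞` and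
  `∥P^{−max}_{−ϵ}∥₁ ≥ 1 − ϵ − ∥P∥_∞`”, and (14)–(15) `∥v∥_p ≤ s^{1/p−1/q} ∥v∥_q` (`s ≥ ∥v∥₀`) at
  `p = 2/3`, `q = 1`.
* Eq. (9) (p0005 L113–126): “If for some constant `κ` it holds that `H_∞(P) = log(κ|E_n|)` …
  `s²_min ≥ c₂² (κ|E_n|/ϵ⁴)(1 − 2ϵ − 1/(κ|E_n|))³`.”
* Lemma 5 (p0007 L55–68, eq. (22)) “with probability at least `1 − δ` over the choice of `U ∼ μ_n`,
  `H_∞(P_U) ≥ ½ (log δ − log Σ_{S∈E_n} 𝔼_{U∼μ_n}[P_U(S)²])`”, proof (p0007 L72–96): Markov on the collision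
  probability, `H₂(P_U) := −log Σ_S P_U(S)²` (23)–(24), and “`H_α(P) ≥ H_∞(P) ≥ ((α−1)/α) H_α(P)` (25) for
  any distribution `P`”.
* Theorem 7 (p0008 L33–50): “For `0 < ϵ < 1/2` and sufficiently large `n`, with probability at least
  `1 − δ`, there exists no `ϵ`-certification test from `s < s_min` many samples for a. IQP circuit sampling
  on `n` qubits, where `s_min ∈ Ω(2^{n/4} δ^{1/4}/ϵ²)` (27). b. `ε̃`-approximate spherical 2-design sampling
  on `n` qubits …, where `s_min ∈ Ω(2^{n/4} δ^{1/4}/(ϵ²(1 + ε̃)^{1/4}))` (28).”  Proofs (p0008 L60–66): “We use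
  Theorem 2 and Lemmas 3–5 as well as the lower bounds (50), (31), and (34) on the min-entropy … for
  `0 < ϵ < 1/2` and sufficiently large `n` the term `(1 − 2ϵ − 2^{−H_∞(P_U)})^{3/2}` can be lower-bounded by
  a constant and, hence, be dropped inside the `Ω`.”
* §V.A IQP circuits (p0008 L72–112): `U_W = exp(i Σ_{i<j} w_{i,j} X_iX_j + i Σ_i w_{i,i} X_i)` (29), `w_{i,j} ∈ A`
  “e.g., `A = {0, π/8, …, 7π/8}`”; “Bremner et al. [16, Appendix F] prove the second-moment bound
  `𝔼_W[|⟨S|U_W|0⟩|⁴] ≤ 3 · 2^{−2n}` (30).  By Lemma 5, this implies the following min-entropy bound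
  `H_∞(P_{U_W}) ≥ ½ (n + log(δ/3))` (31), which holds with probability at least `1 − δ`.”
* §V.B (p0009 L8–28): `𝔼_{U∼μ}[|⟨S|U|S₀⟩|⁴] ≤ 2(1 + ε̃)/(|E_n|(|E_n| + 1))` (33) ⇒
  `H_∞(P_U) ≥ ½ (n + log(δ/(2(1 + ε̃))))` (34).

## What is formalised (all proved; no named fact; Theorem 2's lower half — the predicate `VVLowerBoundAt` — was a HYPOTHESIS through v10 and is PROVED for every target in v11)

Probability vectors are `P : E → ℝ` on a finite nonempty `E` with `P ≥ 0`, `Σ P = 1`.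

* §II: `pmax` (`∥P∥_∞`), `minEntropy` (`H_∞`), `renyiEntropy` (`H_α`, eq. (5)), `nzCount` (`∥·∥₀`).
* §III (i)–(ii): realised on the increasingly SORTED list of values `vals P` — `vvVec ε P` drops the
  last (largest) value and then greedily trims the longest prefix of mass `≤ ε` (`trim`; this IS the
  printed “iteratively setting the smallest entries to zero while the removed sum stays `≤ ϵ`”); ties are
  immaterial because only the multiset of surviving values enters `vvNorm ε P = ∥P^{−max}_{−ε}∥_{2/3}` and
  `vvSupp ε P = ∥P^{−max}_{−ε}∥₀`.  The printed notation does not fix the order of (i) and (ii); we apply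
  (i) then (ii), and Lemma 3 holds for either order.
* **Lemma 3, both inequalities, PROVED** (`vvNorm_ge` / `lemma3_lower`, `vvNorm_le` / `lemma3_upper`),
  through exactly the printed steps (11)–(15) (`rpow_two_thirds_ge`, `sum_rpow_two_thirds_ge`,
  `le_pmax_of_mem_vvVec`, `sum_vvVec_ge`, `qnorm_two_thirds_le` = Hölder (14) via Mathlib's
  `Real.inner_le_Lp_mul_Lq`).  The lower bound carries the hypothesis `ϵ + 2^{−H_∞(P)} ≤ 1` under which the
  printed `(1 − ϵ − 2^{−H∞})^{3/2}` is the real power of a nonnegative number.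
* **Eq. (25) PROVED** for every `α > 1` (`minEntropy_le_renyiEntropy`, `renyiEntropy_mul_le_minEntropy`;
  App. A of the source), and its `α = 2` instance `half_collisionEntropy_le_minEntropy`.
* **Lemma 5 PROVED** in finite-ensemble form (`lemma5`): for a finitely supported ensemble
  `(μ_ω, P_ω)` the `μ`-weight of the `ω` with `H_∞(P_ω) < ½(log₂ δ − log₂ 𝔼_ω Σ_S P_ω(S)²)` is `≤ δ`;
  `minEntropy_tail_of_second_moment` is the form “second-moment bound `B` ⇒ threshold
  `½(log₂ δ − log₂ B)`” used in §V.  (General measures `μ_n` on `U(2ⁿ)` are NOT treated.)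
* **Definition 1** (`IsCertTest`, with `accProb` = `Pr_{S∼Q^s}[T(S)=1]` as the finite product-weight sum
  over `S : Fin s → E`, and `l1Dist`).
* **Theorem 2, lower-bound half, as the predicate `VVLowerBoundAt c₂ ε P`** (Valiant–Valiant
  [ValiantValiant2017]; its proof — an instance-optimal identity-testing lower bound — is outside this
  file and it is used ONLY as an explicit hypothesis `hVV`).  From it: `samples_ge_of_vv` (Theorem 2 +
  Lemma 3: `s ≥ c₂ 2^{½H∞}(1 − 2ϵ − 2^{−H∞})^{3/2}/ϵ²`) and **eq. (9)** (`samples_sq_ge_flat`) PROVED.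
* **The skeleton of Theorems 6–7 PROVED** (`certification_lower_bound_of_second_moment`): second-moment
  bound `B` + Theorem 2 as hypothesis ⇒ off an ensemble weight `δ`, every `ϵ`-certification test needs
  `≥ c₂ 2^{t/2}(1 − 2ϵ − 2^{−t})^{3/2}/ϵ²` samples, `t = ½(log₂ δ − log₂ B)` (closed forms `2^{t/2} = 2^{a/4}q^{1/4}`, `2^{−t} = 2^{−a/2}q^{−1/2}` for
  `t = ½(a + log₂ q)`).
* **Theorem 7a PROVED modulo Theorem 2, constants explicit**, for BOTH finite IQP families of
  Bremner–Montanaro–Shepherd on top of the tree's `IQPAnticoncentration.lean`: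
  (a) the `{Z, CZ, CCZ}` / `𝔽₂`-polynomial family `𝒞_f`, `f = h + (uniformly random degree ≤ 2 part)`
  (`iqpDist`; eq. (30) summed `avg_sum_iqpDist_sq_le` from the tree's Lemma 12 `avg_ngap_pow_four_le` and the
  shift `p_{β,γ}(x) = ngap(poly h β (γ+x))²`; eq. (31) `iqp_minEntropy_tail`; eq. (27)
  `iqp_certification_lower_bound`: off a `δ`-fraction of `(β, γ)`, every test needs
  `≥ c₂ 2^{n/4}(δ/3)^{1/4}(1 − 2ϵ − 2^{−n/2}(δ/3)^{−1/2})^{3/2}/ϵ²` samples);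
  (b) the angle family of eq. (29) with `A = {0, π/8, …, 7π/8}` (`isingAmp`, `isingDist`, with
  `⟨S|U_W|0ⁿ⟩ = 2^{−n} Σ_x (−1)^{S·x} ω^{Σ w_{ij}z_iz_j + Σ v_kz_k}` read off the `X`-eigenbasis; normalisation
  `sum_isingDist` by Parseval; **eq. (30) for EVERY output string** `avg_isingDist_sq_le` from the tree's
  `avg_norm_isingZ_pow_four_le` (`𝔼|Z(ω)|⁴ ≤ 3·2^{2n}`) transported along the bijection `v ↦ v + 4·1_S` of the
  vertex weights (`isingZ_shift`, `norm_isingZ_shift`: the output string `S` is absorbed by adding `π/2`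
  to the vertex angles on `S`); eq. (31) `ising_minEntropy_tail`; eq. (27)
  `ising_certification_lower_bound`).
* **Theorem 7b PROVED modulo Theorem 2 AND the design bound (33)** (`design_certification_lower_bound`,
  finite weighted ensembles; (33) is the hypothesis `h33`, (34) and (28) come out with explicit constants).

* (v2) **Theorem 2 for the FLAT target, PROVED** — the hypothesis `VVLowerBoundAt` discharged in the
  case `H_∞(P) = log₂|E|` (eq. (9) with `κ = 1`) by the tree's Paninski lower bound
  `Literature/Probability/HypothesisTesting/UniformityTestingLowerBound.lean` (Le Cam + Ingster, after
  Canonne's survey §5.1 / Paninski 2008): `uniform_certification_lower_bound` — every `ε`-certification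
  test (Definition 1) of the uniform distribution on `2m` points with `0 < ε ≤ 1/2` uses `s` samples with
  `s² > m/(26 ε⁴)`, i.e. `s > 0.19 √m/ε²` — “the sample complexity for certification thus scales at least
  as the square root of that size”, now unconditionally in the tree for flat targets.
* (v3) **Relabelling invariance and the flat target on any even sample space / on bit strings** —
  Definition 1 transports along a bijection of outcomes (`accProb_comp_equiv`, `l1Dist_comp_equiv`,
  `IsCertTest.comp_equiv`); hence the flat-target bound holds for the uniform distribution `uniformDist E`
  on every finite `E` with `|E| = 2m` (`uniform_certification_lower_bound_card`, `s² > |E|/(52 ε⁴)`) and on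
  `E_n = {0,1}^n`, `n ≥ 1` (`uniform_certification_lower_bound_bitstrings`, `s² > 2^{n−1}/(26 ε⁴)`), the
  sample space of §V.A (“The sample space is therefore given by `E_n = {0, 1}^n`”, p. 8).
* (v4) **Theorem 7b for an EXACT spherical (state) 2-design, modulo Theorem 2 only** — hypothesis (33)
  is supplied, with `ε̃ = 0` and equality, by the tree's `DesignAnticoncentration.IsStateTwoDesign.fourth_moment`
  (`(1/K) Σ_j |⟨S|ψ_j⟩|⁴ = 2/(N(N+1))`, Zhu–Kueng–Grassl–Gross Prop. 1 at `t = 2` /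
  Hangleiter–Bermejo-Vega–Schwarz–Eisert 2018 §3.1): `designDist`, `twoDesign_certification_lower_bound`
  (the fraction of design states whose output distribution admits an `ε`-certification test from fewer
  than `c₂ 2^{(log₂N)/4}(δ/2)^{1/4}(1 − 2ε − 2^{−(log₂N)/2}(δ/2)^{−1/2})^{3/2}/ε²` samples is `≤ δ`);
  and one worked instance of the flat bound with numbers: `flat53_quarter_certification_needs_pow27_samples`
  (uniform target on `{0,1}^53`, `ε = 1/4` ⇒ `s > 2^27`).
* (v5) **Theorem 2's first branch (`s ≥ c₂/ϵ`) PROVED for every target** — `l1_prodW_le`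
  (`‖P^{⊗s} − Q^{⊗s}‖₁ ≤ s‖P − Q‖₁`), `accProb_sub_le` (one test separates two sources by at most
  `s‖P − Q‖₁/2`), `certification_needs_inv_eps` (every `ε`-certification test of ANY probability vector on
  `≥ 2` outcomes, `0 < ε ≤ 1/2`, has `s > 1/(3ε)`; the alternative is `(1 − λ)P + λδ_x` at distance `2ε`),
  `vvLowerBoundAt_third_of_norm_le` (hence `VVLowerBoundAt (1/3) ε P` outright whenever the `1/ϵ` branch
  dominates, `ϵ^{−2}‖P^{−max}_{−2ϵ}‖_{2/3} ≤ 1/ϵ`); and section `flatVV`: **Theorem 2's lower bound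
  DISCHARGED for flat targets** — `vvSupp_le_card`, `vvNorm_le_sqrt_card` (`‖P^{−max}_{−ϵ}‖_{2/3} ≤ √|E|`),
  `vvLowerBoundAt_uniformDist` / `vvLowerBoundAt_uniformDist_bitstrings`: `VVLowerBoundAt (1/8) ε U` is a
  THEOREM for the uniform `U` on any sample space of even size (on `{0,1}^n`), `0 < ε ≤ 1/2` — both
  branches of `max{1/ϵ, ϵ^{−2}‖U^{−max}_{−2ϵ}‖_{2/3}}` covered, constant `c₂ = 1/8`.
* (v6) **Restriction to the support; eq. (9) for targets flat on their support (any `κ`)** —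
  `sum_seq_support`, `accProb_restrict`, `l1Dist_restrict`, `sum_restrict`, **`IsCertTest.restrict`** (a test
  of a target vanishing off `S` is a test of its restriction to `S`), `flatOn S` (+ `flatOn_of_mem`,
  `flatOn_of_not_mem`, `flatOn_restrict`), **`flatOn_certification_lower_bound`** (target uniform on `S ⊆ E`,
  `|S| = 2m ≥ 2`, `0 < ε ≤ 1/2` ⇒ `s² > m/(26ε⁴) = κ|E|/(52ε⁴)`).
* (v7) **Theorem 2's lower bound DISCHARGED for every target flat on its support** — `nzCount_vals`,
  `vvSupp_le_card_support` (`‖P^{−max}_{−ε}‖₀ ≤ |supp P|`), `support_flatOn`, `flatOn_nonneg`, `sum_flatOn`,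
  **`vvLowerBoundAt_flatOn`** (`VVLowerBoundAt (1/8) ε (flatOn S)` for `|S| = 2m ≥ 2`, `0 < ε ≤ 1/2`).
* (v8) **every support size `|S| ≥ 2`** (the tree's padded Paninski family, `samples_sq_gtP`):
  `l1Dist_unifP_paninskiP`, `uniform_certification_lower_bound_padded` (`s² > (2m+r)/(52ε⁴)` on `2m + r`
  points, `r < 2m`), **`uniform_certification_lower_bound_card_two_le`** (`s² > |E|/(52ε⁴)` for every `E`
  with `|E| ≥ 2`), `flatOn_certification_lower_bound_two_le`, **`vvLowerBoundAt_flatOn_two_le`**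
  (`VVLowerBoundAt (1/8) ε (flatOn S)` for every `|S| ≥ 2`, `0 < ε ≤ 1/2`).
* (v9) `vvLowerBoundAt_flatOn_card_one` (point mass), **`vvLowerBoundAt_flatOn_of_nonempty`** (every
  nonempty support), **`twoDesign_certification_lower_bound_flat`** (Theorem 7b with `c₂ = 1/8`, NO
  Valiant–Valiant hypothesis, for every exact state 2-design whose output distributions are flat on their
  supports).

* (v10) **Theorem 2's UPPER-bound half for the flat target — PROVED, `c₁` explicit** (the existence
  half “there exists an `ϵ`-certification test from `c₁ max{1/ϵ, ϵ^{−2}‖P^{−max}_{−ϵ/16}‖_{2/3}}` many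
  samples” for `P = U`): by the tree's `Literature/Probability/HypothesisTesting/CollisionUniformityTester.lean`
  (Goldreich–Ron's collision tester with the optimal analysis of Diakonikolas–Gouleakis–Peebles–Price 2019,
  Theorem 2.1), `uniform_certification_upper_bound`: for `0 < ε ≤ 1` and every `m ≥ 3200 √|E|/ε²` the test
  “number of colliding pairs `< (m choose 2)(1 + 3ε²/4)/|E|`” IS an `ε`-certification test of `uniformDist E`
  from `m` samples (Definition 1; completeness `≥ 3/4`, soundness `≤ 1/4`); `exists_uniform_certTest` (every
  `ε > 0`, `m ≥ 3200√|E|/min(ε,1)²`); `uniform_certification_sample_complexity` (both halves side by side for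
  `|E| ≥ 2`, `0 < ε ≤ 1/2`: `s² > |E|/(52ε⁴)` is necessary, `m ≥ 3200√|E|/ε²` suffices — Canonne's “this sample
  complexity is tight”, `Θ(√|E|/ε²)`); `flat53_quarter_certification_from_pow43_samples` (the `{0,1}^53`,
  `ε = 1/4` instance: impossible from `2^27` samples (v4), achieved from `2^43`).

* (v11) **Theorem 2's LOWER-bound half for EVERY target — PROVED, `c₂ = 1/11`** (Valiant–Valiant's
  instance-optimal identity-testing lower bound, their Theorem 1 = ECCC TR13-111 §3 Theorem 3 → Corollary 1 →
  Proposition 2, through the tree's `Literature/Probability/HypothesisTesting/IdentityTestingLowerBound.lean`,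
  which proves it by Le Cam + Ingster on Valiant–Valiant's perturbation family realised in cancelling pairs):
  section `generalVV` — `trim_eq_drop` and `exists_monotone_enum` (the list `P^{−max}_{−2ϵ}` as the segment
  `t ≤ k ≤ |E| − 2` of a sorted enumeration `x : Fin |E| ≃ E`, the prefix `k ≤ t` carrying `> 2ϵ`),
  **`vvNorm_sq_le`** (`‖P^{−max}_{−2ε}‖²_{2/3} ≤ 104 s² ε⁴` for every `ε`-certification test from `s` samples of
  any probability vector on `≥ 2` outcomes, `ε > 0`), **`vvLowerBoundAt_holds`** (`VVLowerBoundAt (1/11) ε P`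
  for every such `P` and `0 < ε ≤ 1/2` — the hypothesis `hVV` of everything above is a THEOREM), and the
  hypothesis-free forms: `certification_lower_bound_of_second_moment_holds` (the skeleton of Theorems 6–7),
  `design_certification_lower_bound_holds` (7b, ensemble form with (33) as the only input), and Theorem 7
  proper — **`iqp_certification_lower_bound_holds`**, **`ising_certification_lower_bound_holds`** (7a, both IQP
  families), **`twoDesign_certification_lower_bound_holds`** (7b for exact state 2-designs, `|V| ≥ 2`) — each
  with `c₂ = 1/11` and no input beyond “sufficiently large `n`” (`hfit`);
  `certification53_quarter_needs_vvNorm_samples` (any target on `{0,1}^53`, `ϵ = 1/4`).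
* (v12) **Theorem 2 + Lemma 3 for a SINGLE target, unconditional**: `samples_ge_of_minEntropy`
  (`s ≥ (1/11)·2^{½H_∞(P)}(1 − 2ε − 2^{−H_∞(P)})^{3/2}/ε²`) and `samples_ge_of_pmax`
  (`s ≥ (1 − 2ε − p_max)^{3/2}/(11 ε² √p_max)`) for every `ε`-certification test of any probability vector on
  `≥ 2` outcomes, `0 < ε ≤ 1/2` — the min-entropy / largest-probability form of the lower bound with no
  ensemble and no hypothesis (`samples_ge_of_vv` with `vvLowerBoundAt_holds`).
* (v13) **The same bound under an UPPER BOUND on `p_max`, with a dyadic form and numeric instances at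
  `ε = 1/4`**: `samples_ge_of_pmax_le` (`p_max ≤ q`, `2ε + q ≤ 1` ⇒ `s ≥ (1 − 2ε − q)^{3/2}/(11 ε² √q)`),
  `samples_ge_two_rpow_of_pmax_le` (`p_max ≤ 2^{−k}`, `k ≥ 7`, `ε = 1/4` ⇒ `s ≥ 2^{k/2 − 1}`) and the
  kernel-checked numbers `samples_ge_of_pmax_le_two_pow_neg_48` (`≥ 8 388 608`) /
  `samples_ge_of_pmax_le_two_pow_neg_61` (`≥ 7.5·10⁸`) — the form in which eq. (9)'s square-root law is
  applied to an instance (only an upper bound on the largest ideal probability is ever available; whether a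
  given experiment's ideal distribution satisfies it is a property of that instance, not proved here).

NOT formalised: Theorem 2's upper-bound half for NON-flat targets / eq. (10) (the flat target's upper bound is v10; the lower-bound half holds for every target, v11); Lemma 4
(post-selected distributions) and Theorems 6/9/11 (boson sampling: they rest on Aaronson–Arkhipov's
Gaussian-measure closeness, Lemma 8); (33) for APPROXIMATE designs (`ε̃ > 0`) and the statement that the circuit families of Refs. [15, 17, 48, 49] form (approximate) 2-designs (Brandão–Harrow–Horodecki) — only EXACT state 2-designs are covered (v4); the
asymptotic `Ω(·)` phrasing (we keep the factor `(1 − 2ϵ − 2^{−H∞})^{3/2}` explicit and “sufficiently large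
`n`” as the hypothesis `2ϵ + 2^{−t} ≤ 1`); ensembles given by a general (non finitely supported) measure.

## References

* [HangleiterEtAl2019] D. Hangleiter, M. Kliesch, J. Eisert, C. Gogolin, *Sample complexity of
  device-independently certified “quantum supremacy”*, Phys. Rev. Lett. 122, 210502 (2019),
  arXiv:1812.01023 — Definition 1, Theorem 2, Lemma 3 (with proof), eq. (9), Lemma 5 (with proof),
  eq. (25), Theorem 7, §V.A eqs. (29)–(31), §V.B eqs. (33)–(34).
* [ValiantValiant2017] G. Valiant, P. Valiant, *An automatic inequality prover and instance optimal
  identity testing*, SIAM J. Comput. 46, 429–455 (2017) (FOCS 2014; ECCC TR13-111) — Thm. 1 (= Theorem 2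
  above; used as hypothesis `VVLowerBoundAt`, PROVED here for flat targets, v2–v5, and for EVERY target, v11,
  through the tree's `IdentityTestingLowerBound.lean`: §3 Thm. 3, Cor. 1, Prop. 2).
* [Paninski2008] L. Paninski, *A coincidence-based test for uniformity given very sparsely sampled
  discrete data*, IEEE Trans. Inform. Theory 54, 4750–4755 (2008) and [Canonne2020] C. L. Canonne, *A Survey
  on Distribution Testing*, Theory of Computing Graduate Surveys 9 (2020), §5.1 / App. E.2 — the flat-target
  lower bound (v2), through the tree's `UniformityTestingLowerBound.lean`.
* [DiakonikolasEtAl2019CollisionTesters] I. Diakonikolas, T. Gouleakis, J. Peebles, E. Price, *Collision-based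
  testers are optimal for uniformity and closeness*, Chicago J. Theor. Comput. Sci. 2019 (1), 1–21,
  doi:10.4086/cjtcs.2019.001 — Theorem 2.1 (the flat-target UPPER bound, v10), through the tree's
  `CollisionUniformityTester.lean`; the tester is Goldreich–Ron's [GoldreichRon2000].
* [HangleiterEtAl2018] D. Hangleiter, J. Bermejo-Vega, M. Schwarz, J. Eisert, *Anticoncentration theorems
  for schemes showing a quantum speedup*, Quantum 2, 65 (2018), arXiv:1706.03786, §3.1, and [ZhuEtAl2016]
  H. Zhu, R. Kueng, M. Grassl, D. Gross, *The Clifford group fails gracefully to be a unitary 4-design*,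
  arXiv:1609.08172, Prop. 1 — the state-2-design fourth moment (v4), through the tree's
  `DesignAnticoncentration.lean`.
* [BremnerMontanaroShepherd2016] M. J. Bremner, A. Montanaro, D. J. Shepherd, *Average-case complexity
  versus approximate simulation of commuting quantum computations*, Phys. Rev. Lett. 117, 080501 (2016),
  arXiv:1504.07999 — eq. (1), p. 5, App. F Lemmas 11–12 (through the tree's `IQPAnticoncentration.lean`).
-/

noncomputable section

open Finset Real

namespace Literature.Computability.QuantumComplexity

namespace Certification

variable {ι : Type*} [Fintype ι]

/-- The largest probability `‖P‖_∞ = max_i p_i` of a vector on a nonempty finite sample space.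
[cite: HangleiterEtAl2019, §II (“∥x∥∞ := max_i |x_i|”, p. 4)] -/
def pmax [Nonempty ι] (P : ι → ℝ) : ℝ := univ.sup' univ_nonempty P

/-- Every entry is at most the largest one (plumbing). [folklore] -/
private theorem le_pmax [Nonempty ι] (P : ι → ℝ) (i : ι) : P i ≤ pmax P :=
  le_sup' P (mem_univ i)

/-- The maximum is attained (plumbing). [folklore] -/
private theorem exists_pmax_eq [Nonempty ι] (P : ι → ℝ) : ∃ i, P i = pmax P := by
  obtain ⟨i, -, hi⟩ := exists_mem_eq_sup' univ_nonempty P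
  exact ⟨i, hi.symm⟩


/-- **Min-entropy** `H_∞(P) = −log₂ max_i p_i` (logarithms to base 2).
[cite: HangleiterEtAl2019, §II eq. (5) (“We refer to H∞(P) = −log max_i p_i as the min-entropy of P”, p. 4)] -/
def minEntropy [Nonempty ι] (P : ι → ℝ) : ℝ := -Real.logb 2 (pmax P)

/-- The **α-Rényi entropy** `H_α(P) = (α/(1−α)) log₂ ‖P‖_α = (1/(1−α)) log₂ Σ_i p_i^α` (`α ≠ 1`).
[cite: HangleiterEtAl2019, §II eq. (5), p. 4] -/
def renyiEntropy (α : ℝ) (P : ι → ℝ) : ℝ := (1 - α)⁻¹ * Real.logb 2 (∑ i, P i ^ α)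

/-- Operation (ii) on an increasingly sorted list of values: “iteratively setting the smallest entries
to zero, while the sum of the removed entries remains upper bounded by `ε`” — greedily drop the
longest prefix of total mass `≤ ε` (dropped = set to zero; only the surviving values matter for the
quasi-norms). [cite: HangleiterEtAl2019, §III item (ii), p. 5] -/
def trim : ℝ → List ℝ → List ℝ
  | _, [] => []
  | ε, a :: l => if a ≤ ε then trim (ε - a) l else a :: l

/-- The trim keeps a suffix of the list. [cite: HangleiterEtAl2019, §III item (ii), p. 5] -/
theorem trim_suffix : ∀ (ε : ℝ) (l : List ℝ), trim ε l <:+ l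
  | _, [] => by simp [trim]
  | ε, a :: l => by
    unfold trim
    split_ifs
    · exact (trim_suffix (ε - a) l).trans (List.suffix_cons a l)
    · exact List.suffix_refl _

/-- The removed mass is at most `ε`: `Σ l − ε ≤ Σ (trim ε l)`. [cite: HangleiterEtAl2019, §III item (ii) (“while the sum of the removed entries remains upper bounded by ϵ”), p. 5] -/
theorem sum_sub_le_sum_trim : ∀ {ε : ℝ} (_ : 0 ≤ ε) (l : List ℝ), l.sum - ε ≤ (trim ε l).sum
  | _, _, [] => by simp [trim]; assumption
  | ε, hε, a :: l => by
    unfold trim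
    split_ifs with h
    · have := sum_sub_le_sum_trim (sub_nonneg.2 h) l
      simp only [List.sum_cons]; linarith
    · simp only [List.sum_cons]; linarith

/-- With `0 ≤ ε`, no zero entry survives the trim of an increasingly sorted list of nonnegative
reals: every surviving entry is positive (so `‖·‖₀` of the result is its length). [cite: HangleiterEtAl2019, §III item (ii), p. 5] -/
theorem pos_of_mem_trim : ∀ {ε : ℝ} (_ : 0 ≤ ε) {l : List ℝ} (_ : l.Pairwise (· ≤ ·))
    (_ : ∀ x ∈ l, 0 ≤ x) {x : ℝ} (_ : x ∈ trim ε l), 0 < x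
  | _, _, [], _, _, x, hx => by simp [trim] at hx
  | ε, hε, a :: l, hs, hnn, x, hx => by
    unfold trim at hx
    split_ifs at hx with h
    · exact pos_of_mem_trim (sub_nonneg.2 h) (List.pairwise_cons.1 hs).2
        (fun y hy => hnn y (List.mem_cons_of_mem a hy)) hx
    · have ha : 0 < a := lt_of_le_of_lt hε (not_le.1 h)
      rcases List.mem_cons.1 hx with rfl | hx
      · exact ha
      · exact lt_of_lt_of_le ha ((List.pairwise_cons.1 hs).1 x hx)

/-- `‖l‖₀`: the number of nonzero entries. [cite: HangleiterEtAl2019, §II (“∥x∥₀ := |{i ∈ [n] : x_i ≠ 0}|”, p. 4)] -/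
def nzCount (l : List ℝ) : ℕ := l.countP fun x => x ≠ 0

/-- `‖l‖₀` as the sum of the indicator of the nonzero entries (plumbing). [folklore] -/
private theorem sum_map_indicator_eq_nzCount : ∀ l : List ℝ,
    (l.map fun x => if x = 0 then (0 : ℝ) else 1).sum = nzCount l
  | [] => by simp [nzCount]
  | a :: l => by
    rw [List.map_cons, List.sum_cons, sum_map_indicator_eq_nzCount l]
    simp only [nzCount, List.countP_cons]
    by_cases h : a = 0
    · simp [h]
    · simp [h, add_comm]

/-- The entries of `P` as an increasingly sorted list (the order in which operation (ii) removes
them). [folklore] -/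
def vals (P : ι → ℝ) : List ℝ := (univ.val.map P).sort (· ≤ ·)

/-- `vals P` is sorted. [folklore] -/
private theorem vals_sorted (P : ι → ℝ) : (vals P).Pairwise (· ≤ ·) := Multiset.pairwise_sort _ _
/-- `vals P` has the same sum as `P`. [folklore] -/
private theorem sum_vals (P : ι → ℝ) : (vals P).sum = ∑ i, P i := by
  rw [vals, ← Multiset.sum_coe, Multiset.sort_eq, Finset.sum_eq_multiset_sum]
/-- The members of `vals P` are the values of `P`. [folklore] -/
private theorem mem_vals {P : ι → ℝ} {x : ℝ} : x ∈ vals P ↔ ∃ i, P i = x := by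
  rw [vals, Multiset.mem_sort, Multiset.mem_map]; simp
/-- `vals P` has `|E|` entries. [folklore] -/
private theorem length_vals (P : ι → ℝ) : (vals P).length = Fintype.card ι := by
  rw [vals, Multiset.length_sort, Multiset.card_map]; rfl

/-- `vals P` is nonempty. [folklore] -/
private theorem vals_ne_nil [Nonempty ι] (P : ι → ℝ) : vals P ≠ [] := by
  rw [← List.length_pos_iff_ne_nil, length_vals]; exact Fintype.card_pos

/-- The last entry of the increasingly sorted value list is the largest probability. [folklore] -/
private theorem getLast_vals [Nonempty ι] (P : ι → ℝ) :
    (vals P).getLast (vals_ne_nil P) = pmax P := by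
  have hsplit := List.dropLast_append_getLast (vals_ne_nil P)
  have hpw := vals_sorted P
  rw [← hsplit, List.pairwise_append] at hpw
  apply le_antisymm
  · obtain ⟨i, hi⟩ := mem_vals.1 (List.getLast_mem (vals_ne_nil P))
    rw [← hi]; exact le_pmax P i
  · obtain ⟨i, hi⟩ := exists_pmax_eq P
    have hmem : P i ∈ vals P := mem_vals.2 ⟨i, rfl⟩
    rw [← hsplit, List.mem_append, List.mem_singleton] at hmem
    rw [← hi]
    rcases hmem with h | h
    · exact hpw.2.2 _ h _ (List.mem_singleton_self _)
    · exact h.le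

/-- **`P^{−max}_{−ε}`** as the list of surviving values: (i) “setting the largest entry to zero” (drop
the last entry of the sorted list), then (ii) trimming `ε` mass of smallest entries.  (The order
(i)-then-(ii) is immaterial for Lemma 3; all statements below are about this list of values.)
[cite: HangleiterEtAl2019, §III items (i)–(ii) and Theorem 2, p. 5] -/
def vvVec [Nonempty ι] (ε : ℝ) (P : ι → ℝ) : List ℝ := trim ε (vals P).dropLast

/-- **`‖P^{−max}_{−ε}‖_{2/3} = (Σ_i x_i^{2/3})^{3/2}`**, the quasi-norm governing the sample complexity of
certification. [cite: HangleiterEtAl2019, §II (“∥x∥_p := (Σ|x_i|^p)^{1/p} for 0 < p < ∞”) and Theorem 2] -/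
def vvNorm [Nonempty ι] (ε : ℝ) (P : ι → ℝ) : ℝ :=
  (((vvVec ε P).map fun x => x ^ (2 / 3 : ℝ)).sum) ^ (3 / 2 : ℝ)

/-- `‖P^{−max}_{−ε}‖₀`, the support size entering eq. (10) and Lemma 3's upper bound. [cite: HangleiterEtAl2019, §II and Lemma 3] -/
def vvSupp [Nonempty ι] (ε : ℝ) (P : ι → ℝ) : ℕ := nzCount (vvVec ε P)

section lemma3
variable [Nonempty ι]

/-- Operation (i) removes exactly the largest probability: `Σ (P^{−max}) = Σ P − max_i p_i`.
[cite: HangleiterEtAl2019, §III item (i), p. 5] -/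
theorem sum_dropLast_vals (P : ι → ℝ) : (vals P).dropLast.sum = (∑ i, P i) - pmax P := by
  have h := congrArg List.sum (List.dropLast_append_getLast (vals_ne_nil P))
  rw [List.sum_append, List.sum_singleton, getLast_vals, sum_vals] at h
  linarith

/-- Surviving values are values of `P`. [cite: HangleiterEtAl2019, §III, p. 5] -/
theorem mem_vvVec {ε : ℝ} {P : ι → ℝ} {x : ℝ} (hx : x ∈ vvVec ε P) : ∃ i, P i = x := by
  have h1 := (trim_suffix ε (vals P).dropLast).subset hx
  exact mem_vals.1 ((List.dropLast_sublist _).subset h1)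

/-- `‖P^{−max}_{−ε}‖_∞ ≤ ‖P‖_∞` (first ingredient of the lower bound). [cite: HangleiterEtAl2019, Lemma 3 proof (“both ∥P^{−max}_{−ϵ}∥∞ ≤ ∥P∥∞ and …”), p. 6] -/
theorem le_pmax_of_mem_vvVec {ε : ℝ} {P : ι → ℝ} {x : ℝ} (hx : x ∈ vvVec ε P) : x ≤ pmax P := by
  obtain ⟨i, rfl⟩ := mem_vvVec hx; exact le_pmax P i

/-- `‖P^{−max}_{−ε}‖₁ ≥ ‖P‖₁ − ε − ‖P‖_∞` (second ingredient of the lower bound).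
[cite: HangleiterEtAl2019, Lemma 3 proof (“∥P^{−max}_{−ϵ}∥₁ ≥ 1 − ϵ − ∥P∥∞”), p. 6] -/
theorem sum_vvVec_ge {ε : ℝ} (hε : 0 ≤ ε) (P : ι → ℝ) :
    (∑ i, P i) - pmax P - ε ≤ (vvVec ε P).sum := by
  have := sum_sub_le_sum_trim hε (vals P).dropLast
  rw [sum_dropLast_vals] at this
  exact this

/-- `‖P^{−max}_{−ε}‖₁ ≤ ‖P‖₁ − ‖P‖_∞` (the largest entry is gone; used in the upper bound).
[cite: HangleiterEtAl2019, Lemma 3 (upper bound, factor (1 − 2^{−H∞(P)})), p. 5–6] -/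
theorem sum_vvVec_le {ε : ℝ} (P : ι → ℝ) (hP : ∀ i, 0 ≤ P i) :
    (vvVec ε P).sum ≤ (∑ i, P i) - pmax P := by
  rw [← sum_dropLast_vals]
  refine ((trim_suffix ε _).sublist).sum_le_sum ?_
  intro x hx
  obtain ⟨i, rfl⟩ := mem_vals.1 ((List.dropLast_sublist _).subset hx)
  exact hP i

/-- For `ε ≥ 0` every surviving value is positive. [cite: HangleiterEtAl2019, §III item (ii), p. 5] -/
theorem pos_of_mem_vvVec {ε : ℝ} (hε : 0 ≤ ε) {P : ι → ℝ} (hP : ∀ i, 0 ≤ P i) {x : ℝ}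
    (hx : x ∈ vvVec ε P) : 0 < x := by
  refine pos_of_mem_trim hε ((vals_sorted P).sublist (List.dropLast_sublist _)) ?_ hx
  intro y hy
  obtain ⟨i, rfl⟩ := mem_vals.1 ((List.dropLast_sublist _).subset hy)
  exact hP i

/-- **Eq. (11)**, the concavity step: “for any fixed `x_* > 0` and any `0 ≤ x ≤ x_*` we have
`x^{2/3} ≥ x_*^{2/3} x / x_* = x_*^{−1/3} x`”. [cite: HangleiterEtAl2019, Lemma 3 proof eq. (11), p. 6] -/
theorem rpow_two_thirds_ge {x M : ℝ} (hx : 0 ≤ x) (hxM : x ≤ M) :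
    M ^ (-(1 / 3) : ℝ) * x ≤ x ^ (2 / 3 : ℝ) := by
  rcases hx.eq_or_lt with rfl | hx0
  · simp
  · have h1 : M ^ (-(1 / 3) : ℝ) ≤ x ^ (-(1 / 3) : ℝ) :=
      Real.rpow_le_rpow_of_nonpos hx0 hxM (by norm_num)
    calc M ^ (-(1 / 3) : ℝ) * x ≤ x ^ (-(1 / 3) : ℝ) * x :=
          mul_le_mul_of_nonneg_right h1 hx
      _ = x ^ (2 / 3 : ℝ) := by
          rw [← Real.rpow_add_one' hx (by norm_num)]; norm_num

/-- **Eqs. (12)–(13)**: `‖P̃‖_{2/3}^{2/3} = Σ p̃_i^{2/3} ≥ Σ ‖P̃‖_∞^{−1/3} p̃_i = ‖P̃‖_∞^{−1/3} ‖P̃‖₁` for a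
nonnegative vector with entries `≤ M`. [cite: HangleiterEtAl2019, Lemma 3 proof eqs. (12)–(13), p. 6] -/
theorem sum_rpow_two_thirds_ge {M : ℝ} :
    ∀ (l : List ℝ), (∀ x ∈ l, 0 ≤ x ∧ x ≤ M) →
      M ^ (-(1 / 3) : ℝ) * l.sum ≤ (l.map fun x => x ^ (2 / 3 : ℝ)).sum
  | [], _ => by simp
  | a :: l, h => by
    simp only [List.sum_cons, List.map_cons, mul_add]
    exact add_le_add (rpow_two_thirds_ge (h a (by simp)).1 (h a (by simp)).2)
      (sum_rpow_two_thirds_ge l fun x hx => h x (by simp [hx]))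

/-- **Lemma 3, lower bound**, in terms of `M = max_i p_i = 2^{−H_∞(P)}`:
`M^{−1/2} (1 − ε − M)^{3/2} ≤ ‖P^{−max}_{−ε}‖_{2/3}` (for `ε + M ≤ 1`, so that the printed
`(1 − ε − 2^{−H∞})^{3/2}` is the real power of a nonnegative number).
[cite: HangleiterEtAl2019, Lemma 3 eq. (8) and its proof eqs. (11)–(13), p. 5–6] -/
theorem vvNorm_ge {ε : ℝ} (hε : 0 ≤ ε) {P : ι → ℝ} (hP : ∀ i, 0 ≤ P i) (hP1 : ∑ i, P i = 1)
    (hfit : ε + pmax P ≤ 1) :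
    (pmax P) ^ (-(1 / 2) : ℝ) * (1 - ε - pmax P) ^ (3 / 2 : ℝ) ≤ vvNorm ε P := by
  obtain ⟨i₀, hi₀⟩ := exists_pmax_eq P
  have hM : 0 < pmax P := by
    by_contra h
    have hall : ∀ i, P i = 0 := fun i =>
      le_antisymm ((le_pmax P i).trans (not_lt.1 h)) (hP i)
    simp [hall] at hP1
  have hS : (1 - ε - pmax P) ≤ (vvVec ε P).sum := by
    have := sum_vvVec_ge hε P; rw [hP1] at this; linarith
  have hS0 : 0 ≤ 1 - ε - pmax P := by linarith
  have key : pmax P ^ (-(1 / 3) : ℝ) * (1 - ε - pmax P) ≤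
      ((vvVec ε P).map fun x => x ^ (2 / 3 : ℝ)).sum :=
    calc pmax P ^ (-(1 / 3) : ℝ) * (1 - ε - pmax P)
        ≤ pmax P ^ (-(1 / 3) : ℝ) * (vvVec ε P).sum :=
          mul_le_mul_of_nonneg_left hS (Real.rpow_nonneg hM.le _)
      _ ≤ _ := sum_rpow_two_thirds_ge _ fun x hx =>
          ⟨(pos_of_mem_vvVec hε hP hx).le, le_pmax_of_mem_vvVec hx⟩
  have hL0 : 0 ≤ pmax P ^ (-(1 / 3) : ℝ) * (1 - ε - pmax P) :=
    mul_nonneg (Real.rpow_nonneg hM.le _) hS0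
  have := Real.rpow_le_rpow hL0 key (by norm_num : (0 : ℝ) ≤ 3 / 2)
  rw [Real.mul_rpow (Real.rpow_nonneg hM.le _) hS0, ← Real.rpow_mul hM.le] at this
  norm_num at this
  exact this

/-- **Eq. (14) with `p = 2/3`, `q = 1`**: “for any vector `v` and `0 < p < q ≤ ∞`,
`∥v∥_p ≤ s^{1/p − 1/q} ∥v∥_q`, where `s ≥ ∥v∥₀`” — here `(Σ x^{2/3})^{3/2} ≤ ‖v‖₀^{1/2} Σ x` for a list
of nonnegative reals (Hölder with exponents `3/2` and `3` against the indicator of the support).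
[cite: HangleiterEtAl2019, Lemma 3 proof eqs. (14)–(15) (citing Foucart–Rauhut Eq. (A.3)), p. 6] -/
theorem qnorm_two_thirds_le (l : List ℝ) (hl : ∀ x ∈ l, 0 ≤ x) :
    ((l.map fun x => x ^ (2 / 3 : ℝ)).sum) ^ (3 / 2 : ℝ) ≤
      (nzCount l : ℝ) ^ (1 / 2 : ℝ) * l.sum := by
  -- pass to `Fin`-indexed sums
  have conv : ∀ f : ℝ → ℝ, (l.map f).sum = ∑ j : Fin l.length, f l[(j : ℕ)] := fun f => by
    rw [← List.ofFn_getElem_eq_map, List.sum_ofFn]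
  have hcount : (nzCount l : ℝ) = ∑ j : Fin l.length, (if l[(j : ℕ)] = 0 then (0 : ℝ) else 1) := by
    rw [← sum_map_indicator_eq_nzCount, conv]
  have hv0 : ∀ j : Fin l.length, 0 ≤ l[(j : ℕ)] := fun j => hl _ (List.getElem_mem _)
  -- Hölder with exponents 3/2 and 3
  have hpq : (3 / 2 : ℝ).HolderConjugate 3 := by
    rw [Real.holderConjugate_iff]; norm_num
  have H := Real.inner_le_Lp_mul_Lq (s := univ) (f := fun j : Fin l.length => l[(j : ℕ)] ^ (2 / 3 : ℝ))
    (g := fun j => if l[(j : ℕ)] = 0 then (0 : ℝ) else 1) hpq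
  have hfg : ∀ j : Fin l.length, l[(j : ℕ)] ^ (2 / 3 : ℝ) * (if l[(j : ℕ)] = 0 then (0 : ℝ) else 1) =
      l[(j : ℕ)] ^ (2 / 3 : ℝ) := by
    intro j; split_ifs with h
    · rw [h, Real.zero_rpow (by norm_num), zero_mul]
    · rw [mul_one]
  have hf : ∀ j : Fin l.length, |l[(j : ℕ)] ^ (2 / 3 : ℝ)| ^ (3 / 2 : ℝ) = l[(j : ℕ)] := by
    intro j
    rw [abs_of_nonneg (Real.rpow_nonneg (hv0 j) _), ← Real.rpow_mul (hv0 j)]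
    norm_num
  have hg : ∀ j : Fin l.length, |(if l[(j : ℕ)] = 0 then (0 : ℝ) else 1)| ^ (3 : ℝ) =
      (if l[(j : ℕ)] = 0 then (0 : ℝ) else 1) := by
    intro j; split_ifs <;> simp
  simp only [hfg, hf, hg] at H
  -- raise to the power 3/2
  have hA0 : 0 ≤ ∑ j : Fin l.length, l[(j : ℕ)] ^ (2 / 3 : ℝ) :=
    sum_nonneg fun j _ => Real.rpow_nonneg (hv0 j) _
  have hS0 : 0 ≤ ∑ j : Fin l.length, l[(j : ℕ)] := sum_nonneg fun j _ => hv0 j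
  have hC0 : 0 ≤ ∑ j : Fin l.length, (if l[(j : ℕ)] = 0 then (0 : ℝ) else 1) :=
    sum_nonneg fun j _ => by split_ifs <;> norm_num
  have H2 := Real.rpow_le_rpow hA0 H (by norm_num : (0 : ℝ) ≤ 3 / 2)
  rw [Real.mul_rpow (Real.rpow_nonneg hS0 _) (Real.rpow_nonneg hC0 _),
    ← Real.rpow_mul hS0, ← Real.rpow_mul hC0] at H2
  norm_num at H2
  rw [conv, hcount, mul_comm]
  exact H2

/-- **Lemma 3, upper bound**, in terms of `M = max_i p_i`:
`‖P^{−max}_{−ε}‖_{2/3} ≤ (1 − M) ‖P^{−max}_{−ε}‖₀^{1/2}` (eq. (15) and `‖P^{−max}_{−ε}‖₁ ≤ 1 − M`).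
[cite: HangleiterEtAl2019, Lemma 3 eq. (8) and proof eq. (15), p. 5–6] -/
theorem vvNorm_le {ε : ℝ} (hε : 0 ≤ ε) {P : ι → ℝ} (hP : ∀ i, 0 ≤ P i) (hP1 : ∑ i, P i = 1) :
    vvNorm ε P ≤ (1 - pmax P) * (vvSupp ε P : ℝ) ^ (1 / 2 : ℝ) := by
  have h := qnorm_two_thirds_le (vvVec ε P) fun x hx => (pos_of_mem_vvVec hε hP hx).le
  refine h.trans ?_
  rw [mul_comm]
  refine mul_le_mul_of_nonneg_right ?_ (Real.rpow_nonneg (Nat.cast_nonneg _) _)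
  have := sum_vvVec_le (ε := ε) P hP
  rw [hP1] at this
  exact this

end lemma3

section entropyForms
variable [Nonempty ι]

/-- A probability vector (`p_i ≥ 0`, `Σ_i p_i = 1`) has a positive largest entry. [cite: HangleiterEtAl2019, §II (“probability vector P = (p₁, …, p_n), p_i ≥ 0, Σ_i p_i = 1”), p. 4] -/
theorem pmax_pos {P : ι → ℝ} (hP : ∀ i, 0 ≤ P i) (hP1 : ∑ i, P i = 1) : 0 < pmax P := by
  by_contra h
  have hall : ∀ i, P i = 0 := fun i =>
    le_antisymm ((le_pmax P i).trans (not_lt.1 h)) (hP i)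
  simp [hall] at hP1

/-- … and its largest entry is at most `1`. [cite: HangleiterEtAl2019, §II (probability vectors), p. 4] -/
theorem pmax_le_one {P : ι → ℝ} (hP : ∀ i, 0 ≤ P i) (hP1 : ∑ i, P i = 1) : pmax P ≤ 1 := by
  obtain ⟨i, hi⟩ := exists_pmax_eq P
  rw [← hi, ← hP1]
  exact single_le_sum (fun j _ => hP j) (mem_univ i)

/-- `2^{−H_∞(P)} = max_i p_i`. [cite: HangleiterEtAl2019, §II eq. (5) / Lemma 3 (the term 2^{−H∞(P)}), p. 4–5] -/
theorem two_rpow_neg_minEntropy {P : ι → ℝ} (hM : 0 < pmax P) :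
    (2 : ℝ) ^ (-minEntropy P) = pmax P := by
  unfold minEntropy
  rw [neg_neg, Real.rpow_logb (by norm_num) (by norm_num) hM]

/-- `2^{H_∞(P)/2} = (max_i p_i)^{−1/2}`. [cite: HangleiterEtAl2019, Lemma 3 (the factor 2^{½H∞(P)}), p. 5] -/
theorem two_rpow_half_minEntropy {P : ι → ℝ} (hM : 0 < pmax P) :
    (2 : ℝ) ^ (minEntropy P / 2) = pmax P ^ (-(1 / 2) : ℝ) := by
  unfold minEntropy
  conv_rhs => rw [← Real.rpow_logb (by norm_num : (0 : ℝ) < 2) (by norm_num) hM,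
    ← Real.rpow_mul (by norm_num : (0 : ℝ) ≤ 2)]
  congr 1; ring

/-- **Lemma 3 (lower bound), as printed**:
`2^{½ H_∞(P)} (1 − ε − 2^{−H_∞(P)})^{3/2} ≤ ‖P^{−max}_{−ε}‖_{2/3}` (hypothesis `ε + 2^{−H∞(P)} ≤ 1`:
the printed base is nonnegative). [cite: HangleiterEtAl2019, Lemma 3 eq. (8), p. 5] -/
theorem lemma3_lower {ε : ℝ} (hε : 0 ≤ ε) {P : ι → ℝ} (hP : ∀ i, 0 ≤ P i) (hP1 : ∑ i, P i = 1)
    (hfit : ε + (2 : ℝ) ^ (-minEntropy P) ≤ 1) :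
    (2 : ℝ) ^ (minEntropy P / 2) * (1 - ε - (2 : ℝ) ^ (-minEntropy P)) ^ (3 / 2 : ℝ) ≤
      vvNorm ε P := by
  have hM := pmax_pos hP hP1
  rw [two_rpow_neg_minEntropy hM] at hfit ⊢
  rw [two_rpow_half_minEntropy hM]
  exact vvNorm_ge hε hP hP1 hfit

/-- **Lemma 3 (upper bound), as printed**:
`‖P^{−max}_{−ε}‖_{2/3} ≤ (1 − 2^{−H_∞(P)}) ‖P^{−max}_{−ε}‖₀^{1/2}`. [cite: HangleiterEtAl2019, Lemma 3 eq. (8), p. 5] -/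
theorem lemma3_upper {ε : ℝ} (hε : 0 ≤ ε) {P : ι → ℝ} (hP : ∀ i, 0 ≤ P i) (hP1 : ∑ i, P i = 1) :
    vvNorm ε P ≤ (1 - (2 : ℝ) ^ (-minEntropy P)) * (vvSupp ε P : ℝ) ^ (1 / 2 : ℝ) := by
  rw [two_rpow_neg_minEntropy (pmax_pos hP hP1)]
  exact vvNorm_le hε hP hP1

/-! ### Eq. (25): equivalence of the Rényi entropies for `α > 1` -/

/-- `log₂(x^y) = y log₂ x` for `x > 0` (plumbing). [folklore] -/
private theorem logb_two_rpow_of_pos {x : ℝ} (hx : 0 < x) (y : ℝ) :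
    Real.logb 2 (x ^ y) = y * Real.logb 2 x := by
  unfold Real.logb
  rw [Real.log_rpow hx, mul_div_assoc]

/-- `Σ_i p_i^α ≤ (max_i p_i)^{α−1}` for `α > 1` (the step behind `H_α ≥ H_∞`).
[cite: HangleiterEtAl2019, eq. (25) and App. A, p. 7] -/
theorem sum_rpow_le_pmax_rpow {α : ℝ} (hα : 1 < α) {P : ι → ℝ} (hP : ∀ i, 0 ≤ P i)
    (hP1 : ∑ i, P i = 1) : ∑ i, P i ^ α ≤ pmax P ^ (α - 1) := by
  calc ∑ i, P i ^ α = ∑ i, P i ^ (α - 1) * P i := by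
        refine sum_congr rfl fun i _ => ?_
        rw [← Real.rpow_add_one' (hP i) (by linarith)]; ring_nf
    _ ≤ ∑ i, pmax P ^ (α - 1) * P i := by
        refine sum_le_sum fun i _ => mul_le_mul_of_nonneg_right ?_ (hP i)
        exact Real.rpow_le_rpow (hP i) (le_pmax P i) (by linarith)
    _ = pmax P ^ (α - 1) := by rw [← mul_sum, hP1, mul_one]

/-- `(max_i p_i)^α ≤ Σ_i p_i^α` (the step behind `H_∞ ≥ ((α−1)/α) H_α`). [cite: HangleiterEtAl2019, eq. (25) and App. A, p. 7] -/
theorem pmax_rpow_le_sum_rpow (α : ℝ) {P : ι → ℝ} (hP : ∀ i, 0 ≤ P i) :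
    pmax P ^ α ≤ ∑ i, P i ^ α := by
  obtain ⟨i, hi⟩ := exists_pmax_eq P
  rw [← hi]
  exact single_le_sum (f := fun j => P j ^ α) (fun j _ => Real.rpow_nonneg (hP j) _) (mem_univ i)

/-- **Eq. (25), first inequality**: `H_α(P) ≥ H_∞(P)` for `α > 1`.
[cite: HangleiterEtAl2019, eq. (25) (“Hα(P) ≥ H∞(P) ≥ ((α−1)/α) Hα(P)”), p. 7, proved in App. A] -/
theorem minEntropy_le_renyiEntropy {α : ℝ} (hα : 1 < α) {P : ι → ℝ} (hP : ∀ i, 0 ≤ P i)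
    (hP1 : ∑ i, P i = 1) : minEntropy P ≤ renyiEntropy α P := by
  have hM := pmax_pos hP hP1
  have hS : 0 < ∑ i, P i ^ α :=
    lt_of_lt_of_le (Real.rpow_pos_of_pos hM α) (pmax_rpow_le_sum_rpow α hP)
  have h1 : Real.logb 2 (∑ i, P i ^ α) ≤ (α - 1) * Real.logb 2 (pmax P) := by
    rw [← logb_two_rpow_of_pos hM]
    exact Real.logb_le_logb_of_le (by norm_num) hS (sum_rpow_le_pmax_rpow hα hP hP1)
  have hneg : (1 - α)⁻¹ < 0 := inv_lt_zero.2 (by linarith)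
  unfold minEntropy renyiEntropy
  have := mul_le_mul_of_nonpos_left h1 hneg.le
  have hne : (1 - α) ≠ 0 := (sub_neg.2 hα).ne
  have hid : (1 - α)⁻¹ * ((α - 1) * Real.logb 2 (pmax P)) = -Real.logb 2 (pmax P) := by
    field_simp
    ring
  linarith [hid]

/-- **Eq. (25), second inequality**: `H_∞(P) ≥ ((α − 1)/α) H_α(P)` for `α > 1`.
[cite: HangleiterEtAl2019, eq. (25), p. 7, proved in App. A] -/
theorem renyiEntropy_mul_le_minEntropy {α : ℝ} (hα : 1 < α) {P : ι → ℝ} (hP : ∀ i, 0 ≤ P i)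
    (hP1 : ∑ i, P i = 1) : (α - 1) / α * renyiEntropy α P ≤ minEntropy P := by
  have hM := pmax_pos hP hP1
  have hα0 : 0 < α := by linarith
  have hS : 0 < ∑ i, P i ^ α :=
    lt_of_lt_of_le (Real.rpow_pos_of_pos hM α) (pmax_rpow_le_sum_rpow α hP)
  have h1 : α * Real.logb 2 (pmax P) ≤ Real.logb 2 (∑ i, P i ^ α) := by
    rw [← logb_two_rpow_of_pos hM]
    exact Real.logb_le_logb_of_le (by norm_num) (Real.rpow_pos_of_pos hM α)
      (pmax_rpow_le_sum_rpow α hP)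
  unfold minEntropy renyiEntropy
  have hne : (1 - α) ≠ 0 := (sub_neg.2 hα).ne
  have hc : (α - 1) / α * (1 - α)⁻¹ = -α⁻¹ := by
    field_simp
    ring
  calc (α - 1) / α * ((1 - α)⁻¹ * Real.logb 2 (∑ i, P i ^ α))
      = -α⁻¹ * Real.logb 2 (∑ i, P i ^ α) := by rw [← mul_assoc, hc]
    _ ≤ -α⁻¹ * (α * Real.logb 2 (pmax P)) :=
        mul_le_mul_of_nonpos_left h1 (by simp [hα0.le])
    _ = -Real.logb 2 (pmax P) := by field_simp

omit [Nonempty ι] in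
/-- The collision entropy `H_2(P) = −log₂ Σ_S P(S)²` (eq. (23)) is `renyiEntropy 2`.
[cite: HangleiterEtAl2019, eq. (23), p. 7] -/
theorem renyiEntropy_two (P : ι → ℝ) :
    renyiEntropy 2 P = -Real.logb 2 (∑ i, P i ^ 2) := by
  unfold renyiEntropy
  have : ∀ i, P i ^ (2 : ℝ) = P i ^ 2 := fun i => Real.rpow_two (P i)
  simp_rw [this]
  norm_num

/-- Eq. (25) at `α = 2`, the form used in Lemma 5: `H_∞(P) ≥ ½ H_2(P) = −½ log₂ Σ_S P(S)²`.
[cite: HangleiterEtAl2019, Lemma 5 proof (“then use equivalence of the α-Rényi entropies for α > 1”), p. 7] -/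
theorem half_collisionEntropy_le_minEntropy {P : ι → ℝ} (hP : ∀ i, 0 ≤ P i)
    (hP1 : ∑ i, P i = 1) : -Real.logb 2 (∑ i, P i ^ 2) / 2 ≤ minEntropy P := by
  have h := renyiEntropy_mul_le_minEntropy (α := 2) (by norm_num) hP hP1
  rw [renyiEntropy_two] at h
  linarith

end entropyForms

/-! ### Lemma 5: second moments bound the min-entropy (finite ensemble, Markov) -/

section lemma5
variable [Nonempty ι] {Ω : Type*} [Fintype Ω]

/-- A probability vector has positive collision probability `Σ_S P(S)² > 0` (so `H₂` of eq. (23) is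
finite). [cite: HangleiterEtAl2019, eq. (23), p. 7] -/
theorem sum_sq_pos {P : ι → ℝ} (hP : ∀ i, 0 ≤ P i) (hP1 : ∑ i, P i = 1) : 0 < ∑ i, P i ^ 2 := by
  have hM := pmax_pos hP hP1
  obtain ⟨i, hi⟩ := exists_pmax_eq P
  exact lt_of_lt_of_le (by rw [← hi] at hM; positivity)
    (single_le_sum (f := fun j => P j ^ 2) (fun j _ => sq_nonneg _) (mem_univ i))

/-- **Lemma 5 (tail bound for the min-entropy)**, finite-ensemble form. For a family of probability
vectors `P_ω` on `E` drawn with weights `μ` (`μ ≥ 0`, `Σ μ = 1`; the printed `U ∼ μ_n`) and second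
moment `E₂ = 𝔼_ω Σ_S P_ω(S)² = Σ_S 𝔼_ω[P_ω(S)²]`, “with probability at least `1 − δ` over the choice of
`U ∼ μ_n`, `H_∞(P_U) ≥ ½(log δ − log Σ_S 𝔼[P_U(S)²])`”: the `μ`-weight of the violating `ω` is `≤ δ`
(Markov's inequality on the collision probability, eqs. (23)–(24), then eq. (25) at `α = 2`).
Finite (or finitely supported) ensembles only; the printed `μ_n` is a general measure on the unitary
group. [cite: HangleiterEtAl2019, Lemma 5 eq. (22) with proof eqs. (23)–(25), p. 7] -/
theorem lemma5 (μ : Ω → ℝ) (hμ : ∀ ω, 0 ≤ μ ω) (hμ1 : ∑ ω, μ ω = 1) (P : Ω → ι → ℝ)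
    (hP : ∀ ω i, 0 ≤ P ω i) (hP1 : ∀ ω, ∑ i, P ω i = 1) {δ : ℝ} (hδ : 0 < δ) :
    ∑ ω ∈ univ.filter (fun ω => ¬ ((Real.logb 2 δ -
        Real.logb 2 (∑ ω', μ ω' * ∑ i, P ω' i ^ 2)) / 2 ≤ minEntropy (P ω))), μ ω ≤ δ := by
  set E := ∑ ω', μ ω' * ∑ i, P ω' i ^ 2 with hE
  have hEpos : 0 < E := by
    obtain ⟨ω₀, -, hω₀⟩ : ∃ ω ∈ univ, 0 < μ ω := by
      by_contra h
      push Not at h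
      have : ∑ ω, μ ω = 0 := by
        apply le_antisymm (sum_nonpos fun ω _ => h ω (mem_univ ω)) (sum_nonneg fun ω _ => hμ ω)
      rw [this] at hμ1; exact zero_ne_one hμ1
    exact lt_of_lt_of_le (mul_pos hω₀ (sum_sq_pos (hP ω₀) (hP1 ω₀)))
      (single_le_sum (f := fun ω => μ ω * ∑ i, P ω i ^ 2)
        (fun ω _ => mul_nonneg (hμ ω) (sum_nonneg fun i _ => sq_nonneg _)) (mem_univ ω₀))
  -- a bad `ω` has a large collision probability
  have hbad : ∀ ω, ¬ ((Real.logb 2 δ - Real.logb 2 E) / 2 ≤ minEntropy (P ω)) →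
      E / δ < ∑ i, P ω i ^ 2 := by
    intro ω hω
    by_contra hle
    push Not at hle
    apply hω
    have hS := sum_sq_pos (hP ω) (hP1 ω)
    have h1 : Real.logb 2 (∑ i, P ω i ^ 2) ≤ Real.logb 2 (E / δ) :=
      Real.logb_le_logb_of_le (by norm_num) hS hle
    rw [Real.logb_div hEpos.ne' hδ.ne'] at h1
    have h2 := half_collisionEntropy_le_minEntropy (hP ω) (hP1 ω)
    linarith
  -- Markov
  have key : (E / δ) * ∑ ω ∈ univ.filter (fun ω => ¬ ((Real.logb 2 δ - Real.logb 2 E) / 2 ≤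
      minEntropy (P ω))), μ ω ≤ E := by
    rw [mul_sum]
    calc ∑ ω ∈ univ.filter _, E / δ * μ ω
        ≤ ∑ ω ∈ univ.filter (fun ω => ¬ ((Real.logb 2 δ - Real.logb 2 E) / 2 ≤
            minEntropy (P ω))), μ ω * ∑ i, P ω i ^ 2 := by
          refine sum_le_sum fun ω hω => ?_
          rw [mul_comm]
          exact mul_le_mul_of_nonneg_left (hbad ω (mem_filter.1 hω).2).le (hμ ω)
      _ ≤ ∑ ω, μ ω * ∑ i, P ω i ^ 2 :=
          sum_le_sum_of_subset_of_nonneg (filter_subset _ _) fun ω _ _ =>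
            mul_nonneg (hμ ω) (sum_nonneg fun i _ => sq_nonneg _)
  have hEd : 0 < E / δ := div_pos hEpos hδ
  calc ∑ ω ∈ univ.filter _, μ ω = (δ / E) * ((E / δ) * ∑ ω ∈ univ.filter _, μ ω) := by
        field_simp
    _ ≤ (δ / E) * E := mul_le_mul_of_nonneg_left key (div_pos hδ hEpos).le
    _ = δ := by field_simp

end lemma5

/-! ### Definition 1 (ε-certification test from `s` samples) and Theorem 2 as hypothesis -/

section certification

/-- The `ℓ₁` distance `‖P − Q‖₁`. [cite: HangleiterEtAl2019, Definition 1 eq. (7), p. 4] -/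
def l1Dist (P Q : ι → ℝ) : ℝ := ∑ i, |P i - Q i|

/-- The acceptance probability `Pr_{S ∼ Q^s}[T(S) = 1]` of a test `T : E^s → {0,1}` on `s` i.i.d.
samples (finite product-weight form: the sequences `S : Fin s → E` weighted by `Π_k Q(S_k)`).
[cite: HangleiterEtAl2019, Definition 1 (“a sequence S ∼ Q^s of s samples … drawn i.i.d. from some distribution Q”), p. 4] -/
def accProb (Q : ι → ℝ) (s : ℕ) (T : (Fin s → ι) → Bool) : ℝ :=
  ∑ S : Fin s → ι, if T S then ∏ k, Q (S k) else 0

/-- **Definition 1 (certification test).** “We call `T : E^s → {0, 1}` an `ϵ`-certification test of `P`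
from `s` samples if the following completeness and soundness conditions are satisfied for any
distribution `Q` over `E`: `Q = P ⇒ Pr_{S∼Q^s}[T(S) = 1] ≥ 2/3` (6), `∥P − Q∥₁ > ϵ ⇒ Pr_{S∼Q^s}[T(S) = 1] < 1/3` (7).”
[cite: HangleiterEtAl2019, Definition 1 eqs. (6)–(7), p. 4] -/
structure IsCertTest (P : ι → ℝ) (ε : ℝ) (s : ℕ) (T : (Fin s → ι) → Bool) : Prop where
  complete : 2 / 3 ≤ accProb P s T
  sound : ∀ Q : ι → ℝ, (∀ i, 0 ≤ Q i) → ∑ i, Q i = 1 → ε < l1Dist P Q → accProb Q s T < 1 / 3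

variable [Nonempty ι]

/-- The conclusion of **Theorem 2, lower-bound half (Valiant–Valiant [36])** for ONE target `P` and
accuracy `ε` — “there exists no `ϵ`-certification test from fewer than
`c₂ max{1/ϵ, ϵ^{−2} ∥P^{−max}_{−2ϵ}∥_{2/3}}` samples” — packaged as a predicate (Valiant–Valiant's
instance-optimal identity-testing lower bound).  The statements below that need it take it as an explicit
hypothesis; section `generalVV` (v11) PROVES it, `VVLowerBoundAt (1/11) ε P` for every probability vector on
`≥ 2` outcomes and `0 < ε ≤ 1/2` (`vvLowerBoundAt_holds`). [cite: HangleiterEtAl2019, Theorem 2 (“Optimal certification tests [36]”), p. 5] [cite: ValiantValiant2017, Thm. 1] -/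
def VVLowerBoundAt (c₂ ε : ℝ) (P : ι → ℝ) : Prop :=
  ∀ (s : ℕ) (T : (Fin s → ι) → Bool), IsCertTest P ε s T →
    c₂ * max (1 / ε) (vvNorm (2 * ε) P / ε ^ 2) ≤ s

/-- **Theorem 2 + Lemma 3** (the combination used in the proofs of Theorems 6 and 7): every
`ε`-certification test of `P` uses `s ≥ c₂ 2^{½H_∞(P)} (1 − 2ε − 2^{−H_∞(P)})^{3/2} / ε²` samples
(Theorem 2 involves `‖P^{−max}_{−2ε}‖_{2/3}`, whence `2ε`). [cite: HangleiterEtAl2019, §IV.B (“Proofs of Theorems 6 and 7. We use Theorem 2 and Lemmas 3–5 …”), p. 8] -/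
theorem samples_ge_of_vv {c₂ ε : ℝ} (hc : 0 ≤ c₂) (hε : 0 < ε) {P : ι → ℝ} (hP : ∀ i, 0 ≤ P i)
    (hP1 : ∑ i, P i = 1) (hfit : 2 * ε + (2 : ℝ) ^ (-minEntropy P) ≤ 1)
    (hVV : VVLowerBoundAt c₂ ε P) {s : ℕ} {T : (Fin s → ι) → Bool} (hT : IsCertTest P ε s T) :
    c₂ * ((2 : ℝ) ^ (minEntropy P / 2) * (1 - 2 * ε - (2 : ℝ) ^ (-minEntropy P)) ^ (3 / 2 : ℝ))
      / ε ^ 2 ≤ s := by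
  have h3 := lemma3_lower (ε := 2 * ε) (by linarith) hP hP1 hfit
  have h := hVV s T hT
  calc c₂ * ((2 : ℝ) ^ (minEntropy P / 2) * (1 - 2 * ε - (2 : ℝ) ^ (-minEntropy P)) ^ (3 / 2 : ℝ))
        / ε ^ 2 ≤ c₂ * vvNorm (2 * ε) P / ε ^ 2 := by
        gcongr
    _ = c₂ * (vvNorm (2 * ε) P / ε ^ 2) := by ring
    _ ≤ c₂ * max (1 / ε) (vvNorm (2 * ε) P / ε ^ 2) :=
        mul_le_mul_of_nonneg_left (le_max_right _ _) hc
    _ ≤ s := h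

/-- **Eq. (9)**: “If for some constant `κ` it holds that `H_∞(P) = log(κ|E_n|)`, …
`s_min² ≥ c₂² (κ|E_n|/ϵ⁴)(1 − 2ϵ − 1/(κ|E_n|))³`” — “for all distributions whose min-entropy is essentially
given by the logarithm of the size `|E_n|` of the sample space, the sample complexity for certification
thus scales at least as the square root of that size”. [cite: HangleiterEtAl2019, eq. (9), p. 5] -/
theorem samples_sq_ge_flat {c₂ ε κ : ℝ} (hc : 0 ≤ c₂) (hε : 0 < ε) {P : ι → ℝ}
    (hP : ∀ i, 0 ≤ P i) (hP1 : ∑ i, P i = 1)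
    (hκ : pmax P = (κ * Fintype.card ι)⁻¹) (hfit : 2 * ε + (κ * Fintype.card ι)⁻¹ ≤ 1)
    (hVV : VVLowerBoundAt c₂ ε P) {s : ℕ} {T : (Fin s → ι) → Bool} (hT : IsCertTest P ε s T) :
    c₂ ^ 2 * (κ * Fintype.card ι) * (1 - 2 * ε - (κ * Fintype.card ι)⁻¹) ^ 3 / ε ^ 4
      ≤ (s : ℝ) ^ 2 := by
  have hM := pmax_pos hP hP1
  have hfit' : 2 * ε + (2 : ℝ) ^ (-minEntropy P) ≤ 1 := by
    rwa [two_rpow_neg_minEntropy hM, hκ]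
  have h := samples_ge_of_vv hc hε hP hP1 hfit' hVV hT
  rw [two_rpow_neg_minEntropy hM, two_rpow_half_minEntropy hM, hκ] at h
  set N := κ * Fintype.card ι with hN
  have hNpos : 0 < N⁻¹ := by rw [← hκ]; exact hM
  have hB : 0 ≤ 1 - 2 * ε - N⁻¹ := by linarith
  have hL : 0 ≤ c₂ * (N⁻¹ ^ (-(1 / 2) : ℝ) * (1 - 2 * ε - N⁻¹) ^ (3 / 2 : ℝ)) / ε ^ 2 := by
    positivity
  have hsq := pow_le_pow_left₀ hL h 2
  refine le_trans (le_of_eq ?_) hsq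
  rw [div_pow, mul_pow, mul_pow, ← Real.rpow_natCast (N⁻¹ ^ (-(1 / 2) : ℝ)),
    ← Real.rpow_natCast ((1 - 2 * ε - N⁻¹) ^ (3 / 2 : ℝ)), ← Real.rpow_mul hNpos.le,
    ← Real.rpow_mul hB]
  norm_num
  rw [Real.rpow_neg_one, inv_inv]
  ring

end certification

/-! ### From a second-moment bound to a certification lower bound (the common skeleton of Theorems 6–7) -/

section ensemble
variable [Nonempty ι] {Ω : Type*} [Fintype Ω]

/-- **Lemma 5 with an explicit second-moment bound `B`**: if `Σ_ω μ_ω Σ_S P_ω(S)² ≤ B` then for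
every threshold `t ≤ ½(log₂ δ − log₂ B)` the weight of the `ω` with `H_∞(P_ω) < t` is at most `δ`
(“the same second moment bound that is used to derive anti-concentration implies a high
min-entropy”). [cite: HangleiterEtAl2019, Lemma 5 and §IV.A, p. 7] -/
theorem minEntropy_tail_of_second_moment (μ : Ω → ℝ) (hμ : ∀ ω, 0 ≤ μ ω) (hμ1 : ∑ ω, μ ω = 1)
    (P : Ω → ι → ℝ) (hP : ∀ ω i, 0 ≤ P ω i) (hP1 : ∀ ω, ∑ i, P ω i = 1) {δ B t : ℝ} (hδ : 0 < δ)
    (hB : ∑ ω, μ ω * ∑ i, P ω i ^ 2 ≤ B) (ht : t ≤ (Real.logb 2 δ - Real.logb 2 B) / 2) :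
    ∑ ω ∈ univ.filter (fun ω => ¬ (t ≤ minEntropy (P ω))), μ ω ≤ δ := by
  set E := ∑ ω, μ ω * ∑ i, P ω i ^ 2 with hE
  have hEpos : 0 < E := by
    obtain ⟨ω₀, -, hω₀⟩ : ∃ ω ∈ univ, 0 < μ ω := by
      by_contra h
      push Not at h
      have : ∑ ω, μ ω = 0 :=
        le_antisymm (sum_nonpos fun ω _ => h ω (mem_univ ω)) (sum_nonneg fun ω _ => hμ ω)
      rw [this] at hμ1; exact zero_ne_one hμ1
    exact lt_of_lt_of_le (mul_pos hω₀ (sum_sq_pos (hP ω₀) (hP1 ω₀)))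
      (single_le_sum (f := fun ω => μ ω * ∑ i, P ω i ^ 2)
        (fun ω _ => mul_nonneg (hμ ω) (sum_nonneg fun i _ => sq_nonneg _)) (mem_univ ω₀))
  have hthr : t ≤ (Real.logb 2 δ - Real.logb 2 E) / 2 := by
    have := Real.logb_le_logb_of_le (b := 2) (by norm_num) hEpos hB
    linarith
  refine le_trans (sum_le_sum_of_subset_of_nonneg ?_ fun ω _ _ => hμ ω)
    (lemma5 μ hμ hμ1 P hP hP1 hδ)
  intro ω
  simp only [mem_filter, mem_univ, true_and, not_le]
  exact fun hω => lt_of_lt_of_le hω hthr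

/-- **The skeleton of Theorems 6–7.** For a finite weighted ensemble of target distributions with
second moment `Σ_ω μ_ω Σ_S P_ω(S)² ≤ B`, Theorem 2 for each `P_ω` as hypothesis, any threshold
`t ≤ ½(log₂ δ − log₂ B)` with `2ε + 2^{−t} ≤ 1`, and any `L ≤ c₂ 2^{t/2} (1 − 2ε − 2^{−t})^{3/2} / ε²`:
the ensemble weight of the `ω` admitting an `ε`-certification test from fewer than `L` samples is at
most `δ` (Lemma 5, then Lemma 3 + Theorem 2 monotonically in `H_∞`). [cite: HangleiterEtAl2019, §IV.B (“Proofs of Theorems 6 and 7. We use Theorem 2 and Lemmas 3–5 as well as the lower bounds … on the min-entropy”), p. 8] -/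
theorem certification_lower_bound_of_second_moment (μ : Ω → ℝ) (hμ : ∀ ω, 0 ≤ μ ω)
    (hμ1 : ∑ ω, μ ω = 1) (P : Ω → ι → ℝ) (hP : ∀ ω i, 0 ≤ P ω i) (hP1 : ∀ ω, ∑ i, P ω i = 1)
    {c₂ ε δ B t L : ℝ} (hc : 0 ≤ c₂) (hε : 0 < ε) (hδ : 0 < δ)
    (hB : ∑ ω, μ ω * ∑ i, P ω i ^ 2 ≤ B) (ht : t ≤ (Real.logb 2 δ - Real.logb 2 B) / 2)
    (hfit : 2 * ε + (2 : ℝ) ^ (-t) ≤ 1)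
    (hL : L ≤ c₂ * ((2 : ℝ) ^ (t / 2) * (1 - 2 * ε - (2 : ℝ) ^ (-t)) ^ (3 / 2 : ℝ)) / ε ^ 2)
    (hVV : ∀ ω, VVLowerBoundAt c₂ ε (P ω))
    [DecidablePred fun ω : Ω =>
      ¬ (∀ (s : ℕ) (T : (Fin s → ι) → Bool), IsCertTest (P ω) ε s T → L ≤ s)] :
    ∑ ω ∈ univ.filter (fun ω : Ω =>
      ¬ (∀ (s : ℕ) (T : (Fin s → ι) → Bool), IsCertTest (P ω) ε s T → L ≤ s)), μ ω ≤ δ := by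
  refine le_trans (sum_le_sum_of_subset_of_nonneg ?_ fun ω _ _ => hμ ω)
    (minEntropy_tail_of_second_moment μ hμ hμ1 P hP hP1 hδ hB ht)
  intro ω
  simp only [mem_filter, mem_univ, true_and]
  intro hω hgood
  apply hω
  intro s T hT
  have hmono1 : (2 : ℝ) ^ (t / 2) ≤ (2 : ℝ) ^ (minEntropy (P ω) / 2) :=
    Real.rpow_le_rpow_of_exponent_le (by norm_num) (by linarith)
  have hmono2 : (2 : ℝ) ^ (-minEntropy (P ω)) ≤ (2 : ℝ) ^ (-t) :=
    Real.rpow_le_rpow_of_exponent_le (by norm_num) (by linarith)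
  have hfit' : 2 * ε + (2 : ℝ) ^ (-minEntropy (P ω)) ≤ 1 := by linarith
  have hB0 : 0 ≤ 1 - 2 * ε - (2 : ℝ) ^ (-t) := by linarith
  refine hL.trans (le_trans ?_ (samples_ge_of_vv hc hε (hP ω) (hP1 ω) hfit' (hVV ω) hT))
  gcongr

/-- The closed forms of a threshold `t = ½(a + log₂ q)` (`q > 0`):
`2^{t/2} = 2^{a/4} q^{1/4}` and `2^{−t} = 2^{−a/2} q^{−1/2}` (plumbing for eqs. (27)–(28)). [folklore] -/
private theorem two_rpow_threshold {q : ℝ} (hq : 0 < q) (a : ℝ) :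
    (2 : ℝ) ^ ((a + Real.logb 2 q) / 2 / 2) = (2 : ℝ) ^ (a / 4) * q ^ (1 / 4 : ℝ)
    ∧ (2 : ℝ) ^ (-((a + Real.logb 2 q) / 2)) = (2 : ℝ) ^ (-a / 2) * q ^ (-(1 / 2) : ℝ) := by
  constructor
  · rw [show (a + Real.logb 2 q) / 2 / 2 = a / 4 + Real.logb 2 q * (1 / 4) by ring,
      Real.rpow_add (by norm_num), Real.rpow_mul (by norm_num), Real.rpow_logb (by norm_num)
      (by norm_num) hq]
  · rw [show -((a + Real.logb 2 q) / 2) = -a / 2 + Real.logb 2 q * (-(1 / 2)) by ring,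
      Real.rpow_add (by norm_num), Real.rpow_mul (by norm_num), Real.rpow_logb (by norm_num)
      (by norm_num) hq]

open Classical in
/-- **Theorem 7b (spherical 2-designs), modulo Theorem 2 and with the design second-moment bound
(33) as hypothesis.** For a finite weighted circuit ensemble whose output distributions on a sample
space of size `N` satisfy `𝔼_ω[P_ω(S)²] ≤ 2(1+ε̃)/(N(N+1))` for every outcome `S` (eq. (33), “for any
circuit family … such that {U|0⟩} forms a relative ε̃-approximate spherical 2-design”), put `a = log₂ N`
(`= n` for `n` qubits) and `q = δ/(2(1+ε̃))`; then (eq. (34): `H_∞(P_U) ≥ ½(n + log(δ/(2(1+ε̃))))` off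
weight `δ`) the weight of the `ω` admitting an `ε`-certification test from fewer than
`c₂ 2^{a/4} q^{1/4} (1 − 2ε − 2^{−a/2} q^{−1/2})^{3/2} / ε²` samples is at most `δ` — eq. (28),
`s_min ∈ Ω(2^{n/4} δ^{1/4} / (ϵ² (1+ε̃)^{1/4}))` with the constant factor `(1 − 2ϵ − 2^{−H∞})^{3/2}` kept
explicit (“can be lower-bounded by a constant and, hence, be dropped inside the Ω”).  The 2-design
property itself (Brandão–Harrow–Horodecki) is NOT formalised: (33) is the hypothesis `h33`.
[cite: HangleiterEtAl2019, Theorem 7b eq. (28) and §V.B eqs. (33)–(34), p. 8–9] -/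
theorem design_certification_lower_bound (μ : Ω → ℝ) (hμ : ∀ ω, 0 ≤ μ ω) (hμ1 : ∑ ω, μ ω = 1)
    (P : Ω → ι → ℝ) (hP : ∀ ω i, 0 ≤ P ω i) (hP1 : ∀ ω, ∑ i, P ω i = 1)
    {c₂ ε δ εd : ℝ} (hc : 0 ≤ c₂) (hε : 0 < ε) (hδ : 0 < δ) (hεd : 0 ≤ εd)
    (h33 : ∀ i, ∑ ω, μ ω * P ω i ^ 2 ≤
      2 * (1 + εd) / ((Fintype.card ι : ℝ) * (Fintype.card ι + 1)))
    (hfit : 2 * ε + (2 : ℝ) ^ (-Real.logb 2 (Fintype.card ι) / 2) *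
      (δ / (2 * (1 + εd))) ^ (-(1 / 2) : ℝ) ≤ 1)
    (hVV : ∀ ω, VVLowerBoundAt c₂ ε (P ω)) :
    ∑ ω ∈ univ.filter (fun ω : Ω =>
        ¬ (∀ (s : ℕ) (T : (Fin s → ι) → Bool), IsCertTest (P ω) ε s T →
          c₂ * ((2 : ℝ) ^ (Real.logb 2 (Fintype.card ι) / 4) * (δ / (2 * (1 + εd))) ^ (1 / 4 : ℝ) *
            (1 - 2 * ε - (2 : ℝ) ^ (-Real.logb 2 (Fintype.card ι) / 2) *
              (δ / (2 * (1 + εd))) ^ (-(1 / 2) : ℝ)) ^ (3 / 2 : ℝ)) / ε ^ 2 ≤ s)), μ ω ≤ δ := by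
  have hN : (0 : ℝ) < Fintype.card ι := by exact_mod_cast Fintype.card_pos
  have hq : 0 < δ / (2 * (1 + εd)) := by positivity
  -- (33) summed over the `N` outcomes: second moment ≤ 2(1+ε̃)/(N+1) ≤ 2(1+ε̃)/N =: B
  set B := 2 * (1 + εd) / (Fintype.card ι : ℝ) with hBdef
  have hB : ∑ ω, μ ω * ∑ i, P ω i ^ 2 ≤ B := by
    calc ∑ ω, μ ω * ∑ i, P ω i ^ 2 = ∑ i, ∑ ω, μ ω * P ω i ^ 2 := by
          rw [sum_comm]; exact sum_congr rfl fun ω _ => mul_sum _ _ _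
      _ ≤ ∑ _i : ι, 2 * (1 + εd) / ((Fintype.card ι : ℝ) * (Fintype.card ι + 1)) :=
          sum_le_sum fun i _ => h33 i
      _ = 2 * (1 + εd) / (Fintype.card ι + 1) := by
          rw [sum_const, card_univ, nsmul_eq_mul]; field_simp
      _ ≤ B := by
          rw [hBdef]; gcongr; linarith
  -- the thresholds coincide: log₂ δ − log₂ B = log₂ N + log₂(δ/(2(1+ε̃)))
  have hlog : Real.logb 2 δ - Real.logb 2 B =
      Real.logb 2 (Fintype.card ι) + Real.logb 2 (δ / (2 * (1 + εd))) := by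
    rw [hBdef, Real.logb_div (by positivity) hN.ne', Real.logb_div hδ.ne' (by positivity)]
    ring
  obtain ⟨h1, h2⟩ := two_rpow_threshold hq (Real.logb 2 (Fintype.card ι))
  exact certification_lower_bound_of_second_moment μ hμ hμ1 P hP hP1 hc hε hδ hB
    (t := (Real.logb 2 (Fintype.card ι) + Real.logb 2 (δ / (2 * (1 + εd)))) / 2)
    (by rw [hlog]) (by rw [h2]; exact hfit) (by rw [h1, h2]) hVV

end ensemble

/-! ### Theorem 7a for the IQP family `𝒞_f`, `f = h + (uniformly random degree ≤ 2 part)` -/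

section iqp
open IQPAnticoncentration

variable {V : Type*} [Fintype V] [DecidableEq V]

/-- The output distribution `p_f(x) = |⟨x|𝒞_f|0ⁿ⟩|²` of the IQP circuit `𝒞_f = H^{⊗n} 𝒞̃_f H^{⊗n}` of
`f = poly h β γ` (a fixed degree-`> 2` part `h` plus the uniformly random degree-`≤ 2` part), as a real
probability vector on `𝔽₂^V` — the tree's `IQPAnticoncentration.outputProb`; this is the
`{Z, CZ, CCZ}`-family of Bremner–Montanaro–Shepherd, the `𝔽₂`-reading of “IQP circuit sampling on
`n` qubits” (the angle family (29) is treated in section `ising` below).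
[cite: HangleiterEtAl2019, §IV (“P_U(S) := |⟨S|U|S₀⟩|²”) and §V.A, p. 6–8] [cite: BremnerMontanaroShepherd2016, p. 5 (“p_{0y} = Pr[𝒞₀ outputs y] = |⟨y|𝒞₀|0⟩|²”)] -/
def iqpDist (h : (V → ZMod 2) → ZMod 2) (ω : (V → V → ZMod 2) × (V → ZMod 2)) :
    (V → ZMod 2) → ℝ :=
  fun x => outputProb (K := ℝ) (poly h ω.1 ω.2) x

/-- Output probabilities `P_U(S) = |⟨S|U|S₀⟩|²` are nonnegative. [cite: HangleiterEtAl2019, §IV (“P_U(S) := |⟨S|U|S₀⟩|²”), p. 6] -/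
theorem iqpDist_nonneg (h : (V → ZMod 2) → ZMod 2) (ω : (V → V → ZMod 2) × (V → ZMod 2))
    (x : V → ZMod 2) : 0 ≤ iqpDist h ω x := by
  unfold iqpDist outputProb; exact sq_nonneg _

/-- Output probabilities sum to `1` (the tree's Parseval `sum_outputProb`). [cite: BremnerMontanaroShepherd2016, p. 5] -/
theorem sum_iqpDist (h : (V → ZMod 2) → ZMod 2) (ω : (V → V → ZMod 2) × (V → ZMod 2)) :
    ∑ x, iqpDist h ω x = 1 := by
  unfold iqpDist; exact sum_outputProb (K := ℝ) _

omit [DecidableEq V] in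
/-- An output string only shifts the linear coefficients: `f_x = poly h β (γ + x)`.
[cite: BremnerMontanaroShepherd2016, p. 5 (“p_{0y} = |⟨y|𝒞₀|0⟩|² = |⟨0|𝒞_y|0⟩|²”) and App. (“the random γ_i coefficients correspond to applying X gates”)] -/
theorem poly_shift (h : (V → ZMod 2) → ZMod 2) (β : V → V → ZMod 2) (γ x : V → ZMod 2) :
    (fun y => poly h β γ y + x ⬝ᵥ y) = poly h β (γ + x) := by
  funext y
  simp only [poly, quadPart, Pi.add_apply, dotProduct, add_mul, sum_add_distrib]
  ring

/-- `p_{β,γ}(x) = ngap(poly h β (γ + x))²`. [cite: BremnerMontanaroShepherd2016, p. 5] -/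
theorem iqpDist_eq (h : (V → ZMod 2) → ZMod 2) (β : V → V → ZMod 2) (γ x : V → ZMod 2) :
    iqpDist h (β, γ) x = (ngap (poly h β (γ + x)) : ℝ) ^ 2 := by
  unfold iqpDist outputProb
  rw [poly_shift]

/-- **Eq. (30) summed over the outputs**: `Σ_x 𝔼_{β,γ}[p(x)²] ≤ 3·2^{−n}`, from the tree's
second-moment bound `𝔼_{β,γ}[ngap⁴] ≤ 3·2^{−2n}` (“Bremner et al. [16, Appendix F] prove the second-moment
bound `𝔼_W[|⟨S|U_W|0⟩|⁴] ≤ 3·2^{−2n}`”) and the shift symmetry `p_{β,γ}(x) = ngap(poly h β (γ+x))²`.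
[cite: HangleiterEtAl2019, §V.A eq. (30), p. 8] [cite: BremnerMontanaroShepherd2016, App. F Lemma 12] -/
theorem avg_sum_iqpDist_sq_le (h : (V → ZMod 2) → ZMod 2) :
    (∑ ω : (V → V → ZMod 2) × (V → ZMod 2), ∑ x, iqpDist h ω x ^ 2) /
        Fintype.card ((V → V → ZMod 2) × (V → ZMod 2)) ≤ 3 / (2 : ℝ) ^ Fintype.card V := by
  have hcardx : (Fintype.card (V → ZMod 2) : ℝ) = (2 : ℝ) ^ Fintype.card V := by
    rw [Fintype.card_fun, ZMod.card]; push_cast; ring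
  -- regroup: for fixed `β`, `Σ_γ Σ_x ngap(poly h β (γ+x))⁴ = 2ⁿ Σ_γ ngap(poly h β γ)⁴`
  have hre : ∑ ω : (V → V → ZMod 2) × (V → ZMod 2), ∑ x, iqpDist h ω x ^ 2 =
      (2 : ℝ) ^ Fintype.card V * ∑ β : V → V → ZMod 2, ∑ γ : V → ZMod 2,
        (ngap (poly h β γ) : ℝ) ^ 4 := by
    rw [Fintype.sum_prod_type, mul_sum]
    refine sum_congr rfl fun β _ => ?_
    have h4 : ∀ γ x : V → ZMod 2, iqpDist h (β, γ) x ^ 2 = (ngap (poly h β (γ + x)) : ℝ) ^ 4 := by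
      intro γ x; rw [iqpDist_eq]; ring
    simp_rw [h4]
    rw [sum_comm]
    have hin : ∀ x : V → ZMod 2, ∑ γ : V → ZMod 2, (ngap (poly h β (γ + x)) : ℝ) ^ 4 =
        ∑ γ : V → ZMod 2, (ngap (poly h β γ) : ℝ) ^ 4 := fun x =>
      Fintype.sum_equiv (Equiv.addRight x) _ _ fun γ => rfl
    simp_rw [hin]
    rw [sum_const, card_univ, nsmul_eq_mul, hcardx]
  rw [hre]
  have hL := avg_ngap_pow_four_le (V := V) h
  have hpos : (0 : ℝ) < (Fintype.card (V → V → ZMod 2) : ℝ) * Fintype.card (V → ZMod 2) := by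
    positivity
  rw [Fintype.card_prod]
  push_cast
  rw [div_le_iff₀ hpos] at hL
  rw [div_le_div_iff₀ hpos (by positivity)]
  calc (2 : ℝ) ^ Fintype.card V *
        (∑ β : V → V → ZMod 2, ∑ γ : V → ZMod 2, (ngap (poly h β γ) : ℝ) ^ 4) *
        (2 : ℝ) ^ Fintype.card V
      ≤ (2 : ℝ) ^ Fintype.card V * (3 / ((2 : ℝ) ^ Fintype.card V) ^ 2 *
        ((Fintype.card (V → V → ZMod 2) : ℝ) * Fintype.card (V → ZMod 2))) *
        (2 : ℝ) ^ Fintype.card V := by gcongr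
    _ = 3 * ((Fintype.card (V → V → ZMod 2) : ℝ) * Fintype.card (V → ZMod 2)) := by
        field_simp

/-- Eq. (30) in ensemble form: with uniform weights on the `2^{n²}·2ⁿ` coefficient choices,
`𝔼_ω Σ_x p_ω(x)² ≤ 3·2^{−n}`. [cite: HangleiterEtAl2019, §V.A eq. (30), p. 8] -/
theorem iqp_uniform_second_moment (h : (V → ZMod 2) → ZMod 2) :
    ∑ ω : (V → V → ZMod 2) × (V → ZMod 2),
      (Fintype.card ((V → V → ZMod 2) × (V → ZMod 2)) : ℝ)⁻¹ * ∑ x, iqpDist h ω x ^ 2 ≤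
      3 / (2 : ℝ) ^ Fintype.card V := by
  rw [← mul_sum, inv_mul_eq_div]
  exact avg_sum_iqpDist_sq_le h

/-- `log₂ δ − log₂(3·2^{−n}) = n + log₂(δ/3)`: Lemma 5's threshold for `B = 3·2^{−n}` is the printed
threshold of eq. (31). [cite: HangleiterEtAl2019, eq. (31), p. 8] -/
theorem iqp_threshold_eq {δ : ℝ} (hδ : 0 < δ) (n : ℕ) :
    Real.logb 2 δ - Real.logb 2 (3 / (2 : ℝ) ^ n) = n + Real.logb 2 (δ / 3) := by
  rw [Real.logb_div (by norm_num) (by positivity), Real.logb_div hδ.ne' (by norm_num),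
    ← Real.rpow_natCast, Real.logb_rpow (by norm_num) (by norm_num)]
  ring

/-- **Eq. (31): min-entropy tail bound for IQP circuits.** “By Lemma 5, this implies the following
min-entropy bound `H_∞(P_{U_W}) ≥ ½(n + log(δ/3))` (31), which holds with probability at least `1 − δ` over
the choice of `U_W`”: for every `δ > 0` and every fixed degree-`> 2` part `h`, at most a `δ`-fraction of
the degree-`≤ 2` coefficients `(β, γ)` violate it. [cite: HangleiterEtAl2019, §V.A eq. (31), p. 8] -/
theorem iqp_minEntropy_tail (h : (V → ZMod 2) → ZMod 2) {δ : ℝ} (hδ : 0 < δ) :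
    ((univ.filter fun ω : (V → V → ZMod 2) × (V → ZMod 2) =>
        ¬ ((Fintype.card V + Real.logb 2 (δ / 3)) / 2 ≤ minEntropy (iqpDist h ω))).card : ℝ) ≤
      δ * Fintype.card ((V → V → ZMod 2) × (V → ZMod 2)) := by
  set Ω := (V → V → ZMod 2) × (V → ZMod 2)
  have hN : (0 : ℝ) < Fintype.card Ω := by positivity
  have L := minEntropy_tail_of_second_moment (ι := V → ZMod 2)
    (fun _ : Ω => (Fintype.card Ω : ℝ)⁻¹) (fun _ => by positivity)
    (by rw [sum_const, card_univ, nsmul_eq_mul, mul_inv_cancel₀ hN.ne'])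
    (iqpDist h) (iqpDist_nonneg h) (sum_iqpDist h) hδ (iqp_uniform_second_moment h)
    (t := (Fintype.card V + Real.logb 2 (δ / 3)) / 2) (by rw [iqp_threshold_eq hδ])
  rw [sum_const, nsmul_eq_mul, mul_inv_le_iff₀ hN] at L
  exact L

open Classical in
/-- **Theorem 7a (lower bounds on certifying IQP circuit sampling), explicit form modulo
Theorem 2.** “For `0 < ϵ < 1/2` and sufficiently large `n`, with probability at least `1 − δ`, there exists
no `ϵ`-certification test from `s < s_min` many samples for a. IQP circuit sampling on `n` qubits, where
`s_min ∈ Ω(2^{n/4} δ^{1/4} / ϵ²)` (27)”: assuming Theorem 2 for each output distribution of the family,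
for all but a `δ`-fraction of the coefficients `(β, γ)` every `ε`-certification test of `p_f` uses at least
`c₂ 2^{n/4} (δ/3)^{1/4} (1 − 2ε − 2^{−n/2}(δ/3)^{−1/2})^{3/2} / ε²` samples (the last factor is the printed
`(1 − 2ϵ − 2^{−H∞})^{3/2}` at the eq.-(31) threshold, “lower-bounded by a constant and … dropped inside
the Ω”; “sufficiently large `n`” = the hypothesis `hfit`). [cite: HangleiterEtAl2019, Theorem 7a eq. (27) and its proof, p. 8] -/
theorem iqp_certification_lower_bound (h : (V → ZMod 2) → ZMod 2) {c₂ ε δ : ℝ} (hc : 0 ≤ c₂)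
    (hε : 0 < ε) (hδ : 0 < δ)
    (hfit : 2 * ε + (2 : ℝ) ^ (-(Fintype.card V : ℝ) / 2) * (δ / 3) ^ (-(1 / 2) : ℝ) ≤ 1)
    (hVV : ∀ ω : (V → V → ZMod 2) × (V → ZMod 2), VVLowerBoundAt c₂ ε (iqpDist h ω)) :
    ((univ.filter fun ω : (V → V → ZMod 2) × (V → ZMod 2) =>
        ¬ (∀ (s : ℕ) (T : (Fin s → (V → ZMod 2)) → Bool), IsCertTest (iqpDist h ω) ε s T →
          c₂ * ((2 : ℝ) ^ ((Fintype.card V : ℝ) / 4) * (δ / 3) ^ (1 / 4 : ℝ) *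
            (1 - 2 * ε - (2 : ℝ) ^ (-(Fintype.card V : ℝ) / 2) * (δ / 3) ^ (-(1 / 2) : ℝ))
              ^ (3 / 2 : ℝ)) / ε ^ 2 ≤ s)).card : ℝ) ≤
      δ * Fintype.card ((V → V → ZMod 2) × (V → ZMod 2)) := by
  set Ω := (V → V → ZMod 2) × (V → ZMod 2)
  have hN : (0 : ℝ) < Fintype.card Ω := by positivity
  have hq : 0 < δ / 3 := by positivity
  obtain ⟨h1, h2⟩ := two_rpow_threshold hq (Fintype.card V : ℝ)
  have L := certification_lower_bound_of_second_moment (ι := V → ZMod 2)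
    (fun _ : Ω => (Fintype.card Ω : ℝ)⁻¹) (fun _ => by positivity)
    (by rw [sum_const, card_univ, nsmul_eq_mul, mul_inv_cancel₀ hN.ne'])
    (iqpDist h) (iqpDist_nonneg h) (sum_iqpDist h) hc hε hδ (iqp_uniform_second_moment h)
    (t := (Fintype.card V + Real.logb 2 (δ / 3)) / 2) (by rw [iqp_threshold_eq hδ])
    (by rw [h2]; exact hfit) (by rw [h1, h2]) hVV
  rw [sum_const, nsmul_eq_mul, mul_inv_le_iff₀ hN] at L
  exact L

end iqp

/-! ### Theorem 7a for the Ising-angle IQP family of eq. (29): `A = {0, π/8, …, 7π/8}` -/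

section ising
open IQPAnticoncentration GraphStateCutRank

variable {V : Type*} [Fintype V] [DecidableEq V] [LinearOrder V]

omit [Fintype V] [DecidableEq V] [LinearOrder V] in
/-- `χ(Σ_k a_k) = Π_k χ(a_k)` for the sign character `χ(a) = (−1)^a` of `𝔽₂`. [folklore] -/
private theorem chi_finset_sum {κ : Type*} (s : Finset κ) (f : κ → ZMod 2) :
    (chi (∑ k ∈ s, f k) : ℂ) = ∏ k ∈ s, (chi (f k) : ℂ) := by
  classical
  induction s using Finset.induction_on with
  | empty => simp
  | insert a s ha ih => rw [sum_insert ha, prod_insert ha, chi_add, ih]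

/-- The amplitude numerator `A_{w,v}(S) = Σ_{x ∈ 𝔽₂ⁿ} (−1)^{S·x} ω^{Σ_{i<j} w_{ij} z_iz_j + Σ_k v_k z_k}`,
`z_k = 1 − 2x_k`, `ω = e^{iπ/8}`: for the X-program `U_W = exp(i Σ_{i<j} w_{ij} X_iX_j + i Σ_i w_{ii} X_i)` of
eq. (29) with angles `w ∈ A = {0, π/8, …, 7π/8}` one has `⟨S|U_W|0ⁿ⟩ = 2^{−n} A_{w,v}(S)` (expand in the
`X`-eigenbasis `H^{⊗n}|x⟩`, on which `X_k = z_k` and `⟨S|H^{⊗n}|x⟩⟨x|H^{⊗n}|0ⁿ⟩ = 2^{−n}(−1)^{S·x}`);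
`A_{w,v}(0ⁿ)` is the tree's random-Ising partition function `isingZ` (`isingAmp_zero`).
[cite: HangleiterEtAl2019, §V.A eq. (29) (“U_W = exp(i Σ_{i<j} w_{i,j} X_iX_j + Σ_i w_{i,i} X_i) … A = {0, π/8, …, 7π/8}”), p. 8] [cite: BremnerMontanaroShepherd2016, p. 3 eq. (1)] -/
def isingAmp (ω : ℂ) (w : LtPair V → Fin 8) (v : V → Fin 8) (S : V → ZMod 2) : ℂ :=
  ∑ x : V → ZMod 2, (chi (S ⬝ᵥ x) : ℂ) * ω ^ isingExp w v x

/-- The output distribution `P_{U_W}(S) = |⟨S|U_W|0ⁿ⟩|² = 4^{−n} |A_{w,v}(S)|²` of the angle family (29),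
indexed by the weights `W = (w, v)` (edge weights `w_{ij}`, `i < j`, and vertex weights `v_k = w_{kk}`, all
in `{0,…,7}·π/8`). [cite: HangleiterEtAl2019, §IV (“P_U(S) := |⟨S|U|S₀⟩|²”) and §V.A eq. (29), p. 6–8] -/
def isingDist (ω : ℂ) (wv : (LtPair V → Fin 8) × (V → Fin 8)) (S : V → ZMod 2) : ℝ :=
  ‖isingAmp ω wv.1 wv.2 S‖ ^ 2 / (4 : ℝ) ^ Fintype.card V

/-- `A_{w,v}(0ⁿ) = Z(ω)`, the tree's `IQPAnticoncentration.isingZ`. [cite: BremnerMontanaroShepherd2016, p. 3 eq. (1)] -/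
theorem isingAmp_zero (ω : ℂ) (w : LtPair V → Fin 8) (v : V → Fin 8) :
    isingAmp ω w v 0 = isingZ ω w v := by
  simp [isingAmp, isingZ]

/-- Output probabilities `P_U(S) = |⟨S|U|S₀⟩|²` are nonnegative. [cite: HangleiterEtAl2019, §IV (“P_U(S) := |⟨S|U|S₀⟩|²”), p. 6] -/
theorem isingDist_nonneg (ω : ℂ) (wv : (LtPair V → Fin 8) × (V → Fin 8)) (S : V → ZMod 2) :
    0 ≤ isingDist ω wv S := by
  unfold isingDist; positivity

omit [LinearOrder V] in
/-- **Parseval for the `(−1)^{S·x}` transform**: `Σ_S |Σ_x (−1)^{S·x} a_x|² = 2ⁿ Σ_x |a_x|²`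
(orthogonality `Σ_S (−1)^{S·(x+y)} = 2ⁿ[x = y]`, the tree's `sum_chi_dotProduct`) — the normalisation
computation “`(1/2ⁿ) 𝔼_𝒟 Σ_x |⟨x|𝒟|0⟩|² = 1/2ⁿ`”. [cite: BremnerMontanaroShepherd2016, p. 5 (“= (1/2ⁿ) 𝔼_𝒟 Σ_{x∈{0,1}ⁿ} |⟨x|𝒟|0⟩|² = 1/2ⁿ”)] -/
theorem sum_norm_sq_chi_transform (a : (V → ZMod 2) → ℂ) :
    ∑ S : V → ZMod 2, ‖∑ x : V → ZMod 2, (chi (S ⬝ᵥ x) : ℂ) * a x‖ ^ 2 =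
      (2 : ℝ) ^ Fintype.card V * ∑ x, ‖a x‖ ^ 2 := by
  classical
  have hconj : ∀ b : ZMod 2, (starRingEnd ℂ) (chi b : ℂ) = chi b := by
    intro b; unfold chi; simp
  -- complexify
  have key : (∑ S : V → ZMod 2, ((‖∑ x : V → ZMod 2, (chi (S ⬝ᵥ x) : ℂ) * a x‖ : ℂ)) ^ 2) =
      (2 : ℂ) ^ Fintype.card V * ∑ x, ((‖a x‖ : ℂ)) ^ 2 := by
    simp_rw [← Complex.mul_conj', map_sum, map_mul, hconj, sum_mul_sum]
    -- Σ_S Σ_x Σ_y χ(S·x) a_x χ(S·y) ā_y = Σ_x Σ_y a_x ā_y Σ_S χ(S·(x+y))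
    rw [sum_comm]
    have inner : ∀ x : V → ZMod 2, ∑ S : V → ZMod 2, ∑ y : V → ZMod 2,
        (chi (S ⬝ᵥ x) : ℂ) * a x * ((chi (S ⬝ᵥ y) : ℂ) * (starRingEnd ℂ) (a y)) =
        (2 : ℂ) ^ Fintype.card V * (a x * (starRingEnd ℂ) (a x)) := by
      intro x
      rw [sum_comm]
      have hy : ∀ y : V → ZMod 2, ∑ S : V → ZMod 2,
          (chi (S ⬝ᵥ x) : ℂ) * a x * ((chi (S ⬝ᵥ y) : ℂ) * (starRingEnd ℂ) (a y)) =
          (a x * (starRingEnd ℂ) (a y)) * ∑ S : V → ZMod 2, (chi (S ⬝ᵥ (x + y)) : ℂ) := by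
        intro y
        rw [mul_sum]
        refine sum_congr rfl fun S _ => ?_
        rw [dotProduct_add, chi_add]; ring
      simp_rw [hy, sum_chi_dotProduct]
      rw [Fintype.sum_eq_single x]
      · have hxx : x + x = 0 := by
          funext k; simp only [Pi.add_apply, Pi.zero_apply, CharTwo.add_self_eq_zero]
        rw [if_pos hxx]; ring
      · intro y hyx
        have : x + y ≠ 0 := by
          intro h0; apply hyx
          have := congrArg (fun t => t + y) h0
          simp only [zero_add] at this
          rw [← this]; funext k; simp only [Pi.add_apply]
          rw [add_assoc, CharTwo.add_self_eq_zero, add_zero]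
        simp [this]
    simp_rw [inner, ← mul_sum]
  exact_mod_cast key

/-- **Normalisation** `Σ_S P_{U_W}(S) = 1` (Parseval and `|ω^m| = 1`). [cite: HangleiterEtAl2019, §IV (P_U is a probability distribution), p. 6] -/
theorem sum_isingDist {ω : ℂ} (hω : IsPrimitiveRoot ω 16) (wv : (LtPair V → Fin 8) × (V → Fin 8)) :
    ∑ S, isingDist ω wv S = 1 := by
  have hn : ∀ m : ℤ, ‖ω ^ m‖ = 1 := fun m => by
    rw [norm_zpow, hω.norm'_eq_one (by norm_num), one_zpow]
  unfold isingDist isingAmp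
  rw [← sum_div, sum_norm_sq_chi_transform]
  simp_rw [hn, one_pow, sum_const, card_univ, Fintype.card_fun, ZMod.card, nsmul_eq_mul, mul_one]
  rw [div_eq_one_iff_eq (by positivity)]
  push_cast
  rw [← mul_pow]; norm_num

/-- The shift of the vertex weights by the output string, `v ↦ v + 4·1_S` in `ℤ/8`: in circuit terms
`⟨S|U_W|0⟩ = ⟨0|X^S U_W|0⟩` and `X_k = −i e^{i(π/2)X_k}` adds `π/2 = 4·(π/8)` to the vertex angle `w_{kk}`
(angles matter mod `π` up to a global sign) — the analogue for (29) of “`p_{0y} = |⟨0|𝒞_y|0⟩|²`”.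
[cite: BremnerMontanaroShepherd2016, p. 5 (“p_{0y} = Pr[𝒞₀ outputs y] = |⟨y|𝒞₀|0⟩|² = |⟨0|𝒞_y|0⟩|²”)] -/
def bumpVec (S : V → ZMod 2) : V → Fin 8 := fun k => if S k = 0 then 0 else 4

omit [Fintype V] [DecidableEq V] [LinearOrder V] in
/-- The per-site phase of the shift: with `d = ((v_k + 4·[S_k ≠ 0]) mod 8) − v_k ∈ {0, ±4}`,
`ω^{(v_k + d) z_k} = ω^{v_k z_k} · ω^{d} · (−1)^{S_k x_k}` (because `ω⁸ = −1`) — one X gate on an output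
qubit is a quarter-period shift of its vertex angle. [cite: BremnerMontanaroShepherd2016, p. 5 (“p_{0y} = |⟨y|𝒞₀|0⟩|² = |⟨0|𝒞_y|0⟩|²”)] -/
theorem zpow_shift_spin {ω : ℂ} (hω : IsPrimitiveRoot ω 16) (v : V → Fin 8) (S x : V → ZMod 2)
    (k : V) :
    ω ^ (((((v + bumpVec S) k : Fin 8) : ℕ) : ℤ) * spin x k) =
      ω ^ (((v k : ℕ) : ℤ) * spin x k) *
        (ω ^ ((((v + bumpVec S) k : Fin 8) : ℕ) - ((v k : ℕ) : ℤ) : ℤ) * (chi (S k * x k) : ℂ)) := by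
  have hω0 : ω ≠ 0 := hω.ne_zero (by norm_num)
  have h8 : ω ^ (8 : ℤ) = -1 := by
    have h16 : ω ^ (16 : ℕ) = 1 := hω.pow_eq_one
    have h8' : ω ^ (8 : ℕ) * ω ^ (8 : ℕ) = 1 := by rw [← pow_add]; exact h16
    have hne : ω ^ (8 : ℕ) ≠ 1 := hω.pow_ne_one_of_pos_of_lt (by norm_num) (by norm_num)
    rw [zpow_ofNat]
    rcases mul_self_eq_one_iff.1 h8' with h | h
    · exact absurd h hne
    · exact h
  have hm8 : ω ^ (-8 : ℤ) = -1 := by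
    rw [zpow_neg, h8]; norm_num
  -- the values of the bump and the spin
  have hval : (((v + bumpVec S) k : Fin 8) : ℕ) = ((v k : ℕ) + (bumpVec S k : ℕ)) % 8 := by
    rw [Pi.add_apply, Fin.val_add]
  have hvlt := (v k).isLt
  by_cases hS : S k = 0
  · -- no shift at this site
    have hbump : (bumpVec S k : ℕ) = 0 := by simp [bumpVec, hS]
    have hd : ((((v + bumpVec S) k : Fin 8) : ℕ) : ℤ) = ((v k : ℕ) : ℤ) := by
      rw [hval, hbump]; norm_cast; omega
    rw [hd, hS, zero_mul, chi_zero, sub_self, zpow_zero, mul_one, mul_one]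
  · have hbump : (bumpVec S k : ℕ) = 4 := by simp [bumpVec, hS]
    have hS1 : S k = 1 := (by decide : ∀ a : ZMod 2, ¬a = 0 → a = 1) (S k) hS
    have hd : ((((v + bumpVec S) k : Fin 8) : ℕ) : ℤ) - ((v k : ℕ) : ℤ) = 4 ∨
        ((((v + bumpVec S) k : Fin 8) : ℕ) : ℤ) - ((v k : ℕ) : ℤ) = -4 := by
      rw [hval, hbump]; omega
    rw [show ((((v + bumpVec S) k : Fin 8) : ℕ) : ℤ) * spin x k =
        ((v k : ℕ) : ℤ) * spin x k + ((((v + bumpVec S) k : Fin 8) : ℕ) - ((v k : ℕ) : ℤ)) * spin x k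
        by ring, zpow_add₀ hω0]
    congr 1
    set d : ℤ := ((((v + bumpVec S) k : Fin 8) : ℕ) : ℤ) - ((v k : ℕ) : ℤ) with hdd
    rcases (by decide : ∀ a : ZMod 2, a = 0 ∨ a = 1) (x k) with hx | hx
    · -- x_k = 0: spin = 1, character = 1
      have hspin : spin x k = 1 := by simp [spin, bit, hx]
      rw [hspin, hS1, hx, mul_zero, chi_zero, mul_one, mul_one]
    · -- x_k = 1: spin = −1, character = −1, and ω^{−d} = −ω^{d} for d = ±4
      have hspin : spin x k = -1 := by
        simp only [spin, bit, hx]; decide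
      rw [hspin, hS1, hx, mul_one, chi_of_ne_zero one_ne_zero, mul_neg_one, mul_neg_one]
      rcases hd with hd | hd <;> rw [hd]
      · rw [show (-4 : ℤ) = 4 + (-8) by norm_num, zpow_add₀ hω0, hm8, mul_neg_one]
      · rw [show (-(-4) : ℤ) = -4 + 8 by norm_num, zpow_add₀ hω0, h8, mul_neg_one]

omit [Fintype V] [DecidableEq V] [LinearOrder V] in
/-- `ω^{Σ_k f_k} = Π_k ω^{f_k}` for `ω ≠ 0`. [folklore] -/
private theorem zpow_finset_sum {ω : ℂ} (hω : ω ≠ 0) {κ : Type*} (s : Finset κ) (f : κ → ℤ) :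
    ω ^ (∑ k ∈ s, f k) = ∏ k ∈ s, ω ^ f k := by
  classical
  induction s using Finset.induction_on with
  | empty => simp
  | insert a s ha ih => rw [sum_insert ha, prod_insert ha, zpow_add₀ hω, ih]

/-- **The output string is a shift of the vertex weights**: `Z_{w, v + 4·1_S}(ω) = C · A_{w,v}(S)` with
the `x`-independent unit `C = Π_k ω^{d_k}`. [cite: BremnerMontanaroShepherd2016, p. 5 (“p_{0y} = |⟨0|𝒞_y|0⟩|²”, here for the family of eq. (1))] -/
theorem isingZ_shift {ω : ℂ} (hω : IsPrimitiveRoot ω 16) (w : LtPair V → Fin 8) (v : V → Fin 8)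
    (S : V → ZMod 2) :
    isingZ ω w (v + bumpVec S) =
      (∏ k, ω ^ ((((v + bumpVec S) k : Fin 8) : ℕ) - ((v k : ℕ) : ℤ) : ℤ)) * isingAmp ω w v S := by
  have hω0 : ω ≠ 0 := hω.ne_zero (by norm_num)
  unfold isingZ isingAmp
  rw [mul_sum]
  refine sum_congr rfl fun x _ => ?_
  have hsplit : ∀ u : V → Fin 8, ω ^ isingExp w u x =
      ω ^ (∑ q : LtPair V, ((w q : ℕ) : ℤ) * (spin x q.1.1 * spin x q.1.2)) *
        ∏ k, ω ^ (((u k : ℕ) : ℤ) * spin x k) := by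
    intro u
    rw [isingExp, zpow_add₀ hω0]
    congr 1
    exact zpow_finset_sum hω0 _ _
  rw [hsplit, hsplit v]
  simp_rw [zpow_shift_spin hω v S x]
  rw [prod_mul_distrib, prod_mul_distrib, ← chi_finset_sum]
  simp only [dotProduct]
  ring

/-- Hence `|Z_{w, v + 4·1_S}(ω)| = |A_{w,v}(S)|`: every output probability of `U_W` is the `0ⁿ`-output
probability of a re-weighted circuit of the same family. [cite: BremnerMontanaroShepherd2016, p. 5 (“p_{0y} = |⟨0|𝒞_y|0⟩|²”)] -/
theorem norm_isingZ_shift {ω : ℂ} (hω : IsPrimitiveRoot ω 16) (w : LtPair V → Fin 8) (v : V → Fin 8)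
    (S : V → ZMod 2) : ‖isingZ ω w (v + bumpVec S)‖ = ‖isingAmp ω w v S‖ := by
  rw [isingZ_shift hω, norm_mul, norm_prod]
  simp [norm_zpow, hω.norm'_eq_one (by norm_num)]

/-- **Eq. (30) for every output string**: “`𝔼_W[|⟨S|U_W|0⟩|⁴] ≤ 3 · 2^{−2n}` (30)”, i.e.
`𝔼_{w,v}[P_{U_W}(S)²] ≤ 3·2^{−2n}` — the tree's `𝔼_{w,v}[|Z(ω)|⁴] ≤ 3·2^{2n}` (Bremner–Montanaro–Shepherd
App. F) transported along the bijection `v ↦ v + 4·1_S` of the vertex weights.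
[cite: HangleiterEtAl2019, §V.A eq. (30), p. 8] [cite: BremnerMontanaroShepherd2016, App. F (“𝔼_{w,v′}[|Z(ω)|⁴] ≤ 3 · 2^{2n}”)] -/
theorem avg_isingDist_sq_le {ω : ℂ} (hω : IsPrimitiveRoot ω 16) (S : V → ZMod 2) :
    (∑ wv : (LtPair V → Fin 8) × (V → Fin 8), isingDist ω wv S ^ 2) /
        Fintype.card ((LtPair V → Fin 8) × (V → Fin 8)) ≤ 3 / ((2 : ℝ) ^ Fintype.card V) ^ 2 := by
  have hcard : (Fintype.card ((LtPair V → Fin 8) × (V → Fin 8)) : ℝ) =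
      (8 : ℝ) ^ Fintype.card (LtPair V) * (8 : ℝ) ^ Fintype.card V := by
    rw [Fintype.card_prod, Fintype.card_fun, Fintype.card_fun, Fintype.card_fin]; push_cast; ring
  -- transport to `Z(ω)`
  have hsum : ∑ wv : (LtPair V → Fin 8) × (V → Fin 8), isingDist ω wv S ^ 2 =
      (∑ w : LtPair V → Fin 8, ∑ v : V → Fin 8, ‖isingZ ω w v‖ ^ 4) /
        ((4 : ℝ) ^ Fintype.card V) ^ 2 := by
    rw [Fintype.sum_prod_type, sum_div]
    refine sum_congr rfl fun w _ => ?_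
    rw [sum_div]
    have hbij : ∑ v : V → Fin 8, ‖isingZ ω w v‖ ^ 4 / ((4 : ℝ) ^ Fintype.card V) ^ 2 =
        ∑ v : V → Fin 8, ‖isingZ ω w (v + bumpVec S)‖ ^ 4 / ((4 : ℝ) ^ Fintype.card V) ^ 2 :=
      (Fintype.sum_equiv (Equiv.addRight (bumpVec S)) _ _ fun v => rfl).symm
    rw [hbij]
    refine sum_congr rfl fun v _ => ?_
    rw [norm_isingZ_shift hω, isingDist]
    ring
  rw [hsum, hcard, div_div, mul_comm (((4 : ℝ) ^ Fintype.card V) ^ 2), ← div_div]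
  have hL := avg_norm_isingZ_pow_four_le (V := V) hω
  have h4 : ((4 : ℝ) ^ Fintype.card V) ^ 2 = (((2 : ℝ) ^ Fintype.card V) ^ 2) ^ 2 := by
    congr 1
    rw [show (4 : ℝ) = 2 ^ 2 by norm_num, ← pow_mul, mul_comm, pow_mul]
  rw [h4, div_le_iff₀ (by positivity)]
  calc (∑ w : LtPair V → Fin 8, ∑ v : V → Fin 8, ‖isingZ ω w v‖ ^ 4) /
        ((8 : ℝ) ^ Fintype.card (LtPair V) * (8 : ℝ) ^ Fintype.card V)
      ≤ 3 * ((2 : ℝ) ^ Fintype.card V) ^ 2 := hL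
    _ = 3 / ((2 : ℝ) ^ Fintype.card V) ^ 2 * (((2 : ℝ) ^ Fintype.card V) ^ 2) ^ 2 := by
        field_simp

/-- **Eq. (30) summed over outputs**, ensemble form: `𝔼_{w,v} Σ_S P_{U_W}(S)² ≤ 3·2^{−n}`.
[cite: HangleiterEtAl2019, §V.A eq. (30), p. 8] -/
theorem ising_uniform_second_moment {ω : ℂ} (hω : IsPrimitiveRoot ω 16) :
    ∑ wv : (LtPair V → Fin 8) × (V → Fin 8),
      (Fintype.card ((LtPair V → Fin 8) × (V → Fin 8)) : ℝ)⁻¹ * ∑ S, isingDist ω wv S ^ 2 ≤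
      3 / (2 : ℝ) ^ Fintype.card V := by
  have hN : (0 : ℝ) < Fintype.card ((LtPair V → Fin 8) × (V → Fin 8)) := by positivity
  rw [← mul_sum, sum_comm, mul_sum]
  calc ∑ S : V → ZMod 2, (Fintype.card ((LtPair V → Fin 8) × (V → Fin 8)) : ℝ)⁻¹ *
        ∑ wv : (LtPair V → Fin 8) × (V → Fin 8), isingDist ω wv S ^ 2
      ≤ ∑ _S : V → ZMod 2, 3 / ((2 : ℝ) ^ Fintype.card V) ^ 2 := by
        refine sum_le_sum fun S _ => ?_
        rw [inv_mul_eq_div]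
        exact avg_isingDist_sq_le hω S
    _ = 3 / (2 : ℝ) ^ Fintype.card V := by
        rw [sum_const, card_univ, Fintype.card_fun, ZMod.card, nsmul_eq_mul]
        push_cast
        field_simp

/-- **Eq. (31) for the family (29)**: “`H_∞(P_{U_W}) ≥ ½(n + log(δ/3))` … with probability at least
`1 − δ` over the choice of `U_W`” — for every primitive 16-th root `ω` (`e^{iπ/8}` is one) and `δ > 0`, at
most a `δ`-fraction of the weights `(w, v)` violate it. [cite: HangleiterEtAl2019, §V.A eq. (31), p. 8] -/
theorem ising_minEntropy_tail {ω : ℂ} (hω : IsPrimitiveRoot ω 16) {δ : ℝ} (hδ : 0 < δ) :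
    ((univ.filter fun wv : (LtPair V → Fin 8) × (V → Fin 8) =>
        ¬ ((Fintype.card V + Real.logb 2 (δ / 3)) / 2 ≤ minEntropy (isingDist ω wv))).card : ℝ) ≤
      δ * Fintype.card ((LtPair V → Fin 8) × (V → Fin 8)) := by
  set Ω := (LtPair V → Fin 8) × (V → Fin 8)
  have hN : (0 : ℝ) < Fintype.card Ω := by positivity
  have L := minEntropy_tail_of_second_moment (ι := V → ZMod 2)
    (fun _ : Ω => (Fintype.card Ω : ℝ)⁻¹) (fun _ => by positivity)
    (by rw [sum_const, card_univ, nsmul_eq_mul, mul_inv_cancel₀ hN.ne'])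
    (isingDist ω) (isingDist_nonneg ω) (sum_isingDist hω) hδ (ising_uniform_second_moment hω)
    (t := (Fintype.card V + Real.logb 2 (δ / 3)) / 2) (by rw [iqp_threshold_eq hδ])
  rw [sum_const, nsmul_eq_mul, mul_inv_le_iff₀ hN] at L
  exact L

open Classical in
/-- **Theorem 7a for the IQP family (29) with `A = {0, π/8, …, 7π/8}`**, explicit form modulo
Theorem 2: for all but a `δ`-fraction of the weights `W = (w, v)`, every `ε`-certification test of
`P_{U_W}` uses at least `c₂ 2^{n/4} (δ/3)^{1/4} (1 − 2ε − 2^{−n/2}(δ/3)^{−1/2})^{3/2} / ε²` samples —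
eq. (27), `s_min ∈ Ω(2^{n/4} δ^{1/4} / ϵ²)`. [cite: HangleiterEtAl2019, Theorem 7a eq. (27) and §V.A, p. 8] -/
theorem ising_certification_lower_bound {ω : ℂ} (hω : IsPrimitiveRoot ω 16) {c₂ ε δ : ℝ}
    (hc : 0 ≤ c₂) (hε : 0 < ε) (hδ : 0 < δ)
    (hfit : 2 * ε + (2 : ℝ) ^ (-(Fintype.card V : ℝ) / 2) * (δ / 3) ^ (-(1 / 2) : ℝ) ≤ 1)
    (hVV : ∀ wv : (LtPair V → Fin 8) × (V → Fin 8), VVLowerBoundAt c₂ ε (isingDist ω wv)) :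
    ((univ.filter fun wv : (LtPair V → Fin 8) × (V → Fin 8) =>
        ¬ (∀ (s : ℕ) (T : (Fin s → (V → ZMod 2)) → Bool), IsCertTest (isingDist ω wv) ε s T →
          c₂ * ((2 : ℝ) ^ ((Fintype.card V : ℝ) / 4) * (δ / 3) ^ (1 / 4 : ℝ) *
            (1 - 2 * ε - (2 : ℝ) ^ (-(Fintype.card V : ℝ) / 2) * (δ / 3) ^ (-(1 / 2) : ℝ))
              ^ (3 / 2 : ℝ)) / ε ^ 2 ≤ s)).card : ℝ) ≤
      δ * Fintype.card ((LtPair V → Fin 8) × (V → Fin 8)) := by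
  set Ω := (LtPair V → Fin 8) × (V → Fin 8)
  have hN : (0 : ℝ) < Fintype.card Ω := by positivity
  have hq : 0 < δ / 3 := by positivity
  obtain ⟨h1, h2⟩ := two_rpow_threshold hq (Fintype.card V : ℝ)
  have L := certification_lower_bound_of_second_moment (ι := V → ZMod 2)
    (fun _ : Ω => (Fintype.card Ω : ℝ)⁻¹) (fun _ => by positivity)
    (by rw [sum_const, card_univ, nsmul_eq_mul, mul_inv_cancel₀ hN.ne'])
    (isingDist ω) (isingDist_nonneg ω) (sum_isingDist hω) hc hε hδ (ising_uniform_second_moment hω)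
    (t := (Fintype.card V + Real.logb 2 (δ / 3)) / 2) (by rw [iqp_threshold_eq hδ])
    (by rw [h2]; exact hfit) (by rw [h1, h2]) hVV
  rw [sum_const, nsmul_eq_mul, mul_inv_le_iff₀ hN] at L
  exact L

end ising

/-! ### (v2) Theorem 2 for the flat target, proved: eq. (9) with `κ = 1` without the Valiant–Valiant hypothesis -/

section flat
open Literature.Probability.HypothesisTesting.UniformityTesting

/-- The acceptance probability of Definition 1 is the tree's `accept` of the indicator of `T`
(plumbing between the two files). [cite: HangleiterEtAl2019, Definition 1, p. 4] -/
theorem accProb_eq_accept {E : Type*} [Fintype E] (Q : E → ℝ) (s : ℕ) (T : (Fin s → E) → Bool) :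
    accProb Q s T = accept Q (fun S => if T S then (1 : ℝ) else 0) := by
  unfold accProb accept prodW
  refine sum_congr rfl fun S _ => ?_
  by_cases h : T S = true <;> simp [h]

/-- `‖U − P_z‖₁ = |η|`: the Paninski perturbations are exactly `|η|`-far from the uniform target.
[cite: Canonne2020, §5.1 (“Each such distribution is thus being exactly ε-far from uniform”)] -/
theorem l1Dist_unif_paninski {m : ℕ} (hm : 0 < m) (η : ℝ) (z : Fin m → Bool) :
    l1Dist (unif m) (paninski η z) = |η| := by
  unfold l1Dist
  rw [← l1_paninski_unif hm η z]
  exact sum_congr rfl fun x _ => abs_sub_comm _ _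

/-- **Theorem 2 (lower-bound half) for the flat target — PROVED.** Every `ε`-certification test
(Definition 1) of the uniform distribution on a sample space of `2m ≥ 2` points, `0 < ε ≤ 1/2`, uses `s`
samples with `s² > m/(26 ε⁴)`, i.e. `s > 0.19 √m/ε² ≈ 0.14 √|E|/ε²`: eq. (9) with `κ = 1`
(`H_∞(U) = log₂|E|`), “the sample complexity for certification thus scales at least as the square root of
that size”, with the Valiant–Valiant input replaced by the tree's Paninski bound (`samples_sq_gt` with
`η = 2ε`: the perturbations are `2ε > ε` far in `ℓ₁`, so soundness (7) rejects each of them).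
[cite: HangleiterEtAl2019, Theorem 2 and eq. (9), p. 5] [cite: Paninski2008, lower bound Ω(√n/ε²) (via Canonne2020 §5.1)] -/
theorem uniform_certification_lower_bound {m : ℕ} (hm : 0 < m) {ε : ℝ} (hε : 0 < ε) (hε2 : ε ≤ 1 / 2)
    {s : ℕ} {T : (Fin s → Fin m × Bool) → Bool} (hT : IsCertTest (unif m) ε s T) :
    (m : ℝ) / (26 * ε ^ 4) < (s : ℝ) ^ 2 := by
  have hη : (2 * ε) ^ 2 ≤ 1 := by nlinarith
  have hφ0 : ∀ S : Fin s → Fin m × Bool, 0 ≤ (if T S then (1 : ℝ) else 0) := fun S => by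
    split_ifs <;> norm_num
  have hφ1 : ∀ S : Fin s → Fin m × Bool, (if T S then (1 : ℝ) else 0) ≤ 1 := fun S => by
    split_ifs <;> norm_num
  have hcomplete : 2 / 3 ≤ accept (unif m) (fun S => if T S then (1 : ℝ) else 0) := by
    rw [← accProb_eq_accept]; exact hT.complete
  have hsound : ∀ z : Fin m → Bool,
      accept (paninski (2 * ε) z) (fun S => if T S then (1 : ℝ) else 0) < 1 / 3 := by
    intro z
    rw [← accProb_eq_accept]
    refine hT.sound (paninski (2 * ε) z) (paninski_nonneg ?_ z) (sum_paninski hm _ z) ?_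
    · rw [abs_of_pos (by linarith)]; linarith
    · rw [l1Dist_unif_paninski hm, abs_of_pos (by linarith)]; linarith
  have key := samples_sq_gt hm hη _ hφ0 hφ1 hcomplete hsound
  rw [div_lt_iff₀ (by positivity)]
  nlinarith [key]

end flat

/-! ## v3 — relabelling invariance; the flat target on any even sample space, and on bit strings

“The sample space is therefore given by `E_n = {0, 1}^n`.” [cite: HangleiterEtAl2019, §V.A, p. 8]  Definition 1
only sees the sample space through the target `P` and the samples, so a certification test transports
along any relabelling `e : α ≃ β` of the outcomes; with it the flat-target lower bound of section `flat`
(stated on the Paninski sample space `Fin m × Bool`) holds verbatim for the uniform distribution on ANY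
finite sample space of even size `2m`, in particular on `{0,1}^n` (`|E_n| = 2^n`, `m = 2^{n-1}`). -/

section relabel

/-- The acceptance probability (Definition 1) is invariant under relabelling the outcomes: reading the
samples through `e : α ≃ β` and testing with `T ∘ (e ∘ ·)` against `Q ∘ e` is testing with `T` against `Q`.
[cite: HangleiterEtAl2019, Definition 1, p. 4] -/
theorem accProb_comp_equiv {α β : Type*} [Fintype α] [Fintype β] (e : α ≃ β) (Q : β → ℝ) (s : ℕ)
    (T : (Fin s → β) → Bool) :
    accProb (Q ∘ e) s (fun S => T (e ∘ S)) = accProb Q s T := by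
  unfold accProb
  refine Fintype.sum_equiv ((Equiv.refl (Fin s)).arrowCongr e) _ _ fun S => ?_
  have hS : ((Equiv.refl (Fin s)).arrowCongr e) S = e ∘ S := by
    funext k; rfl
  rw [hS]
  rfl

/-- The `ℓ₁` distance is invariant under relabelling the outcomes. [cite: HangleiterEtAl2019, §II (norms), p. 4] -/
theorem l1Dist_comp_equiv {α β : Type*} [Fintype α] [Fintype β] (e : α ≃ β) (P Q : β → ℝ) :
    l1Dist (P ∘ e) (Q ∘ e) = l1Dist P Q := by
  unfold l1Dist
  exact Fintype.sum_equiv e _ _ fun _ => rfl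

/-- **Certification tests transport along relabellings.** If `T` is an `ε`-certification test of `P`
on `β` from `s` samples, then `S ↦ T (e ∘ S)` is an `ε`-certification test of `P ∘ e` on `α`
(completeness (6) and soundness (7) are both preserved, the alternatives `Q` on `α` being the pull-backs
of the alternatives `Q ∘ e⁻¹` on `β`). [cite: HangleiterEtAl2019, Definition 1 eqs. (6)–(7), p. 4] -/
theorem IsCertTest.comp_equiv {α β : Type*} [Fintype α] [Fintype β] (e : α ≃ β) {P : β → ℝ} {ε : ℝ}
    {s : ℕ} {T : (Fin s → β) → Bool} (hT : IsCertTest P ε s T) :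
    IsCertTest (P ∘ e) ε s (fun S => T (e ∘ S)) where
  complete := by
    rw [accProb_comp_equiv]
    exact hT.complete
  sound Q hQ0 hQ1 hfar := by
    have hQ : Q = (Q ∘ e.symm) ∘ e := by
      ext a; simp
    rw [hQ, accProb_comp_equiv]
    refine hT.sound (Q ∘ e.symm) (fun b => hQ0 (e.symm b)) ?_ ?_
    · rw [← hQ1]
      exact Fintype.sum_equiv e.symm _ _ fun _ => rfl
    · rw [hQ, l1Dist_comp_equiv] at hfar
      exact hfar

end relabel

section flatAny
open Literature.Probability.HypothesisTesting.UniformityTesting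

/-- The uniform (“flat”) distribution on a finite sample space `E`: `U(x) = 1/|E|`, the target with
`H_∞(U) = log₂ |E|` (`κ = 1` in eq. (9)). [cite: HangleiterEtAl2019, eq. (9) and §IV.B (“quantum supremacy distributions are flat”), pp. 5, 7] -/
def uniformDist (E : Type*) [Fintype E] : E → ℝ := fun _ => 1 / (Fintype.card E : ℝ)

/-- Unfolding lemma: `U(x) = 1/|E|`. [cite: HangleiterEtAl2019, eq. (9) (`H_∞(P) = log(κ|E_n|)`, `κ = 1`), p. 5] -/
theorem uniformDist_apply (E : Type*) [Fintype E] (x : E) :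
    uniformDist E x = 1 / (Fintype.card E : ℝ) := rfl

/-- `U` is a probability vector (`Σ_i p_i = 1`) on a nonempty sample space.
[cite: HangleiterEtAl2019, §II (probability vectors `p_i ≥ 0, Σ_i p_i = 1`), p. 4] -/
theorem sum_uniformDist (E : Type*) [Fintype E] [Nonempty E] : ∑ x, uniformDist E x = 1 := by
  simp only [uniformDist, sum_const, card_univ, nsmul_eq_mul]
  have : (0 : ℝ) < Fintype.card E := by exact_mod_cast Fintype.card_pos
  field_simp

/-- **Theorem 2 (lower-bound half) for the flat target on ANY sample space of even size — PROVED.**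
For every finite sample space `E` with `|E| = 2m ≥ 2` and every `0 < ε ≤ 1/2`, an `ε`-certification test
of the uniform distribution on `E` from `s` samples has `s² > m/(26 ε⁴) = |E|/(52 ε⁴)`: eq. (9) with
`κ = 1`, unconditionally (section `flat` transported along a bijection `Fin m × Bool ≃ E`).
[cite: HangleiterEtAl2019, Theorem 2 and eq. (9), p. 5] [cite: Paninski2008, lower bound Ω(√n/ε²) (via Canonne2020 §5.1)] -/
theorem uniform_certification_lower_bound_card {E : Type*} [Fintype E] {m : ℕ} (hm : 0 < m)
    (hcard : Fintype.card E = 2 * m) {ε : ℝ} (hε : 0 < ε) (hε2 : ε ≤ 1 / 2) {s : ℕ}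
    {T : (Fin s → E) → Bool} (hT : IsCertTest (uniformDist E) ε s T) :
    (m : ℝ) / (26 * ε ^ 4) < (s : ℝ) ^ 2 := by
  have hc : Fintype.card (Fin m × Bool) = Fintype.card E := by
    rw [hcard, Fintype.card_prod, Fintype.card_fin, Fintype.card_bool, mul_comm]
  obtain ⟨e⟩ : Nonempty (Fin m × Bool ≃ E) := ⟨Fintype.equivOfCardEq hc⟩
  have h := hT.comp_equiv e
  have hu : uniformDist E ∘ e = unif m := by
    ext x
    simp only [Function.comp_apply, uniformDist, unif, hcard, Nat.cast_mul, Nat.cast_ofNat]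
  rw [hu] at h
  exact uniform_certification_lower_bound hm hε hε2 h

/-- **The flat target on bit strings.** For `E_n = {0,1}^n`, `n ≥ 1` (“The sample space is therefore
given by `E_n = {0, 1}^n`”), every `ε`-certification test (`0 < ε ≤ 1/2`) of the uniform distribution
from `s` samples has `s² > 2^{n−1}/(26 ε⁴)`, i.e. `s > 2^{(n−1)/2}/(√26 ε²)` — “the sample complexity
for certification thus scales at least as the square root of that size”, here `√|E_n| = 2^{n/2}`.
[cite: HangleiterEtAl2019, eq. (9) p. 5 and §V.A p. 8] [cite: Paninski2008, lower bound Ω(√n/ε²) (via Canonne2020 §5.1)] -/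
theorem uniform_certification_lower_bound_bitstrings {n : ℕ} (hn : 1 ≤ n) {ε : ℝ} (hε : 0 < ε)
    (hε2 : ε ≤ 1 / 2) {s : ℕ} {T : (Fin s → (Fin n → Bool)) → Bool}
    (hT : IsCertTest (uniformDist (Fin n → Bool)) ε s T) :
    (2 : ℝ) ^ (n - 1) / (26 * ε ^ 4) < (s : ℝ) ^ 2 := by
  have hcard : Fintype.card (Fin n → Bool) = 2 * 2 ^ (n - 1) := by
    rw [Fintype.card_fun, Fintype.card_bool, Fintype.card_fin, ← pow_succ', Nat.sub_add_cancel hn]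
  have h := uniform_certification_lower_bound_card (m := 2 ^ (n - 1)) (by positivity) hcard hε hε2 hT
  simpa using h

end flatAny

/-! ## v4 — Theorem 7b for an exact spherical 2-design: hypothesis (33) supplied by the tree

“The result of Theorem 7 applies to any circuit family `U` such that `{U|S0⟩}_{U∼U}` forms a relative
`ε̃`-approximate spherical 2-design, for which the second moments are upper bounded as in Eq. (33).”
[cite: HangleiterEtAl2019, Theorem 7 and §V.B eq. (33), p. 8]  For an EXACT complex-projective (state)
2-design `{ψ_j}_{j ∈ J}` — the tree's `DesignAnticoncentration.IsStateTwoDesign` (Zhu–Kueng–Grassl–Gross,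
Proposition 1 at `t = 2`) — eq. (33) holds with `ε̃ = 0` and EQUALITY, `(1/K) Σ_j |⟨S|ψ_j⟩|⁴ = 2/(N(N+1))`
(`IsStateTwoDesign.fourth_moment`, after Hangleiter–Bermejo-Vega–Schwarz–Eisert 2018 §3.1); feeding it to
`design_certification_lower_bound` leaves Theorem 2 (Valiant–Valiant) as the ONLY remaining hypothesis. -/

section twoDesign
open DesignAnticoncentration

/-- The output distribution `P_j(S) = |⟨S|ψ_j⟩|²` of the `j`-th design state measured in the
computational basis. [cite: HangleiterEtAl2019, §IV (“measured in the computational basis, thereby resulting in outcome S with probability P_U(S) := |⟨S|U|S0⟩|²”), p. 6] -/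
def designDist {V J : Type*} (ψ : J → V → ℂ) (j : J) : V → ℝ := fun S => Complex.normSq (ψ j S)

/-- `P_j(S) = |⟨S|ψ_j⟩|² ≥ 0`. [cite: HangleiterEtAl2019, §II (probability vectors `p_i ≥ 0`), p. 4] -/
theorem designDist_nonneg {V J : Type*} (ψ : J → V → ℂ) (j : J) (S : V) : 0 ≤ designDist ψ j S :=
  Complex.normSq_nonneg _

variable {V : Type*} [Fintype V] [DecidableEq V] [Nonempty V] {J : Type*} [Fintype J]

open Classical in
/-- **Theorem 7b for an exact state 2-design, modulo Theorem 2 only — PROVED.** For a finite exact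
complex-projective 2-design `{ψ_j}_{j∈J}` in `ℂ^V` (`N = |V|`), uniform weights `1/K`, `0 < ε`, `0 < δ`,
granted the Valiant–Valiant lower bound (Theorem 2) at accuracy `ε` for each `P_j`: the fraction of
design states whose output distribution `P_j` ADMITS an `ε`-certification test from fewer than
`c₂ · 2^{(log₂ N)/4} (δ/2)^{1/4} (1 − 2ε − 2^{−(log₂ N)/2}(δ/2)^{−1/2})^{3/2} / ε²` samples is at most `δ`
— eq. (28) with `ε̃ = 0` (`2^{n/4} δ^{1/4}/(ϵ²(1+ε̃)^{1/4})` up to the constant `2^{−1/4}` and the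
explicit `(1 − 2ϵ − 2^{−H_∞})^{3/2}` factor that the paper drops “for sufficiently large `n`”, here the
hypothesis `hfit`).  Hypothesis (33) is DISCHARGED by `IsStateTwoDesign.fourth_moment`.
[cite: HangleiterEtAl2019, Theorem 7(b) eq. (28) and §V.B eqs. (33)–(34), p. 8] [cite: HangleiterEtAl2018, §3.1 (state 2-design moments 𝔼[p²] = 2/(N(N+1)))] -/
theorem twoDesign_certification_lower_bound {ψ : J → V → ℂ} (hψ : IsStateTwoDesign ψ)
    {c₂ ε δ : ℝ} (hc : 0 ≤ c₂) (hε : 0 < ε) (hδ : 0 < δ)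
    (hfit : 2 * ε + (2 : ℝ) ^ (-Real.logb 2 (Fintype.card V) / 2) *
      (δ / 2) ^ (-(1 / 2) : ℝ) ≤ 1)
    (hVV : ∀ j, VVLowerBoundAt c₂ ε (designDist ψ j)) :
    ((univ.filter (fun j : J =>
        ¬ (∀ (s : ℕ) (T : (Fin s → V) → Bool), IsCertTest (designDist ψ j) ε s T →
          c₂ * ((2 : ℝ) ^ (Real.logb 2 (Fintype.card V) / 4) * (δ / 2) ^ (1 / 4 : ℝ) *
            (1 - 2 * ε - (2 : ℝ) ^ (-Real.logb 2 (Fintype.card V) / 2) *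
              (δ / 2) ^ (-(1 / 2) : ℝ)) ^ (3 / 2 : ℝ)) / ε ^ 2 ≤ s))).card : ℝ) /
      (Fintype.card J : ℝ) ≤ δ := by
  obtain ⟨x₀⟩ := (inferInstance : Nonempty V)
  have hK : (0 : ℝ) < Fintype.card J := by exact_mod_cast hψ.card_pos x₀
  -- uniform ensemble weights
  have hμ : ∀ _j : J, (0 : ℝ) ≤ ((Fintype.card J : ℝ))⁻¹ := fun _ => by positivity
  have hμ1 : ∑ _j : J, ((Fintype.card J : ℝ))⁻¹ = 1 := by
    rw [sum_const, card_univ, nsmul_eq_mul, mul_inv_cancel₀ hK.ne']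
  have hP1 : ∀ j, ∑ S, designDist ψ j S = 1 := fun j => hψ.norm_sq j
  -- (33) with ε̃ = 0, from the design identity
  have h33 : ∀ S : V, ∑ j, ((Fintype.card J : ℝ))⁻¹ * designDist ψ j S ^ 2 ≤
      2 * (1 + 0) / ((Fintype.card V : ℝ) * (Fintype.card V + 1)) := by
    intro S
    rw [← mul_sum, add_zero, mul_one]
    exact (hψ.fourth_moment S).le
  have hfit' : 2 * ε + (2 : ℝ) ^ (-Real.logb 2 (Fintype.card V) / 2) *
      (δ / (2 * (1 + 0))) ^ (-(1 / 2) : ℝ) ≤ 1 := by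
    rw [add_zero, mul_one]; exact hfit
  have key := design_certification_lower_bound (fun _ : J => ((Fintype.card J : ℝ))⁻¹) hμ hμ1
    (designDist ψ) (fun j S => designDist_nonneg ψ j S) hP1 hc hε hδ le_rfl h33 hfit' hVV
  simp only [add_zero, mul_one, sum_const, nsmul_eq_mul] at key
  rw [div_eq_mul_inv]
  exact key

end twoDesign

section flatInstance

/-- **Worked instance (numbers, not asymptotics): the flat target on 53 bits at `ε = 1/4`.**
Every `1/4`-certification test (Definition 1) of the uniform distribution on `{0,1}^53`
(`|E| = 2^53 ≈ 9.0 × 10^15` outcomes) uses MORE THAN `2^27 ≈ 1.3 × 10^8` samples: from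
`uniform_certification_lower_bound_bitstrings`, `s² > 2^52/(26 · 4^{−4}) = 2^60/26 > 2^54`.  (This is the
`κ = 1` idealisation of eq. (9) on a 53-qubit sample space; it is a statement about the FLAT target only,
not about any device's or any circuit's output distribution.) [cite: HangleiterEtAl2019, eq. (9), p. 5] -/
theorem flat53_quarter_certification_needs_pow27_samples {s : ℕ}
    {T : (Fin s → (Fin 53 → Bool)) → Bool}
    (hT : IsCertTest (uniformDist (Fin 53 → Bool)) (1 / 4) s T) : (2 : ℝ) ^ 27 < s := by
  have h := uniform_certification_lower_bound_bitstrings (n := 53) (by norm_num) (by norm_num)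
    (by norm_num) hT
  have hs : (0 : ℝ) ≤ s := Nat.cast_nonneg s
  have h54 : ((2 : ℝ) ^ 27) ^ 2 < (s : ℝ) ^ 2 := by
    have : ((2 : ℝ) ^ 27) ^ 2 ≤ (2 : ℝ) ^ (53 - 1) / (26 * (1 / 4) ^ 4) := by norm_num
    exact lt_of_le_of_lt this h
  nlinarith [h54, hs]

end flatInstance

/-! ## v5 — Theorem 2's first branch `s ≥ c₂/ϵ`, for EVERY target, unconditionally

“there exists no `ϵ`-certification test from fewer than `c₂ max{1/ϵ, ϵ^{−2}‖P^{−max}_{−2ϵ}‖_{2/3}}` samples”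
[cite: HangleiterEtAl2019, Theorem 2, p. 5]: the `1/ϵ` branch is Le Cam's two-point method — any single
alternative `Q` at `ℓ₁`-distance `2ϵ` forces `s ≥ 1/(3ϵ)` — and needs nothing about `P` beyond a second
outcome; proved here with `c₂ = 1/3` (sections `productL1`, `invEps`). -/

section productL1
open Literature.Probability.HypothesisTesting.UniformityTesting

variable {E : Type*} [Fintype E]

omit [Fintype E] in
/-- `P^{⊗(s+1)}(x ∷ T) = P(x) · P^{⊗s}(T)` (i.i.d. samples). [cite: HangleiterEtAl2019, Definition 1 (“drawn i.i.d. from some distribution Q”), p. 4] -/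
theorem prodW_cons (P : E → ℝ) {s : ℕ} (x : E) (T : Fin s → E) :
    prodW P (Fin.cons x T : Fin (s + 1) → E) = P x * prodW P T := by
  unfold prodW
  rw [Fin.prod_univ_succ]
  simp only [Fin.cons_zero, Fin.cons_succ]

/-- Splitting a sum over `(s+1)`-sample transcripts into the first sample and the rest (plumbing). [cite: HangleiterEtAl2019, Definition 1, p. 4] -/
theorem sum_seq_succ {s : ℕ} (g : (Fin (s + 1) → E) → ℝ) :
    ∑ S : Fin (s + 1) → E, g S = ∑ x : E, ∑ T : Fin s → E, g (Fin.cons x T) := by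
  rw [← (Fin.consEquiv fun _ : Fin (s + 1) => E).sum_comp, Fintype.sum_prod_type]
  rfl

/-- `Σ_S |P^{⊗s}(S)| = (Σ_x |P x|)^s`. [cite: Canonne2020, App. E.2 (product distributions over m samples)] -/
theorem sum_abs_prodW (P : E → ℝ) (s : ℕ) :
    ∑ S : Fin s → E, |prodW P S| = (∑ x, |P x|) ^ s := by
  have : ∀ S : Fin s → E, |prodW P S| = prodW (fun x => |P x|) S := fun S => by
    unfold prodW; exact (Finset.abs_prod _ _)
  simp_rw [this]
  exact sum_prodW _ s

/-- **Tensorisation of the `ℓ₁` distance (hybrid argument)**: for weight vectors with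
`Σ|P| ≤ 1` and `Σ|Q| ≤ 1`, `‖P^{⊗s} − Q^{⊗s}‖₁ ≤ s · ‖P − Q‖₁` — the subadditivity of the total
variation distance under products that turns Le Cam's two-point method into an `Ω(1/ε)` sample bound.
[cite: Canonne2020, App. E.2 Thm. E.7 (Le Cam) with the standard bound d_TV(p^{⊗m}, q^{⊗m}) ≤ m·d_TV(p, q)] -/
theorem l1_prodW_le (P Q : E → ℝ) (hP : ∑ x, |P x| ≤ 1) (hQ : ∑ x, |Q x| ≤ 1) (s : ℕ) :
    ∑ S : Fin s → E, |prodW P S - prodW Q S| ≤ s * ∑ x, |P x - Q x| := by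
  induction s with
  | zero =>
    simp [prodW]
  | succ s ih =>
    rw [sum_seq_succ]
    simp only [prodW_cons]
    have hstep : ∀ (x : E) (T : Fin s → E),
        |P x * prodW P T - Q x * prodW Q T| ≤
          |P x - Q x| * |prodW P T| + |Q x| * |prodW P T - prodW Q T| := by
      intro x T
      have : P x * prodW P T - Q x * prodW Q T =
          (P x - Q x) * prodW P T + Q x * (prodW P T - prodW Q T) := by ring
      rw [this, ← abs_mul, ← abs_mul]
      exact abs_add_le _ _
    have hD : 0 ≤ ∑ x, |P x - Q x| := sum_nonneg fun x _ => abs_nonneg _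
    have h1 : ∑ T : Fin s → E, |prodW P T| ≤ 1 := by
      rw [sum_abs_prodW]; exact pow_le_one₀ (sum_nonneg fun x _ => abs_nonneg _) hP
    have hih : 0 ≤ ∑ T : Fin s → E, |prodW P T - prodW Q T| := sum_nonneg fun T _ => abs_nonneg _
    calc ∑ x, ∑ T : Fin s → E, |P x * prodW P T - Q x * prodW Q T|
        ≤ ∑ x, ∑ T : Fin s → E,
            (|P x - Q x| * |prodW P T| + |Q x| * |prodW P T - prodW Q T|) :=
          sum_le_sum fun x _ => sum_le_sum fun T _ => hstep x T
      _ = (∑ x, |P x - Q x|) * ∑ T : Fin s → E, |prodW P T| +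
            (∑ x, |Q x|) * ∑ T : Fin s → E, |prodW P T - prodW Q T| := by
          simp only [sum_add_distrib, ← mul_sum, ← sum_mul]
      _ ≤ (∑ x, |P x - Q x|) * 1 + 1 * (s * ∑ x, |P x - Q x|) :=
          add_le_add (mul_le_mul_of_nonneg_left h1 hD) (mul_le_mul hQ ih hih zero_le_one)
      _ = ((s + 1 : ℕ) : ℝ) * ∑ x, |P x - Q x| := by push_cast; ring

end productL1

section invEps
open Literature.Probability.HypothesisTesting.UniformityTesting

/-- **Le Cam for `s` samples**: the acceptance probabilities (Definition 1) of one test under two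
probability vectors differ by at most `(s/2)·‖P − Q‖₁` (event form of Le Cam, `accept_sub_le_half_l1` of
the tree's `UniformityTestingLowerBound.lean`, plus `l1_prodW_le`).
[cite: Canonne2020, App. E.2 Thm. E.7 and Cor. E.8] [cite: HangleiterEtAl2019, Definition 1, p. 4] -/
theorem accProb_sub_le (P Q : ι → ℝ) (hP0 : ∀ i, 0 ≤ P i) (hP1 : ∑ i, P i = 1)
    (hQ0 : ∀ i, 0 ≤ Q i) (hQ1 : ∑ i, Q i = 1) (s : ℕ) (T : (Fin s → ι) → Bool) :
    accProb P s T - accProb Q s T ≤ s * l1Dist P Q / 2 := by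
  rw [accProb_eq_accept, accProb_eq_accept]
  unfold accept
  have hφ0 : ∀ S : Fin s → ι, 0 ≤ (if T S then (1 : ℝ) else 0) := fun S => by split_ifs <;> norm_num
  have hφ1 : ∀ S : Fin s → ι, (if T S then (1 : ℝ) else 0) ≤ 1 := fun S => by split_ifs <;> norm_num
  have hsum : ∑ S : Fin s → ι, prodW P S = ∑ S : Fin s → ι, prodW Q S := by
    rw [sum_prodW, sum_prodW, hP1, hQ1]
  have h := accept_sub_le_half_l1 (prodW P) (prodW Q) hsum _ hφ0 hφ1
  have hPa : ∑ i, |P i| ≤ 1 := by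
    rw [show ∑ i, |P i| = ∑ i, P i from sum_congr rfl fun i _ => abs_of_nonneg (hP0 i), hP1]
  have hQa : ∑ i, |Q i| ≤ 1 := by
    rw [show ∑ i, |Q i| = ∑ i, Q i from sum_congr rfl fun i _ => abs_of_nonneg (hQ0 i), hQ1]
  have ht := l1_prodW_le P Q hPa hQa s
  unfold l1Dist
  linarith

/-- **Theorem 2, first branch (`s ≥ c₂/ϵ`) — PROVED for every target, unconditionally.** For any
probability vector `P` on a sample space with at least two outcomes and any `0 < ε ≤ 1/2`, every
`ε`-certification test of `P` (Definition 1) from `s` samples has `s > 1/(3ε)`: mixing `P` with a point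
mass, `Q = (1 − λ)P + λδ_x` at `ℓ₁`-distance exactly `2ε`, is rejected by soundness (7) while `P` is
accepted by completeness (6), and one test separates the two by at most `s·‖P − Q‖₁/2 = sε`
(`accProb_sub_le`). [cite: HangleiterEtAl2019, Theorem 2 (“no ϵ-certification test from fewer than c₂ max{1/ϵ, …} samples”), p. 5] [cite: Canonne2020, App. E.2 Thm. E.7 (Le Cam's method)] -/
theorem certification_needs_inv_eps [Nontrivial ι] (P : ι → ℝ) (hP0 : ∀ i, 0 ≤ P i)
    (hP1 : ∑ i, P i = 1) {ε : ℝ} (hε : 0 < ε) (hε2 : ε ≤ 1 / 2) {s : ℕ} {T : (Fin s → ι) → Bool}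
    (hT : IsCertTest P ε s T) : 1 / (3 * ε) < s := by
  classical
  -- an outcome carrying at most half of the mass
  obtain ⟨x, hx⟩ : ∃ x, P x ≤ 1 / 2 := by
    by_contra h
    push Not at h
    have hlt : ∑ _i : ι, (1 / 2 : ℝ) < ∑ i, P i := sum_lt_sum_of_nonempty univ_nonempty fun i _ => h i
    rw [hP1, sum_const, card_univ, nsmul_eq_mul] at hlt
    have hcard : (2 : ℝ) ≤ Fintype.card ι := by exact_mod_cast Fintype.one_lt_card
    linarith
  -- the alternative Q = (1 − λ)P + λ δ_x with λ = ε/(1 − P x)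
  set lam : ℝ := ε / (1 - P x) with hlam
  have h1x : 0 < 1 - P x := by linarith
  have hlam0 : 0 ≤ lam := div_nonneg hε.le h1x.le
  have hlam1 : lam ≤ 1 := by rw [hlam, div_le_one h1x]; linarith
  have hlamx : lam * (1 - P x) = ε := by rw [hlam]; field_simp
  set Q : ι → ℝ := fun i => (1 - lam) * P i + if i = x then lam else 0 with hQ
  have hQ0 : ∀ i, 0 ≤ Q i := fun i => by
    simp only [hQ]
    have := hP0 i
    split_ifs <;> nlinarith
  have hQ1 : ∑ i, Q i = 1 := by
    simp only [hQ, sum_add_distrib, ← mul_sum, hP1, sum_ite_eq', mem_univ, if_true]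
    ring
  have hdist : l1Dist P Q = 2 * ε := by
    unfold l1Dist
    have hpt : ∀ i, |P i - Q i| = lam * P i + if i = x then lam * (1 - 2 * P x) else 0 := by
      intro i
      simp only [hQ]
      split_ifs with hi
      · subst hi
        rw [show P i - ((1 - lam) * P i + lam) = -(lam * (1 - P i)) by ring, abs_neg,
          abs_of_nonneg (by nlinarith)]
        ring
      · rw [show P i - ((1 - lam) * P i + 0) = lam * P i by ring,
          abs_of_nonneg (mul_nonneg hlam0 (hP0 i))]
        ring
    simp only [hpt, sum_add_distrib, ← mul_sum, hP1, sum_ite_eq', mem_univ, if_true]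
    linear_combination (2 : ℝ) * hlamx
  have hacc : accProb Q s T < 1 / 3 := hT.sound Q hQ0 hQ1 (by rw [hdist]; linarith)
  have hcomp := hT.complete
  have hle := accProb_sub_le P Q hP0 hP1 hQ0 hQ1 s T
  rw [hdist] at hle
  rw [div_lt_iff₀ (by positivity)]
  nlinarith

/-- **Corollary: Theorem 2's lower bound holds outright (with `c₂ = 1/3`) whenever its `1/ϵ` branch
dominates**, i.e. for targets so concentrated that `ϵ^{−2}‖P^{−max}_{−2ϵ}‖_{2/3} ≤ 1/ϵ`: then the
hypothesis predicate `VVLowerBoundAt (1/3) ε P` is a theorem, by `certification_needs_inv_eps`.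
[cite: HangleiterEtAl2019, Theorem 2, p. 5] -/
theorem vvLowerBoundAt_third_of_norm_le [Nontrivial ι] (P : ι → ℝ) (hP0 : ∀ i, 0 ≤ P i)
    (hP1 : ∑ i, P i = 1) {ε : ℝ} (hε : 0 < ε) (hε2 : ε ≤ 1 / 2)
    (hsmall : vvNorm (2 * ε) P / ε ^ 2 ≤ 1 / ε) : VVLowerBoundAt (1 / 3) ε P := by
  intro s T hT
  rw [max_eq_left hsmall]
  have h := certification_needs_inv_eps P hP0 hP1 hε hε2 hT
  rw [show (1 : ℝ) / 3 * (1 / ε) = 1 / (3 * ε) by ring]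
  exact h.le

end invEps

section flatVV
open Literature.Probability.HypothesisTesting.UniformityTesting

/-- `‖P^{−max}_{−ε}‖₀ ≤ |E|` (the trimmed vector has at most `|E| − 1` entries).
[cite: HangleiterEtAl2019, §III items (i)–(ii), p. 5] -/
theorem vvSupp_le_card [Nonempty ι] (ε : ℝ) (P : ι → ℝ) : vvSupp ε P ≤ Fintype.card ι := by
  unfold vvSupp nzCount vvVec
  refine (List.countP_le_length).trans ?_
  refine ((trim_suffix _ _).length_le).trans ?_
  rw [List.length_dropLast, length_vals]
  exact Nat.sub_le _ _

/-- `‖P^{−max}_{−ε}‖_{2/3} ≤ √|E|` for every probability vector (Lemma 3's upper bound with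
`1 − 2^{−H_∞(P)} ≤ 1` and `‖P^{−max}_{−ε}‖₀ ≤ |E|`) — “We note that `∥P^{−max}_{−ϵ}∥_{2/3} ≤ ∥P∥_{2/3}`
for any `P`”, and `∥P∥_{2/3} ≤ √|E|`. [cite: HangleiterEtAl2019, Lemma 3 (upper bound) and the remark after Theorem 2, p. 5] -/
theorem vvNorm_le_sqrt_card [Nonempty ι] {ε : ℝ} (hε : 0 ≤ ε) {P : ι → ℝ} (hP : ∀ i, 0 ≤ P i)
    (hP1 : ∑ i, P i = 1) : vvNorm ε P ≤ (Fintype.card ι : ℝ) ^ (1 / 2 : ℝ) := by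
  have h := vvNorm_le hε hP hP1
  have h1 : 1 - pmax P ≤ 1 := by linarith [pmax_pos hP hP1]
  have hsupp : (vvSupp ε P : ℝ) ^ (1 / 2 : ℝ) ≤ (Fintype.card ι : ℝ) ^ (1 / 2 : ℝ) :=
    Real.rpow_le_rpow (Nat.cast_nonneg _) (by exact_mod_cast vvSupp_le_card ε P) (by norm_num)
  calc vvNorm ε P ≤ (1 - pmax P) * (vvSupp ε P : ℝ) ^ (1 / 2 : ℝ) := h
    _ ≤ 1 * (Fintype.card ι : ℝ) ^ (1 / 2 : ℝ) :=
        mul_le_mul h1 hsupp (Real.rpow_nonneg (Nat.cast_nonneg _) _) zero_le_one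
    _ = (Fintype.card ι : ℝ) ^ (1 / 2 : ℝ) := one_mul _

/-- **Theorem 2 (Valiant–Valiant, lower-bound half) DISCHARGED for the flat target, `c₂ = 1/8`.**  For the
uniform distribution on any finite sample space of even size `|E| = 2m ≥ 2` and every `0 < ε ≤ 1/2`, the
hypothesis predicate `VVLowerBoundAt (1/8) ε U` — “there exists no `ϵ`-certification test from fewer than
`c₂ max{1/ϵ, ϵ^{−2}‖P^{−max}_{−2ϵ}‖_{2/3}}` samples” — is a THEOREM: the `1/ϵ` branch by
`certification_needs_inv_eps` (`s > 1/(3ϵ)`), the `‖·‖_{2/3}` branch by `uniform_certification_lower_bound_card`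
(`s² > m/(26ϵ⁴)`) together with `‖U^{−max}_{−2ϵ}‖_{2/3} ≤ √(2m)` (`vvNorm_le_sqrt_card`), since
`(√(2m)/8)² = m/32 < m/26`.  So every statement of this file taking `VVLowerBoundAt c₂ ε P` as a hypothesis
holds unconditionally at flat targets with `c₂ = 1/8`.
[cite: HangleiterEtAl2019, Theorem 2, p. 5] [cite: ValiantValiant2017, Thm. 1 (the flat case)] [cite: Paninski2008, lower bound Ω(√n/ε²) (via Canonne2020 §5.1)] -/
theorem vvLowerBoundAt_uniformDist {E : Type*} [Fintype E] [Nonempty E] {m : ℕ} (hm : 0 < m)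
    (hcard : Fintype.card E = 2 * m) {ε : ℝ} (hε : 0 < ε) (hε2 : ε ≤ 1 / 2) :
    VVLowerBoundAt (1 / 8) ε (uniformDist E) := by
  intro s T hT
  have hN : (Fintype.card E : ℝ) = 2 * m := by exact_mod_cast hcard
  haveI : Nontrivial E := Fintype.one_lt_card_iff_nontrivial.mp (by omega)
  have hU0 : ∀ x, 0 ≤ uniformDist E x := fun x => by
    rw [uniformDist_apply]; positivity
  have hU1 : ∑ x, uniformDist E x = 1 := sum_uniformDist E
  have hs : (0 : ℝ) ≤ s := Nat.cast_nonneg s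
  -- branch 1
  have h1 : 1 / (3 * ε) < (s : ℝ) := certification_needs_inv_eps (uniformDist E) hU0 hU1 hε hε2 hT
  -- branch 2
  have h2 : (m : ℝ) / (26 * ε ^ 4) < (s : ℝ) ^ 2 :=
    uniform_certification_lower_bound_card hm hcard hε hε2 hT
  have hnorm : vvNorm (2 * ε) (uniformDist E) ≤ (2 * m : ℝ) ^ (1 / 2 : ℝ) := by
    rw [← hN]; exact vvNorm_le_sqrt_card (by linarith) hU0 hU1
  have hsq : ((2 * m : ℝ) ^ (1 / 2 : ℝ)) ^ 2 = 2 * m := by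
    rw [← Real.rpow_natCast, ← Real.rpow_mul (by positivity)]; norm_num
  rw [mul_max_of_nonneg _ _ (by norm_num : (0 : ℝ) ≤ 1 / 8)]
  refine max_le ?_ ?_
  · -- (1/8)(1/ε) ≤ 1/(3ε) < s
    have : (1 : ℝ) / 8 * (1 / ε) ≤ 1 / (3 * ε) := by
      rw [show (1 : ℝ) / 8 * (1 / ε) = 1 / (8 * ε) by ring]
      exact one_div_le_one_div_of_le (by positivity) (by nlinarith)
    linarith
  · -- (1/8) vvNorm/ε² ≤ (1/8)√(2m)/ε² < s
    have hb : (1 : ℝ) / 8 * (vvNorm (2 * ε) (uniformDist E) / ε ^ 2) ≤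
        (1 / 8) * ((2 * m : ℝ) ^ (1 / 2 : ℝ) / ε ^ 2) := by
      gcongr
    have hc : ((1 : ℝ) / 8 * ((2 * m : ℝ) ^ (1 / 2 : ℝ) / ε ^ 2)) ^ 2 < (s : ℝ) ^ 2 := by
      have hε4 : 0 < ε ^ 4 := by positivity
      calc ((1 : ℝ) / 8 * ((2 * m : ℝ) ^ (1 / 2 : ℝ) / ε ^ 2)) ^ 2
          = (m : ℝ) / (32 * ε ^ 4) := by
            simp only [mul_pow, div_pow, hsq]; field_simp; ring
        _ ≤ (m : ℝ) / (26 * ε ^ 4) := by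
            apply div_le_div_of_nonneg_left (by positivity) (by positivity); nlinarith
        _ < (s : ℝ) ^ 2 := h2
    have hpos : 0 ≤ (1 : ℝ) / 8 * ((2 * m : ℝ) ^ (1 / 2 : ℝ) / ε ^ 2) := by positivity
    have hlt : (1 : ℝ) / 8 * ((2 * m : ℝ) ^ (1 / 2 : ℝ) / ε ^ 2) < s := by
      nlinarith [hc, hpos, hs]
    linarith

/-- The same on bit strings: for `E_n = {0,1}^n`, `n ≥ 1`, Theorem 2's lower bound holds for the uniform
target with `c₂ = 1/8`, unconditionally. [cite: HangleiterEtAl2019, Theorem 2 p. 5 and §V.A (“E_n = {0,1}^n”) p. 8] -/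
theorem vvLowerBoundAt_uniformDist_bitstrings {n : ℕ} (hn : 1 ≤ n) {ε : ℝ} (hε : 0 < ε)
    (hε2 : ε ≤ 1 / 2) : VVLowerBoundAt (1 / 8) ε (uniformDist (Fin n → Bool)) := by
  have hcard : Fintype.card (Fin n → Bool) = 2 * 2 ^ (n - 1) := by
    rw [Fintype.card_fun, Fintype.card_bool, Fintype.card_fin, ← pow_succ', Nat.sub_add_cancel hn]
  exact vvLowerBoundAt_uniformDist (m := 2 ^ (n - 1)) (by positivity) hcard hε hε2

end flatVV

/-! ## v6 — restriction to the support; eq. (9) for every target flat on its support (any `κ`)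

A certification test only “sees” outcomes of positive probability under the hypotheses it must separate:
if the target vanishes off `S ⊆ E`, the test restricts to `S` (`IsCertTest.restrict`), so the flat-target
bounds of sections `flat` … `flatVV` apply to every distribution that is UNIFORM ON ITS SUPPORT `S`,
`|S| = 2m` — eq. (9) with `κ = |S|/|E|` arbitrary (`flatOn_certification_lower_bound`). -/

section support
variable {E : Type*} [Fintype E]

/-- Sums of transcript functionals vanishing off `S^s` are sums over transcripts valued in `S` (plumbing). [cite: HangleiterEtAl2019, Definition 1, p. 4] -/
theorem sum_seq_support (S : Finset E) {s : ℕ} (g : (Fin s → E) → ℝ)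
    (hg : ∀ F : Fin s → E, (¬ ∀ k, F k ∈ S) → g F = 0) :
    ∑ F : Fin s → E, g F = ∑ R : Fin s → ↥S, g (fun k => (R k : E)) := by
  classical
  have h1 : ∑ F : Fin s → E, g F = ∑ F ∈ univ.filter (fun F : Fin s → E => ∀ k, F k ∈ S), g F := by
    rw [sum_filter]
    refine sum_congr rfl fun F _ => ?_
    split_ifs with h
    · rfl
    · exact hg F h
  have h2 : ∑ F ∈ univ.filter (fun F : Fin s → E => ∀ k, F k ∈ S), g F =
      ∑ F' : {F : Fin s → E // ∀ k, F k ∈ S}, g F'.1 :=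
    Finset.sum_subtype _ (fun F => by simp) g
  rw [h1, h2]
  exact Fintype.sum_equiv (Equiv.subtypePiEquivPi (p := fun (_ : Fin s) (x : E) => x ∈ S))
    (fun F' => g F'.1) (fun R => g (fun k => (R k : E))) (fun F' => rfl)

/-- **Restriction to the support.** If the target `P` vanishes off `S`, its acceptance probability under
any test equals that of `P|_S` under the test read through the inclusion `S ⊆ E` (transcripts leaving `S`
have probability `0`). [cite: HangleiterEtAl2019, Definition 1, p. 4] -/
theorem accProb_restrict {S : Finset E} {P : E → ℝ} (hPS : ∀ x ∉ S, P x = 0) (s : ℕ)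
    (T : (Fin s → E) → Bool) :
    accProb P s T = accProb (fun a : ↥S => P a) s (fun R => T (fun k => (R k : E))) := by
  unfold accProb
  refine sum_seq_support S _ fun F hF => ?_
  have h0 : ∏ k, P (F k) = 0 := by
    push Not at hF
    obtain ⟨k, hk⟩ := hF
    exact Finset.prod_eq_zero (mem_univ k) (hPS _ hk)
  simp [h0]

/-- The `ℓ₁` distance of two vectors vanishing off `S` is computed on `S`. [cite: HangleiterEtAl2019, §II (norms) and §III (“restriction P↾F”), pp. 4, 6] -/
theorem l1Dist_restrict {S : Finset E} {P Q : E → ℝ} (hPS : ∀ x ∉ S, P x = 0)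
    (hQS : ∀ x ∉ S, Q x = 0) :
    l1Dist P Q = l1Dist (fun a : ↥S => P a) (fun a : ↥S => Q a) := by
  unfold l1Dist
  rw [← Finset.sum_subtype S (fun x => Iff.rfl) (fun x => |P x - Q x|)]
  symm
  refine Finset.sum_subset (subset_univ S) fun x _ hx => ?_
  rw [hPS x hx, hQS x hx, sub_zero, abs_zero]

/-- The total mass of a vector vanishing off `S` is computed on `S`. [cite: HangleiterEtAl2019, §III (“P(F) := ∥P↾F∥₁”), p. 6] -/
theorem sum_restrict {S : Finset E} {Q : E → ℝ} (hQS : ∀ x ∉ S, Q x = 0) :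
    ∑ x, Q x = ∑ a : ↥S, Q a := by
  rw [← Finset.sum_subtype S (fun x => Iff.rfl) Q]
  symm
  exact Finset.sum_subset (subset_univ S) fun x _ hx => hQS x hx

/-- **Certification tests restrict to the support of the target.** If `P` vanishes off `S` and `T` is an
`ε`-certification test of `P` on `E`, then `T` read through the inclusion is an `ε`-certification test of
`P|_S` on `S`: completeness (6) is the same number, and for soundness (7) every alternative on `S` extends
by zero to an alternative on `E` at the same `ℓ₁` distance. [cite: HangleiterEtAl2019, Definition 1 eqs. (6)–(7), p. 4] -/
theorem IsCertTest.restrict {S : Finset E} {P : E → ℝ} (hPS : ∀ x ∉ S, P x = 0) {ε : ℝ} {s : ℕ}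
    {T : (Fin s → E) → Bool} (hT : IsCertTest P ε s T) :
    IsCertTest (fun a : ↥S => P a) ε s (fun R => T (fun k => (R k : E))) where
  complete := by
    rw [← accProb_restrict hPS]
    exact hT.complete
  sound Q' hQ0 hQ1 hfar := by
    classical
    -- extend Q' by zero
    set Q : E → ℝ := fun x => if h : x ∈ S then Q' ⟨x, h⟩ else 0 with hQ
    have hQS : ∀ x ∉ S, Q x = 0 := fun x hx => by simp [hQ, hx]
    have hQres : (fun a : ↥S => Q a) = Q' := by
      funext a; simp [hQ, a.2]
    have h0 : ∀ x, 0 ≤ Q x := fun x => by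
      simp only [hQ]; split_ifs <;> simp [hQ0]
    have h1 : ∑ x, Q x = 1 := by rw [sum_restrict hQS, hQres, hQ1]
    have hd : ε < l1Dist P Q := by rw [l1Dist_restrict hPS hQS, hQres]; exact hfar
    have := hT.sound Q h0 h1 hd
    rwa [accProb_restrict hQS, hQres] at this

variable [DecidableEq E]

/-- The distribution FLAT ON `S ⊆ E`: `P(x) = 1/|S|` on `S`, `0` off `S` — min-entropy
`H_∞(P) = log₂ |S| = log₂(κ|E|)` with `κ = |S|/|E|`, the targets of eq. (9) (“If for some constant `κ` it holds
that `H_∞(P) = log(κ|E_n|)`”); also the no-instances of the birthday-paradox bound (“the uniform distribution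
on half of the elements”). [cite: HangleiterEtAl2019, eq. (9), p. 5] [cite: Canonne2020, §5.1 (“An Ω(√n/ε²) lower bound”)] -/
def flatOn (S : Finset E) : E → ℝ := fun x => if x ∈ S then 1 / (S.card : ℝ) else 0

omit [Fintype E] in
/-- Off the support the flat distribution vanishes. [cite: HangleiterEtAl2019, eq. (9), p. 5] -/
theorem flatOn_of_not_mem {S : Finset E} {x : E} (hx : x ∉ S) : flatOn S x = 0 := by
  simp [flatOn, hx]

omit [Fintype E] in
/-- On the support the flat distribution is `1/|S|`. [cite: HangleiterEtAl2019, eq. (9), p. 5] -/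
theorem flatOn_of_mem {S : Finset E} {x : E} (hx : x ∈ S) : flatOn S x = 1 / (S.card : ℝ) := by
  simp [flatOn, hx]

omit [Fintype E] in
/-- Restricted to its support, the flat distribution is the uniform distribution `uniformDist ↥S`. [cite: HangleiterEtAl2019, eq. (9), p. 5] -/
theorem flatOn_restrict (S : Finset E) : (fun a : ↥S => flatOn S a) = uniformDist ↥S := by
  funext a
  rw [flatOn_of_mem a.2, uniformDist_apply, Fintype.card_coe]

/-- **Eq. (9) for every target that is flat on its support — PROVED, unconditionally.** If `P` is uniform
on a set `S` of `2m ≥ 2` outcomes of `E` (and zero elsewhere), every `ε`-certification test of `P`,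
`0 < ε ≤ 1/2`, uses `s` samples with `s² > m/(26ε⁴) = |S|/(52ε⁴) = κ|E|/(52ε⁴)`: “`s²_min ≥ c₂² (κ|E_n|/ϵ⁴)(1 − 2ϵ − 1/(κ|E_n|))³`”
with the Valiant–Valiant input replaced by the tree's Paninski bound, via `IsCertTest.restrict` and
`uniform_certification_lower_bound_card`. [cite: HangleiterEtAl2019, eq. (9), p. 5] [cite: Paninski2008, lower bound Ω(√n/ε²) (via Canonne2020 §5.1)] -/
theorem flatOn_certification_lower_bound {S : Finset E} {m : ℕ} (hm : 0 < m) (hS : S.card = 2 * m)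
    {ε : ℝ} (hε : 0 < ε) (hε2 : ε ≤ 1 / 2) {s : ℕ} {T : (Fin s → E) → Bool}
    (hT : IsCertTest (flatOn S) ε s T) : (m : ℝ) / (26 * ε ^ 4) < (s : ℝ) ^ 2 := by
  have h := hT.restrict (S := S) fun x hx => flatOn_of_not_mem hx
  rw [flatOn_restrict] at h
  exact uniform_certification_lower_bound_card hm (by rw [Fintype.card_coe, hS]) hε hε2 h

end support

/-! ## v7 — Theorem 2 (lower bound) for every target flat on its support -/

section supportSize
variable {ι : Type*} [Fintype ι]

/-- `‖·‖₀` of the sorted value list is the support size of `P`. [cite: HangleiterEtAl2019, §II (“∥x∥₀ := |{i ∈ [n] : x_i ≠ 0}|”), p. 4] -/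
theorem nzCount_vals [DecidableEq ι] (P : ι → ℝ) :
    nzCount (vals P) = (univ.filter fun i => P i ≠ 0).card := by
  classical
  unfold nzCount vals
  rw [← Multiset.coe_countP, Multiset.sort_eq, Multiset.countP_map]
  rw [← Finset.filter_val, Finset.card_val]

/-- `‖P^{−max}_{−ε}‖₀ ≤ |supp P|`: trimming and dropping the maximum only remove entries. [cite: HangleiterEtAl2019, §III items (i)–(ii), p. 5] -/
theorem vvSupp_le_card_support [Nonempty ι] [DecidableEq ι] (ε : ℝ) (P : ι → ℝ) :
    vvSupp ε P ≤ (univ.filter fun i => P i ≠ 0).card := by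
  rw [← nzCount_vals]
  unfold vvSupp vvVec nzCount
  exact (trim_suffix _ _).sublist.countP_le.trans (List.dropLast_sublist _).countP_le

/-- The support of `flatOn S` is `S`. [cite: HangleiterEtAl2019, eq. (9), p. 5] -/
theorem support_flatOn {E : Type*} [Fintype E] [DecidableEq E] {S : Finset E} (hS : S.Nonempty) :
    (univ.filter fun x => flatOn S x ≠ 0) = S := by
  ext x
  simp only [mem_filter, mem_univ, true_and]
  constructor
  · intro h
    by_contra hx
    exact h (flatOn_of_not_mem hx)
  · intro hx
    rw [flatOn_of_mem hx]
    have : (0 : ℝ) < S.card := by exact_mod_cast hS.card_pos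
    positivity

/-- `flatOn S` is entrywise nonnegative. [cite: HangleiterEtAl2019, §II (probability vectors), p. 4] -/
theorem flatOn_nonneg {E : Type*} [Fintype E] [DecidableEq E] (S : Finset E) (x : E) :
    0 ≤ flatOn S x := by
  unfold flatOn; split_ifs <;> positivity

/-- `flatOn S` has total mass `1` for nonempty `S`. [cite: HangleiterEtAl2019, §II (probability vectors), p. 4] -/
theorem sum_flatOn {E : Type*} [Fintype E] [DecidableEq E] {S : Finset E} (hS : S.Nonempty) :
    ∑ x, flatOn S x = 1 := by
  haveI : Nonempty ↥S := hS.to_subtype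
  rw [sum_restrict (S := S) (fun x hx => flatOn_of_not_mem hx)]
  rw [show (∑ a : ↥S, flatOn S a) = ∑ a : ↥S, uniformDist ↥S a from
    sum_congr rfl fun a _ => congr_fun (flatOn_restrict S) a]
  exact sum_uniformDist _

/-- **Theorem 2 (Valiant–Valiant, lower-bound half) DISCHARGED for every target flat on its support,
`c₂ = 1/8`.** For `P` uniform on `S ⊆ E` with `|S| = 2m ≥ 2` and `0 < ε ≤ 1/2`, `VVLowerBoundAt (1/8) ε P`
is a theorem: the `1/ϵ` branch by `certification_needs_inv_eps`, the `‖·‖_{2/3}` branch by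
`flatOn_certification_lower_bound` with `‖P^{−max}_{−2ϵ}‖_{2/3} ≤ √|S|` (`vvNorm_le`,
`vvSupp_le_card_support`, `support_flatOn`). [cite: HangleiterEtAl2019, Theorem 2 and eq. (9), p. 5] [cite: ValiantValiant2017, Thm. 1 (flat-on-support case)] -/
theorem vvLowerBoundAt_flatOn {E : Type*} [Fintype E] [Nonempty E] [DecidableEq E] {S : Finset E}
    {m : ℕ} (hm : 0 < m) (hS : S.card = 2 * m) {ε : ℝ} (hε : 0 < ε) (hε2 : ε ≤ 1 / 2) :
    VVLowerBoundAt (1 / 8) ε (flatOn S) := by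
  intro s T hT
  have hSne : S.Nonempty := by rw [← Finset.card_pos]; omega
  haveI : Nontrivial E := Fintype.one_lt_card_iff_nontrivial.mp
    (lt_of_lt_of_le (by omega : 1 < S.card) (Finset.card_le_univ S))
  have hU0 : ∀ x, 0 ≤ flatOn S x := flatOn_nonneg S
  have hU1 : ∑ x, flatOn S x = 1 := sum_flatOn hSne
  have hs : (0 : ℝ) ≤ s := Nat.cast_nonneg s
  have h1 : 1 / (3 * ε) < (s : ℝ) := certification_needs_inv_eps (flatOn S) hU0 hU1 hε hε2 hT
  have h2 : (m : ℝ) / (26 * ε ^ 4) < (s : ℝ) ^ 2 := flatOn_certification_lower_bound hm hS hε hε2 hT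
  have hScard : ((univ.filter fun x => flatOn S x ≠ 0).card : ℝ) = 2 * m := by
    rw [support_flatOn hSne]; exact_mod_cast hS
  have hnorm : vvNorm (2 * ε) (flatOn S) ≤ (2 * m : ℝ) ^ (1 / 2 : ℝ) := by
    have h := vvNorm_le (by linarith : (0 : ℝ) ≤ 2 * ε) hU0 hU1
    have hp1 : 1 - pmax (flatOn S) ≤ 1 := by linarith [pmax_pos hU0 hU1]
    have hsupp : (vvSupp (2 * ε) (flatOn S) : ℝ) ^ (1 / 2 : ℝ) ≤ (2 * m : ℝ) ^ (1 / 2 : ℝ) := by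
      rw [← hScard]
      exact Real.rpow_le_rpow (Nat.cast_nonneg _)
        (by exact_mod_cast vvSupp_le_card_support (2 * ε) (flatOn S)) (by norm_num)
    calc vvNorm (2 * ε) (flatOn S)
        ≤ (1 - pmax (flatOn S)) * (vvSupp (2 * ε) (flatOn S) : ℝ) ^ (1 / 2 : ℝ) := h
      _ ≤ 1 * (2 * m : ℝ) ^ (1 / 2 : ℝ) :=
          mul_le_mul hp1 hsupp (Real.rpow_nonneg (Nat.cast_nonneg _) _) zero_le_one
      _ = (2 * m : ℝ) ^ (1 / 2 : ℝ) := one_mul _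
  have hsq : ((2 * m : ℝ) ^ (1 / 2 : ℝ)) ^ 2 = 2 * m := by
    rw [← Real.rpow_natCast, ← Real.rpow_mul (by positivity)]; norm_num
  rw [mul_max_of_nonneg _ _ (by norm_num : (0 : ℝ) ≤ 1 / 8)]
  refine max_le ?_ ?_
  · have : (1 : ℝ) / 8 * (1 / ε) ≤ 1 / (3 * ε) := by
      rw [show (1 : ℝ) / 8 * (1 / ε) = 1 / (8 * ε) by ring]
      exact one_div_le_one_div_of_le (by positivity) (by nlinarith)
    linarith
  · have hb : (1 : ℝ) / 8 * (vvNorm (2 * ε) (flatOn S) / ε ^ 2) ≤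
        (1 / 8) * ((2 * m : ℝ) ^ (1 / 2 : ℝ) / ε ^ 2) := by
      gcongr
    have hc : ((1 : ℝ) / 8 * ((2 * m : ℝ) ^ (1 / 2 : ℝ) / ε ^ 2)) ^ 2 < (s : ℝ) ^ 2 := by
      have hε4 : 0 < ε ^ 4 := by positivity
      calc ((1 : ℝ) / 8 * ((2 * m : ℝ) ^ (1 / 2 : ℝ) / ε ^ 2)) ^ 2
          = (m : ℝ) / (32 * ε ^ 4) := by
            simp only [mul_pow, div_pow, hsq]; field_simp; ring
        _ ≤ (m : ℝ) / (26 * ε ^ 4) := by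
            apply div_le_div_of_nonneg_left (by positivity) (by positivity); nlinarith
        _ < (s : ℝ) ^ 2 := h2
    have hpos : 0 ≤ (1 : ℝ) / 8 * ((2 * m : ℝ) ^ (1 / 2 : ℝ) / ε ^ 2) := by positivity
    have hlt : (1 : ℝ) / 8 * ((2 * m : ℝ) ^ (1 / 2 : ℝ) / ε ^ 2) < s := by
      nlinarith [hc, hpos, hs]
    linarith

end supportSize

/-! ## v8 — Theorem 2 (lower bound) for flat targets of ANY support size `≥ 2`

“taking without loss of generality the domain to be `[n]` and `n` to be even” [cite: Canonne2020, §5.1]: the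
v2 section of `UniformityTestingLowerBound.lean` removes the loss of generality (Paninski's family padded by
unperturbed points, `samples_sq_gtP`), so the flat-target lower bound and the discharge of the
`VVLowerBoundAt` hypothesis now hold for every support size `|S| ≥ 2` with the SAME constants
(`c₂ = 1/8`, `0 < ε ≤ 1/2`; sample bound `s² > |S|/(52ε⁴)`), superseding the even-size statements of v3/v6/v7.
[cite: HangleiterEtAl2019, Theorem 2 and eq. (9), p. 5] -/

section flatAnySize
open Literature.Probability.HypothesisTesting.UniformityTesting

/-- `‖U − P_z‖₁ = |η|·2m/(2m+r)` for the padded family. [cite: Canonne2020, §5.1 (“exactly ε-far from uniform”)] -/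
theorem l1Dist_unifP_paninskiP {m r : ℕ} (hm : 0 < m) (η : ℝ) (z : Fin m → Bool) :
    l1Dist (unifP m r) (paninskiP (r := r) η z) = |η| * (2 * m) / (2 * m + r) := by
  unfold l1Dist
  rw [← l1_paninskiP_unifP hm η z]
  exact sum_congr rfl fun x _ => abs_sub_comm _ _

/-- **Theorem 2 (lower-bound half) for the flat target on `2m + r` points, `r < 2m` — PROVED.** Every
`ε`-certification test (`0 < ε ≤ 1/2`) of the uniform distribution from `s` samples has
`s² > (2m + r)/(52 ε⁴)` (Paninski's padded family with `η = 2ε`: the perturbations are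
`2ε·2m/(2m+r) > ε` far in `ℓ₁`, so soundness (7) rejects each of them).
[cite: HangleiterEtAl2019, Theorem 2 and eq. (9), p. 5] [cite: Paninski2008, lower bound Ω(√n/ε²) (via Canonne2020 §5.1)] -/
theorem uniform_certification_lower_bound_padded {m r : ℕ} (hm : 0 < m) (hr : r < 2 * m) {ε : ℝ}
    (hε : 0 < ε) (hε2 : ε ≤ 1 / 2) {s : ℕ} {T : (Fin s → PSpace m r) → Bool}
    (hT : IsCertTest (unifP m r) ε s T) : ((2 * m + r : ℕ) : ℝ) / (52 * ε ^ 4) < (s : ℝ) ^ 2 := by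
  have hη : (2 * ε) ^ 2 ≤ 1 := by nlinarith
  have h0 : (0 : ℝ) < 2 * m + r := by positivity
  have hφ0 : ∀ S : Fin s → PSpace m r, 0 ≤ (if T S then (1 : ℝ) else 0) := fun S => by
    split_ifs <;> norm_num
  have hφ1 : ∀ S : Fin s → PSpace m r, (if T S then (1 : ℝ) else 0) ≤ 1 := fun S => by
    split_ifs <;> norm_num
  have hcomplete : 2 / 3 ≤ accept (unifP m r) (fun S => if T S then (1 : ℝ) else 0) := by
    rw [← accProb_eq_accept]; exact hT.complete
  have hsound : ∀ z : Fin m → Bool,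
      accept (paninskiP (r := r) (2 * ε) z) (fun S => if T S then (1 : ℝ) else 0) < 1 / 3 := by
    intro z
    rw [← accProb_eq_accept]
    refine hT.sound (paninskiP (2 * ε) z) (paninskiP_nonneg ?_ z) (sum_paninskiP hm _ z) ?_
    · rw [abs_of_pos (by linarith)]; linarith
    · rw [l1Dist_unifP_paninskiP hm, abs_of_pos (by linarith)]
      have hr' : (r : ℝ) < 2 * m := by exact_mod_cast hr
      rw [lt_div_iff₀ h0]
      nlinarith
  have key := samples_sq_gtP (r := r) hm hη _ hφ0 hφ1 hcomplete hsound
  rw [div_lt_iff₀ (by positivity)]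
  push_cast
  nlinarith [key]

/-- **Theorem 2 (lower-bound half) for the flat target on ANY sample space with at least two points —
PROVED**: `s² > |E|/(52 ε⁴)` for every `ε`-certification test of the uniform distribution on `E`,
`0 < ε ≤ 1/2` (write `|E| = 2m + r`, `r ∈ {0,1}`, and transport along a bijection).
[cite: HangleiterEtAl2019, Theorem 2 and eq. (9), p. 5] [cite: Canonne2020, §5.1 (“without loss of generality … n to be even”)] -/
theorem uniform_certification_lower_bound_card_two_le {E : Type*} [Fintype E] (hE : 2 ≤ Fintype.card E)
    {ε : ℝ} (hε : 0 < ε) (hε2 : ε ≤ 1 / 2) {s : ℕ} {T : (Fin s → E) → Bool}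
    (hT : IsCertTest (uniformDist E) ε s T) : (Fintype.card E : ℝ) / (52 * ε ^ 4) < (s : ℝ) ^ 2 := by
  set m := Fintype.card E / 2 with hm_def
  set r := Fintype.card E % 2 with hr_def
  have hN : Fintype.card E = 2 * m + r := (Nat.div_add_mod (Fintype.card E) 2).symm
  have hm : 0 < m := Nat.div_pos hE two_pos
  have hr : r < 2 * m := lt_of_lt_of_le (Nat.mod_lt _ two_pos) (by omega)
  have hc : Fintype.card (PSpace m r) = Fintype.card E := by
    rw [hN]; simp [PSpace, Fintype.card_sum, Fintype.card_prod, mul_comm]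
  obtain ⟨e⟩ : Nonempty (PSpace m r ≃ E) := ⟨Fintype.equivOfCardEq hc⟩
  have h := hT.comp_equiv e
  have hu : uniformDist E ∘ e = unifP m r := by
    ext x
    simp only [Function.comp_apply, uniformDist, unifP, hN, Nat.cast_add, Nat.cast_mul, Nat.cast_ofNat]
  rw [hu] at h
  have := uniform_certification_lower_bound_padded hm hr hε hε2 h
  rw [hN]
  exact this

/-- **Every target flat on a support of size `≥ 2`**: an `ε`-certification test of `flatOn S`
(`0 < ε ≤ 1/2`) uses `s` samples with `s² > |S|/(52 ε⁴)`. [cite: HangleiterEtAl2019, Theorem 2 and eq. (9), p. 5] -/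
theorem flatOn_certification_lower_bound_two_le {E : Type*} [Fintype E] [DecidableEq E] {S : Finset E}
    (hS : 2 ≤ S.card)
    {ε : ℝ} (hε : 0 < ε) (hε2 : ε ≤ 1 / 2) {s : ℕ} {T : (Fin s → E) → Bool}
    (hT : IsCertTest (flatOn S) ε s T) : (S.card : ℝ) / (52 * ε ^ 4) < (s : ℝ) ^ 2 := by
  have h := hT.restrict (S := S) fun x hx => flatOn_of_not_mem hx
  rw [flatOn_restrict] at h
  have := uniform_certification_lower_bound_card_two_le (E := ↥S) (by rw [Fintype.card_coe]; exact hS) hε hε2 h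
  rwa [Fintype.card_coe] at this

/-- **Theorem 2 (Valiant–Valiant, lower-bound half) DISCHARGED for every target flat on its support of
size `≥ 2`, `c₂ = 1/8`** (the even-size hypothesis of `vvLowerBoundAt_flatOn` removed): for `P` uniform on
`S ⊆ E` with `|S| ≥ 2` and `0 < ε ≤ 1/2`, `VVLowerBoundAt (1/8) ε P` is a theorem.
[cite: HangleiterEtAl2019, Theorem 2 and eq. (9), p. 5] [cite: ValiantValiant2017, Thm. 1 (flat-on-support case)] -/
theorem vvLowerBoundAt_flatOn_two_le {E : Type*} [Fintype E] [Nonempty E] [DecidableEq E] {S : Finset E}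
    (hS : 2 ≤ S.card) {ε : ℝ} (hε : 0 < ε) (hε2 : ε ≤ 1 / 2) :
    VVLowerBoundAt (1 / 8) ε (flatOn S) := by
  intro s T hT
  have hSne : S.Nonempty := by rw [← Finset.card_pos]; omega
  haveI : Nontrivial E := Fintype.one_lt_card_iff_nontrivial.mp
    (lt_of_lt_of_le (by omega : 1 < S.card) (Finset.card_le_univ S))
  have hU0 : ∀ x, 0 ≤ flatOn S x := flatOn_nonneg S
  have hU1 : ∑ x, flatOn S x = 1 := sum_flatOn hSne
  have hs : (0 : ℝ) ≤ s := Nat.cast_nonneg s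
  have h1 : 1 / (3 * ε) < (s : ℝ) := certification_needs_inv_eps (flatOn S) hU0 hU1 hε hε2 hT
  have h2 : (S.card : ℝ) / (52 * ε ^ 4) < (s : ℝ) ^ 2 := flatOn_certification_lower_bound_two_le hS hε hε2 hT
  have hScard : ((univ.filter fun x => flatOn S x ≠ 0).card : ℝ) = S.card := by
    rw [support_flatOn hSne]
  have hnorm : vvNorm (2 * ε) (flatOn S) ≤ (S.card : ℝ) ^ (1 / 2 : ℝ) := by
    have h := vvNorm_le (by linarith : (0 : ℝ) ≤ 2 * ε) hU0 hU1
    have hp1 : 1 - pmax (flatOn S) ≤ 1 := by linarith [pmax_pos hU0 hU1]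
    have hsupp : (vvSupp (2 * ε) (flatOn S) : ℝ) ^ (1 / 2 : ℝ) ≤ (S.card : ℝ) ^ (1 / 2 : ℝ) := by
      rw [← hScard]
      exact Real.rpow_le_rpow (Nat.cast_nonneg _)
        (by exact_mod_cast vvSupp_le_card_support (2 * ε) (flatOn S)) (by norm_num)
    calc vvNorm (2 * ε) (flatOn S)
        ≤ (1 - pmax (flatOn S)) * (vvSupp (2 * ε) (flatOn S) : ℝ) ^ (1 / 2 : ℝ) := h
      _ ≤ 1 * (S.card : ℝ) ^ (1 / 2 : ℝ) :=
          mul_le_mul hp1 hsupp (Real.rpow_nonneg (Nat.cast_nonneg _) _) zero_le_one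
      _ = (S.card : ℝ) ^ (1 / 2 : ℝ) := one_mul _
  have hsq : ((S.card : ℝ) ^ (1 / 2 : ℝ)) ^ 2 = S.card := by
    rw [← Real.rpow_natCast, ← Real.rpow_mul (by positivity)]; norm_num
  rw [mul_max_of_nonneg _ _ (by norm_num : (0 : ℝ) ≤ 1 / 8)]
  refine max_le ?_ ?_
  · have : (1 : ℝ) / 8 * (1 / ε) ≤ 1 / (3 * ε) := by
      rw [show (1 : ℝ) / 8 * (1 / ε) = 1 / (8 * ε) by ring]
      exact one_div_le_one_div_of_le (by positivity) (by nlinarith)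
    linarith
  · have hb : (1 : ℝ) / 8 * (vvNorm (2 * ε) (flatOn S) / ε ^ 2) ≤
        (1 / 8) * ((S.card : ℝ) ^ (1 / 2 : ℝ) / ε ^ 2) := by
      gcongr
    have hc : ((1 : ℝ) / 8 * ((S.card : ℝ) ^ (1 / 2 : ℝ) / ε ^ 2)) ^ 2 < (s : ℝ) ^ 2 := by
      have hε4 : 0 < ε ^ 4 := by positivity
      calc ((1 : ℝ) / 8 * ((S.card : ℝ) ^ (1 / 2 : ℝ) / ε ^ 2)) ^ 2
          = (S.card : ℝ) / (64 * ε ^ 4) := by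
            simp only [mul_pow, div_pow, hsq]; field_simp; ring
        _ ≤ (S.card : ℝ) / (52 * ε ^ 4) := by
            apply div_le_div_of_nonneg_left (by positivity) (by positivity); nlinarith
        _ < (s : ℝ) ^ 2 := h2
    have hpos : 0 ≤ (1 : ℝ) / 8 * ((S.card : ℝ) ^ (1 / 2 : ℝ) / ε ^ 2) := by positivity
    have hlt : (1 : ℝ) / 8 * ((S.card : ℝ) ^ (1 / 2 : ℝ) / ε ^ 2) < s := by
      nlinarith [hc, hpos, hs]
    linarith

end flatAnySize

/-! ## v9 — every flat-on-support target (support size `≥ 1`), and Theorem 7b hypothesis-free for every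
exact state 2-design with flat-on-support outputs

The point-mass case (`|S| = 1`: the `‖·‖_{2/3}` term of Theorem 2 vanishes once the largest entry is removed,
the `1/ε` branch is `certification_needs_inv_eps`) completes `vvLowerBoundAt_flatOn_two_le` to every nonempty
support, and Theorem 7b (`twoDesign_certification_lower_bound`, v4) becomes hypothesis-free (`c₂ = 1/8`,
`0 < ε ≤ 1/2`) for every exact state 2-design all of whose output distributions are flat on their supports —
“quantum supremacy distributions are flat” [cite: HangleiterEtAl2019, §IV.B and eq. (9), pp. 5–7] — e.g. the
complete MUB ensembles of `MutuallyUnbiasedBases.lean` (whose own `vvLowerBoundAt_flatOn_singleton` predates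
this section and is kept there). -/

section flatAll

/-- Theorem 2's lower bound for a POINT MASS, `c₂ = 1/8`: every `ε`-certification test of `δ_b` uses
`s ≥ 1/(8ε)` samples. [cite: HangleiterEtAl2019, Theorem 2, p. 5] [cite: ValiantValiant2017, Thm. 1 (point-mass case)] -/
theorem vvLowerBoundAt_flatOn_card_one {E : Type*} [Fintype E] [DecidableEq E] [Nontrivial E] (b : E)
    {ε : ℝ} (hε : 0 < ε) (hε2 : ε ≤ 1 / 2) : VVLowerBoundAt (1 / 8) ε (flatOn ({b} : Finset E)) := by
  intro s T hT
  have hU0 : ∀ x, 0 ≤ flatOn ({b} : Finset E) x := flatOn_nonneg {b}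
  have hU1 : ∑ x, flatOn ({b} : Finset E) x = 1 := sum_flatOn (Finset.singleton_nonempty b)
  have hs : (0 : ℝ) ≤ s := Nat.cast_nonneg s
  have h1 : 1 / (3 * ε) < (s : ℝ) := certification_needs_inv_eps (flatOn {b}) hU0 hU1 hε hε2 hT
  have hpmax : 1 ≤ pmax (flatOn ({b} : Finset E)) := by
    have h := Finset.le_sup' (flatOn ({b} : Finset E)) (Finset.mem_univ b)
    rw [flatOn_of_mem (Finset.mem_singleton_self b), Finset.card_singleton, Nat.cast_one, div_one] at h
    exact h
  have hnorm : vvNorm (2 * ε) (flatOn ({b} : Finset E)) ≤ 0 := by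
    have h := vvNorm_le (by linarith : (0 : ℝ) ≤ 2 * ε) hU0 hU1
    have hX : (0 : ℝ) ≤ (vvSupp (2 * ε) (flatOn ({b} : Finset E)) : ℝ) ^ (1 / 2 : ℝ) :=
      Real.rpow_nonneg (Nat.cast_nonneg _) _
    nlinarith
  rw [mul_max_of_nonneg _ _ (by norm_num : (0 : ℝ) ≤ 1 / 8)]
  refine max_le ?_ ?_
  · have : (1 : ℝ) / 8 * (1 / ε) ≤ 1 / (3 * ε) := by
      rw [show (1 : ℝ) / 8 * (1 / ε) = 1 / (8 * ε) by ring]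
      exact one_div_le_one_div_of_le (by positivity) (by nlinarith)
    linarith
  · have h3 : vvNorm (2 * ε) (flatOn ({b} : Finset E)) / ε ^ 2 ≤ 0 :=
      div_nonpos_iff.2 (Or.inr ⟨hnorm, by positivity⟩)
    linarith

/-- **Theorem 2 (Valiant–Valiant, lower-bound half) DISCHARGED for EVERY target flat on a nonempty support**
(`c₂ = 1/8`, `0 < ε ≤ 1/2`; sample space with at least two outcomes). [cite: HangleiterEtAl2019, Theorem 2 and eq. (9), p. 5] [cite: ValiantValiant2017, Thm. 1 (flat-on-support case)] -/
theorem vvLowerBoundAt_flatOn_of_nonempty {E : Type*} [Fintype E] [DecidableEq E] [Nontrivial E]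
    {S : Finset E} (hS : S.Nonempty) {ε : ℝ} (hε : 0 < ε) (hε2 : ε ≤ 1 / 2) :
    VVLowerBoundAt (1 / 8) ε (flatOn S) := by
  haveI : Nonempty E := ⟨hS.choose⟩
  rcases Nat.lt_or_ge S.card 2 with h | h
  · obtain ⟨b, hb⟩ : ∃ b, S = {b} := Finset.card_eq_one.1 (by have := Finset.card_pos.2 hS; omega)
    subst hb
    exact vvLowerBoundAt_flatOn_card_one b hε hε2
  · exact vvLowerBoundAt_flatOn_two_le h hε hε2

open DesignAnticoncentration in
open Classical in
/-- **Theorem 7b, hypothesis-free, for every exact state 2-design with flat-on-support outputs** (`c₂ = 1/8`,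
`0 < ε ≤ 1/2`): if every output distribution `P_j = |⟨·|ψ_j⟩|²` of an exact complex-projective 2-design
`{ψ_j}` in `ℂ^V` (`|V| ≥ 2`) is uniform on its support — “quantum supremacy distributions are flat”, eq. (9)
with any `κ`-free support — then at most a `δ`-fraction of the `ψ_j` admit an `ε`-certification test from
fewer than `(1/8)·2^{(log₂N)/4}(δ/2)^{1/4}(1 − 2ε − 2^{−(log₂N)/2}(δ/2)^{−1/2})^{3/2}/ε²` samples; Valiant–Valiant's
Theorem 2 is no longer an input. [cite: HangleiterEtAl2019, Theorem 7(b) eq. (28), §IV.B, eq. (9)] -/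
theorem twoDesign_certification_lower_bound_flat {V : Type*} [Fintype V] [DecidableEq V] [Nontrivial V]
    {J : Type*} [Fintype J] {ψ : J → V → ℂ} (hψ : IsStateTwoDesign ψ)
    (hflat : ∀ j, ∃ S : Finset V, S.Nonempty ∧ designDist ψ j = flatOn S)
    {ε δ : ℝ} (hε : 0 < ε) (hε2 : ε ≤ 1 / 2) (hδ : 0 < δ)
    (hfit : 2 * ε + (2 : ℝ) ^ (-Real.logb 2 (Fintype.card V) / 2) * (δ / 2) ^ (-(1 / 2) : ℝ) ≤ 1) :
    ((univ.filter (fun j : J =>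
        ¬ (∀ (s : ℕ) (T : (Fin s → V) → Bool), IsCertTest (designDist ψ j) ε s T →
          (1 / 8 : ℝ) * ((2 : ℝ) ^ (Real.logb 2 (Fintype.card V) / 4) * (δ / 2) ^ (1 / 4 : ℝ) *
            (1 - 2 * ε - (2 : ℝ) ^ (-Real.logb 2 (Fintype.card V) / 2) *
              (δ / 2) ^ (-(1 / 2) : ℝ)) ^ (3 / 2 : ℝ)) / ε ^ 2 ≤ s))).card : ℝ) /
      (Fintype.card J : ℝ) ≤ δ := by
  haveI : Nonempty V := inferInstance
  refine twoDesign_certification_lower_bound hψ (by norm_num) hε hδ hfit fun j => ?_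
  obtain ⟨S, hS, h⟩ := hflat j
  rw [h]
  exact vvLowerBoundAt_flatOn_of_nonempty hS hε hε2

end flatAll

/-! ## (v10) Theorem 2's UPPER-bound half for the flat target: the collision tester
(Goldreich–Ron; Diakonikolas–Gouleakis–Peebles–Price 2019, Theorem 2.1)

Source, verbatim (held text `paper:doi-10-4086-cjtcs-2019-001`, p. 5): “Algorithm TEST-UNIFORMITY-COLLISIONS
… 3. Define the random variable `s = Σ_{i<j} σ_ij` and the threshold `t = (m choose 2)·(1 + 3ε²/4)/n`.
4. If `s ≥ t` return “NO”; otherwise, return “YES”.  Theorem 2.1. The above estimator, when given m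
samples drawn from a distribution p over [n] will, with probability at least 3/4, distinguish the case that
`‖p − U_n‖₂² ≤ ε²/(2n)` from the case that `‖p − U_n‖₂² ≥ ε²/n` provided that `m ≥ 3200 n^{1/2}/ε²`.”
The tree's `CollisionUniformityTester.lean` proves it (`collisionTest_uniform`, `collisionTest_far_l1`);
here it is packaged in the vocabulary of Definition 1. -/

section collisionUpper

open Literature.Probability.HypothesisTesting.CollisionTester

/-- Definition 1 is monotone in `ϵ`: a test sound against every `ε`-far alternative is sound against
every `ε'`-far one, `ε ≤ ε'`. [cite: HangleiterEtAl2019, Definition 1 eq. (7), p. 4] -/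
theorem IsCertTest.of_le {ι : Type*} [Fintype ι] {P : ι → ℝ} {ε ε' : ℝ} {s : ℕ}
    {T : (Fin s → ι) → Bool} (h : IsCertTest P ε s T) (hε : ε ≤ ε') : IsCertTest P ε' s T where
  complete := h.complete
  sound := fun Q hQ hQ1 hfar => h.sound Q hQ hQ1 (lt_of_le_of_lt hε hfar)

/-- The tree's two names for the uniform distribution agree (`uniformDist` here, `unifOn` in
`CollisionUniformityTester`). [cite: HangleiterEtAl2019, eq. (9) (κ = 1), p. 5] -/
theorem uniformDist_eq_unifOn (E : Type*) [Fintype E] : uniformDist E = unifOn E := rfl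

/-- **Theorem 2, UPPER-bound half, for the flat target — PROVED with `c₁` explicit**: for every finite
sample space `E` (`n = |E|`), every `0 < ϵ ≤ 1` and every `m ≥ 3200 √n/ϵ²`, the collision tester
`collisionTest ϵ` (accept iff the number of colliding pairs among the `m` samples is
`< (m choose 2)(1 + 3ϵ²/4)/n`) IS an `ϵ`-certification test of the uniform distribution from `m` samples
in the sense of Definition 1: completeness `Pr_{U^m}[T = 1] ≥ 3/4 ≥ 2/3`, soundness
`Pr_{Q^m}[T = 1] ≤ 1/4 < 1/3` whenever `‖U − Q‖₁ > ϵ` (“there exists an `ϵ`-certification test from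
`c₁ max{1/ϵ, ϵ^{−2}‖P^{−max}_{−ϵ/16}‖_{2/3}}` many samples” — here `P = U`, `‖U^{−max}_{−ϵ/16}‖_{2/3} ≤ √n`).
[cite: HangleiterEtAl2019, Theorem 2 (“Optimal certification tests [36]”, existence half) and Definition 1, pp. 4–5] [cite: DiakonikolasEtAl2019CollisionTesters, Theorem 2.1, p. 5] [cite: Canonne2020, §5.1 Theorem 5.1, p. 9] -/
theorem uniform_certification_upper_bound {E : Type*} [Fintype E] [DecidableEq E] [Nonempty E]
    {ε : ℝ} (hε : 0 < ε) (hε1 : ε ≤ 1) {m : ℕ}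
    (hm : 3200 * Real.sqrt (Fintype.card E : ℝ) / ε ^ 2 ≤ m) :
    IsCertTest (uniformDist E) ε m (collisionTest ε) where
  complete := by
    rw [accProb_eq_accept, accept_eq_expect, uniformDist_eq_unifOn]
    linarith [collisionTest_uniform (E := E) (m := m) hε hε1 hm]
  sound := by
    intro Q hQ hQ1 hfar
    rw [accProb_eq_accept, accept_eq_expect]
    have hfar' : ε < ∑ x, |Q x - 1 / (Fintype.card E : ℝ)| := by
      unfold l1Dist uniformDist at hfar
      simpa only [abs_sub_comm] using hfar
    linarith [collisionTest_far_l1 (m := m) hQ hQ1 hε hε1 hm hfar']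

/-- **An `ϵ`-certification test of the uniform distribution from `⌈3200√n/min(ϵ,1)²⌉` samples exists for
every `ϵ > 0`** (for `ϵ > 1` run the `ϵ = 1` tester: an `ℓ₁`-distance `> ϵ ≥ 1` is `> 1`).
[cite: HangleiterEtAl2019, Theorem 2 (existence half), p. 5] [cite: DiakonikolasEtAl2019CollisionTesters, Theorem 2.1, p. 5] -/
theorem exists_uniform_certTest {E : Type*} [Fintype E] [DecidableEq E] [Nonempty E]
    {ε : ℝ} (hε : 0 < ε) {m : ℕ}
    (hm : 3200 * Real.sqrt (Fintype.card E : ℝ) / (min ε 1) ^ 2 ≤ m) :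
    ∃ T : (Fin m → E) → Bool, IsCertTest (uniformDist E) ε m T :=
  ⟨collisionTest (min ε 1),
    (uniform_certification_upper_bound (lt_min hε one_pos) (min_le_right ε 1) hm).of_le
      (min_le_left ε 1)⟩

/-- **Theorem 2 for the flat target, BOTH halves in the tree, constants explicit** (“Furthermore, this
sample complexity is tight”): on every sample space with `|E| ≥ 2` and for `0 < ϵ ≤ 1/2`, (a) every
`ϵ`-certification test of the uniform distribution uses `s` samples with `s² > |E|/(52ϵ⁴)`
(`s > 0.138 √|E|/ϵ²`, the tree's Paninski bound, v8), and (b) the collision tester is an `ϵ`-certification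
test from every `m ≥ 3200 √|E|/ϵ²` samples: the flat-target sample complexity is `Θ(√|E|/ϵ²)`.
[cite: HangleiterEtAl2019, Theorem 2 and eq. (9) (κ = 1), p. 5] [cite: Canonne2020, §5.1 Theorem 5.1 (“Furthermore, this sample complexity is tight”), p. 9] [cite: DiakonikolasEtAl2019CollisionTesters, Theorem 2.1, p. 5] -/
theorem uniform_certification_sample_complexity {E : Type*} [Fintype E] [DecidableEq E]
    (hE : 2 ≤ Fintype.card E) {ε : ℝ} (hε : 0 < ε) (hε2 : ε ≤ 1 / 2) :
    (∀ (s : ℕ) (T : (Fin s → E) → Bool), IsCertTest (uniformDist E) ε s T →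
        (Fintype.card E : ℝ) / (52 * ε ^ 4) < (s : ℝ) ^ 2) ∧
      (∀ m : ℕ, 3200 * Real.sqrt (Fintype.card E : ℝ) / ε ^ 2 ≤ m →
        IsCertTest (uniformDist E) ε m (collisionTest ε)) := by
  haveI : Nonempty E := Fintype.card_pos_iff.1 (by omega)
  exact ⟨fun s T hT => uniform_certification_lower_bound_card_two_le hE hε hε2 hT,
    fun m hm => uniform_certification_upper_bound hε (by linarith) hm⟩

/-- The worked instance of `flat53_quarter_certification_needs_pow27_samples` (v4), now two-sided: for
the uniform target on `{0,1}^53` and `ϵ = 1/4` no test works from `s ≤ 2^27` samples, while the collision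
tester works from every `m ≥ 3200·16·2^{26.5} ≈ 4.86·10¹²` samples, in particular from `m = 2^43 ≈ 8.8·10¹²`.
[cite: HangleiterEtAl2019, eq. (9), p. 5] [cite: DiakonikolasEtAl2019CollisionTesters, Theorem 2.1, p. 5] -/
theorem flat53_quarter_certification_from_pow43_samples :
    IsCertTest (uniformDist (Fin 53 → Bool)) (1 / 4) (2 ^ 43) (collisionTest (1 / 4)) := by
  refine uniform_certification_upper_bound (by norm_num) (by norm_num) ?_
  have hcard : (Fintype.card (Fin 53 → Bool) : ℝ) = 2 ^ 53 := by
    rw [Fintype.card_fun, Fintype.card_bool, Fintype.card_fin]; norm_num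
  rw [hcard]
  have hs : Real.sqrt ((2 : ℝ) ^ 53) ≤ 2 ^ 27 := by
    rw [Real.sqrt_le_left (by positivity)]
    norm_num
  have : (3200 : ℝ) * Real.sqrt (2 ^ 53) / (1 / 4) ^ 2 ≤ 3200 * 2 ^ 27 / (1 / 4) ^ 2 := by gcongr
  refine this.trans ?_
  norm_num

end collisionUpper

/-! ## (v11) Theorem 2's LOWER-bound half for EVERY target: Valiant–Valiant's instance-optimal bound

The hypothesis predicate `VVLowerBoundAt c₂ ε P` — “there exists no `ϵ`-certification test from fewer than
`c₂ max{1/ϵ, ϵ^{−2} ∥P^{−max}_{−2ϵ}∥_{2/3}}` samples” [cite: HangleiterEtAl2019, Theorem 2] = Valiant–Valiant,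
Theorem 1 (lower half) / ECCC TR13-111 §3 Proposition 2 — is DISCHARGED here for every probability vector on
at least two outcomes and every `0 < ε ≤ 1/2`, with `c₂ = 1/11`, by the tree's
`Literature/Probability/HypothesisTesting/IdentityTestingLowerBound.lean` (`vv_lower_bound_enum`: the
source's Theorem 3 → Corollary 1 → Proposition 2 chain, proved by Le Cam + Ingster on Valiant–Valiant's
perturbation family realised in cancelling pairs).  What this section adds is the bridge between this
file's list presentation of `P^{−max}_{−2ϵ}` (`vals`, `trim`, `vvVec`, `vvNorm`) and the sorted enumeration
used there, and then the hypothesis-free forms of Theorem 7a (both IQP families) and Theorem 7b (exact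
2-designs) with `c₂ = 1/11`. -/

section generalVV
open Literature.Probability.HypothesisTesting.UniformityTesting
open Literature.Probability.HypothesisTesting.IdentityTesting

/-- **The greedy trim is a `drop` with the printed mass bookkeeping**: `trim ε l = l.drop t` where the
dropped prefix has mass `≤ ε` and — if anything survives — the prefix through the first survivor has mass
`> ε` (“iteratively setting the smallest entries to zero, while the sum of the removed entries remains
upper bounded by `ϵ`”). [cite: HangleiterEtAl2019, §III item (ii), p. 5] -/
theorem trim_eq_drop : ∀ {ε : ℝ} (_ : 0 ≤ ε) (l : List ℝ), ∃ t : ℕ, t ≤ l.length ∧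
    trim ε l = l.drop t ∧ (l.take t).sum ≤ ε ∧ (t < l.length → ε < (l.take (t + 1)).sum)
  | ε, hε, [] => ⟨0, le_rfl, by simp [trim], by simpa using hε, by simp⟩
  | ε, hε, a :: l => by
    unfold trim
    split_ifs with h
    · obtain ⟨t, ht, htrim, hsum, hstrict⟩ := trim_eq_drop (sub_nonneg.2 h) l
      refine ⟨t + 1, by simpa using ht, by simpa using htrim, ?_, ?_⟩
      · simp only [List.take_succ_cons, List.sum_cons]
        linarith
      · intro hlt
        have hlt' : t < l.length := by simpa using hlt
        have := hstrict hlt'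
        simp only [List.take_succ_cons, List.sum_cons]
        linarith
    · refine ⟨0, by simp, by simp, by simpa using hε, fun _ => ?_⟩
      simpa using not_le.1 h

/-- Sums over a middle segment `l[t], …, l[m−1]` of a list, as an indexed sum (plumbing for the bridge
between the list `P^{−max}_{−ε}` and the sorted enumeration). [folklore] -/
private theorem sum_map_drop_take (g : ℝ → ℝ) : ∀ (l : List ℝ) (t m : ℕ),
    (((l.take m).drop t).map g).sum =
      ∑ k ∈ range l.length, if t ≤ k ∧ k < m then g (l.getD k 0) else 0
  | [], t, m => by simp
  | a :: l, t, 0 => by simp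
  | a :: l, 0, m + 1 => by
    rw [List.take_succ_cons, List.drop_zero, List.map_cons, List.sum_cons, List.length_cons,
      sum_range_succ']
    have ih := sum_map_drop_take g l 0 m
    rw [List.drop_zero] at ih
    rw [ih, add_comm]
    congr 1
    simp
  | a :: l, t + 1, m + 1 => by
    rw [List.take_succ_cons, List.drop_succ_cons, List.length_cons, sum_range_succ',
      sum_map_drop_take g l t m]
    have h0 : (if t + 1 ≤ 0 ∧ 0 < m + 1 then g ((a :: l).getD 0 0) else 0) = 0 := by simp
    rw [h0, add_zero]
    refine sum_congr rfl fun k _ => ?_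
    simp only [Nat.add_le_add_iff_right, Nat.add_lt_add_iff_right, List.getD_cons_succ]

/-- **A sorted enumeration of the sample space**: a bijection `x : Fin |E| ≃ E` along which `P` is
non-decreasing and whose value list IS the sorted list `vals P` underlying `P^{−max}_{−ε}` (so operation (i)
removes the value at `x_{|E|−1}` and operation (ii) removes the values at a prefix `x_0, …, x_{t−1}`).
[cite: HangleiterEtAl2019, §III items (i)–(ii), p. 5] [cite: ValiantValiant2017, §3 Prop. 2 (“where we assume p_i is sorted in ascending order”), ECCC TR13-111 p. 10] -/
theorem exists_monotone_enum (P : ι → ℝ) :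
    ∃ x : Fin (Fintype.card ι) ≃ ι, Monotone (P ∘ x) ∧ vals P = List.ofFn (P ∘ x) := by
  classical
  let e₀ : ι ≃ Fin (Fintype.card ι) := Fintype.equivFin ι
  let f : Fin (Fintype.card ι) → ℝ := P ∘ e₀.symm
  let x : Fin (Fintype.card ι) ≃ ι := (Tuple.sort f).trans e₀.symm
  have hmono : Monotone (P ∘ x) := Tuple.monotone_sort f
  refine ⟨x, hmono, ?_⟩
  refine List.Perm.eq_of_pairwise' (vals_sorted P)
    (List.pairwise_ofFn.2 fun i j hij => hmono hij.le) ?_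
  rw [← Multiset.coe_eq_coe, vals, Multiset.sort_eq, List.ofFn_eq_map, ← Multiset.map_coe]
  have huniv : ((List.finRange (Fintype.card ι) : List (Fin (Fintype.card ι))) :
      Multiset (Fin (Fintype.card ι))) = (univ : Finset (Fin (Fintype.card ι))).val := by
    rw [Fin.univ_def]
  rw [huniv, ← Multiset.map_map, Multiset.map_univ_val_equiv]

/-- `‖P^{−max}_{−ε}‖_{2/3} ≥ 0` (plumbing; the surviving values are positive). [cite: HangleiterEtAl2019, §II–§III, p. 4–5] -/
theorem vvNorm_nonneg' [Nonempty ι] {ε : ℝ} (hε : 0 ≤ ε) {P : ι → ℝ} (hP : ∀ i, 0 ≤ P i) :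
    0 ≤ vvNorm ε P := by
  unfold vvNorm
  refine Real.rpow_nonneg (List.sum_nonneg ?_) _
  intro y hy
  obtain ⟨v, hv, rfl⟩ := List.mem_map.1 hy
  exact Real.rpow_nonneg (pos_of_mem_vvVec hε hP hv).le _

/-- **Theorem 2, lower-bound half, for EVERY target — the `ϵ^{−2}‖P^{−max}_{−2ϵ}‖_{2/3}` branch** (Valiant–
Valiant's instance-optimal identity-testing lower bound, explicit constant): every `ε`-certification test
(Definition 1) of any probability vector `P` on `≥ 2` outcomes from `s` samples, `ε > 0`, satisfies
`‖P^{−max}_{−2ε}‖²_{2/3} ≤ 104 s² ε⁴`, i.e. `s ≥ ‖P^{−max}_{−2ε}‖_{2/3}/(√104 ε²)` — “there exists no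
`ϵ`-certification test from fewer than `c₂ … ϵ^{−2} ∥P^{−max}_{−2ϵ}∥_{2/3}` samples”.  (The sorted
enumeration of `exists_monotone_enum` presents `P^{−max}_{−2ε}` as the values at the indices `t ≤ k ≤ |E|−2`
of a `drop` (`trim_eq_drop`), the prefix `k ≤ t` is heavy, and `IdentityTesting.vv_lower_bound_enum` applies
to the indicator of `T`.) [cite: HangleiterEtAl2019, Theorem 2 (“Optimal certification tests [36]”), p. 5] [cite: ValiantValiant2017, Thm. 1 (lower bound) = §3 Prop. 2, ECCC TR13-111 p. 10] -/
theorem vvNorm_sq_le [Nontrivial ι] (P : ι → ℝ) (hP0 : ∀ i, 0 ≤ P i) (hP1 : ∑ i, P i = 1)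
    {ε : ℝ} (hε : 0 < ε) {s : ℕ} {T : (Fin s → ι) → Bool} (hT : IsCertTest P ε s T) :
    vvNorm (2 * ε) P ^ 2 ≤ 104 * (s : ℝ) ^ 2 * ε ^ 4 := by
  classical
  haveI : Nonempty ι := inferInstance
  have hn2 : 2 ≤ Fintype.card ι := Fintype.one_lt_card
  obtain ⟨x, hmono, hvals⟩ := exists_monotone_enum P
  have hlen : (vals P).length = Fintype.card ι := length_vals P
  obtain ⟨t, ht, htrim, -, hstrict⟩ :=
    trim_eq_drop (by linarith : 0 ≤ 2 * ε) ((vals P).take (Fintype.card ι - 1))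
  have hlen' : ((vals P).take (Fintype.card ι - 1)).length = Fintype.card ι - 1 := by
    rw [List.length_take, hlen]; omega
  rw [hlen'] at ht hstrict
  have hvv : vvVec (2 * ε) P = ((vals P).take (Fintype.card ι - 1)).drop t := by
    rw [vvVec, List.dropLast_eq_take, hlen, htrim]
  have hgetD : ∀ k : Fin (Fintype.card ι), (vals P).getD k 0 = P (x k) := by
    intro k
    rw [hvals]
    simp [List.getD_eq_getElem?_getD]
  -- the 2/3-quasinorm of the surviving values as an indexed sum over the survivors `t ≤ k ≤ |E| − 2`
  set SL := ∑ k ∈ univ.filter (fun k : Fin (Fintype.card ι) => t ≤ k.val ∧ k.val + 1 < Fintype.card ι),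
    P (x k) ^ (2 / 3 : ℝ) with hSL
  have hS0 : 0 ≤ SL := sum_nonneg fun k _ => Real.rpow_nonneg (hP0 _) _
  have hsum : ((vvVec (2 * ε) P).map fun v => v ^ (2 / 3 : ℝ)).sum = SL := by
    rw [hvv, sum_map_drop_take, hlen, hSL, sum_filter, ← Fin.sum_univ_eq_sum_range
      (fun k => if t ≤ k ∧ k < Fintype.card ι - 1 then ((vals P).getD k 0) ^ (2 / 3 : ℝ) else 0)
      (Fintype.card ι)]
    refine sum_congr rfl fun k _ => ?_
    have hiff : (t ≤ k.val ∧ k.val < Fintype.card ι - 1) ↔ (t ≤ k.val ∧ k.val + 1 < Fintype.card ι) := by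
      omega
    simp only [hiff, hgetD]
  have hnorm : vvNorm (2 * ε) P = SL ^ (3 / 2 : ℝ) := by rw [vvNorm, hsum]
  have hcube : (SL ^ (3 / 2 : ℝ)) ^ 2 = SL ^ 3 := by
    rw [← Real.rpow_natCast _ 2, ← Real.rpow_mul hS0]
    norm_num
  rw [hnorm, hcube]
  rcases Nat.lt_or_ge t (Fintype.card ι - 1) with hlt | hge
  · -- something survives: the prefix through the first survivor is heavy, and Proposition 2 applies
    have ht1 : t + 1 < Fintype.card ι := by omega
    have hheavy : 2 * ε < ∑ k ∈ univ.filter (fun k : Fin (Fintype.card ι) => k.val ≤ t), P (x k) := by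
      have h := hstrict hlt
      rw [List.take_take, min_eq_left (by omega : t + 1 ≤ Fintype.card ι - 1)] at h
      have hs : ((vals P).take (t + 1)).sum =
          ∑ k ∈ range (vals P).length, if k < t + 1 then (vals P).getD k 0 else 0 := by
        have h' := sum_map_drop_take id (vals P) 0 (t + 1)
        rw [List.drop_zero, List.map_id] at h'
        rw [h']
        exact sum_congr rfl fun k _ => by simp
      have hEq : ∑ k ∈ univ.filter (fun k : Fin (Fintype.card ι) => k.val ≤ t), P (x k) =
          ∑ k : Fin (Fintype.card ι), if (k : ℕ) < t + 1 then (vals P).getD k 0 else 0 := by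
        rw [sum_filter]
        refine sum_congr rfl fun k _ => ?_
        simp only [Nat.lt_succ_iff, hgetD]
      rw [hEq]
      rwa [hs, hlen, ← Fin.sum_univ_eq_sum_range
        (fun k => if k < t + 1 then (vals P).getD k 0 else 0) (Fintype.card ι)] at h
    have key := vv_lower_bound_enum P hP0 hP1 x hmono hε ht1 hheavy
      (fun S => if T S then (1 : ℝ) else 0) (fun S => by positivity)
      (fun S => by split_ifs <;> norm_num)
      (by rw [← accProb_eq_accept]; exact hT.complete)
      (fun Q hQ0 hQ1 hfar => by rw [← accProb_eq_accept]; exact hT.sound Q hQ0 hQ1 hfar)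
    exact key.le
  · -- everything is trimmed: the quasinorm vanishes
    have hempty : univ.filter
        (fun k : Fin (Fintype.card ι) => t ≤ k.val ∧ k.val + 1 < Fintype.card ι) = ∅ := by
      ext k
      simp only [mem_filter, mem_univ, true_and, Finset.notMem_empty, iff_false, not_and, not_lt]
      intro hk
      omega
    have h0 : (0 : ℝ) ^ 3 = 0 := by norm_num
    rw [hSL, hempty, sum_empty, h0]
    positivity

/-- **Theorem 2 (lower-bound half) DISCHARGED for every target**: `VVLowerBoundAt (1/11) ε P` holds for
every probability vector `P` on a sample space with at least two outcomes and every `0 < ε ≤ 1/2` — both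
branches of `c₂ max{1/ϵ, ϵ^{−2}‖P^{−max}_{−2ϵ}‖_{2/3}}`: the `1/ϵ` branch by `certification_needs_inv_eps`
(v5), the quasinorm branch by Valiant–Valiant's Proposition 2 (`vvNorm_sq_le`, `√104 < 11`).  Every
statement of this file that took `hVV : VVLowerBoundAt c₂ ε P` as a hypothesis is thereby unconditional
with `c₂ = 1/11`. [cite: HangleiterEtAl2019, Theorem 2 (“there exists no ϵ-certification test from fewer than c₂ max{1/ϵ, ϵ^{−2}∥P^{−max}_{−2ϵ}∥_{2/3}} samples”), p. 5] [cite: ValiantValiant2017, Thm. 1 (lower bound), §3 Prop. 2, ECCC TR13-111 p. 10] -/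
theorem vvLowerBoundAt_holds [Nontrivial ι] (P : ι → ℝ) (hP0 : ∀ i, 0 ≤ P i) (hP1 : ∑ i, P i = 1)
    {ε : ℝ} (hε : 0 < ε) (hε2 : ε ≤ 1 / 2) : VVLowerBoundAt (1 / 11) ε P := by
  haveI : Nonempty ι := inferInstance
  intro s T hT
  have hinv := certification_needs_inv_eps P hP0 hP1 hε hε2 hT
  have hsq := vvNorm_sq_le P hP0 hP1 hε hT
  have hN0 : 0 ≤ vvNorm (2 * ε) P := vvNorm_nonneg' (by linarith) hP0
  have hs0 : (0 : ℝ) ≤ s := Nat.cast_nonneg s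
  have hsε : 0 ≤ 11 * (s : ℝ) * ε ^ 2 := by positivity
  have hnorm : vvNorm (2 * ε) P ≤ 11 * s * ε ^ 2 := by
    by_contra h
    push Not at h
    nlinarith [mul_self_lt_mul_self hsε h]
  rcases le_total (1 / ε) (vvNorm (2 * ε) P / ε ^ 2) with h | h
  · rw [max_eq_right h]
    have hε2' : 0 < ε ^ 2 := by positivity
    calc (1 / 11 : ℝ) * (vvNorm (2 * ε) P / ε ^ 2) = vvNorm (2 * ε) P / (11 * ε ^ 2) := by ring
      _ ≤ 11 * s * ε ^ 2 / (11 * ε ^ 2) := div_le_div_of_nonneg_right hnorm (by positivity)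
      _ = s := by field_simp
  · rw [max_eq_left h]
    calc (1 / 11 : ℝ) * (1 / ε) = 1 / (11 * ε) := by ring
      _ ≤ 1 / (3 * ε) := one_div_le_one_div_of_le (by positivity) (by linarith)
      _ ≤ s := hinv.le

/-- `ε ≤ 1/2` is implicit in the “sufficiently large `n`” hypotheses `2ε + 2^{−t} ≤ 1` (plumbing). [folklore] -/
private theorem eps_le_half_of_fit {ε a b : ℝ} (hb : 0 < b) (hfit : 2 * ε + (2 : ℝ) ^ a * b ≤ 1) :
    ε ≤ 1 / 2 := by
  have : 0 < (2 : ℝ) ^ a * b := mul_pos (Real.rpow_pos_of_pos (by norm_num) _) hb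
  linarith

open Classical in
/-- **The skeleton of Theorems 6–7, UNCONDITIONAL** (`c₂ = 1/11`): for a finite weighted ensemble of target
distributions on `≥ 2` outcomes with second moment `Σ_ω μ_ω Σ_S P_ω(S)² ≤ B`, any threshold
`t ≤ ½(log₂ δ − log₂ B)` with `2ε + 2^{−t} ≤ 1` and any `L ≤ (1/11)·2^{t/2}(1 − 2ε − 2^{−t})^{3/2}/ε²`, the
ensemble weight of the `ω` admitting an `ε`-certification test from fewer than `L` samples is at most `δ` —
Valiant–Valiant's Theorem 2 is no longer a hypothesis. [cite: HangleiterEtAl2019, §IV.B (“Proofs of Theorems 6 and 7. We use Theorem 2 and Lemmas 3–5 …”), p. 8] [cite: ValiantValiant2017, Thm. 1 (lower bound)] -/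
theorem certification_lower_bound_of_second_moment_holds [Nontrivial ι] {Ω : Type*} [Fintype Ω]
    (μ : Ω → ℝ) (hμ : ∀ ω, 0 ≤ μ ω) (hμ1 : ∑ ω, μ ω = 1) (P : Ω → ι → ℝ) (hP : ∀ ω i, 0 ≤ P ω i)
    (hP1 : ∀ ω, ∑ i, P ω i = 1) {ε δ B t L : ℝ} (hε : 0 < ε) (hδ : 0 < δ)
    (hB : ∑ ω, μ ω * ∑ i, P ω i ^ 2 ≤ B) (ht : t ≤ (Real.logb 2 δ - Real.logb 2 B) / 2)
    (hfit : 2 * ε + (2 : ℝ) ^ (-t) ≤ 1)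
    (hL : L ≤ (1 / 11 : ℝ) * ((2 : ℝ) ^ (t / 2) * (1 - 2 * ε - (2 : ℝ) ^ (-t)) ^ (3 / 2 : ℝ)) / ε ^ 2) :
    ∑ ω ∈ univ.filter (fun ω : Ω =>
      ¬ (∀ (s : ℕ) (T : (Fin s → ι) → Bool), IsCertTest (P ω) ε s T → L ≤ s)), μ ω ≤ δ := by
  haveI : Nonempty ι := inferInstance
  have hε2 : ε ≤ 1 / 2 := by
    have : 0 < (2 : ℝ) ^ (-t) := Real.rpow_pos_of_pos (by norm_num) _
    linarith
  exact certification_lower_bound_of_second_moment μ hμ hμ1 P hP hP1 (by norm_num) hε hδ hB ht hfit hL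
    fun ω => vvLowerBoundAt_holds _ (hP ω) (hP1 ω) hε hε2

open Classical in
/-- **Theorem 7b in ensemble form with (33) as hypothesis — UNCONDITIONAL in Theorem 2** (`c₂ = 1/11`): for a
finite weighted circuit ensemble on a sample space of size `N ≥ 2` with `𝔼_ω[P_ω(S)²] ≤ 2(1+ε̃)/(N(N+1))` for
every outcome `S`, the weight of the `ω` admitting an `ε`-certification test from fewer than
`(1/11)·2^{(log₂N)/4} q^{1/4}(1 − 2ε − 2^{−(log₂N)/2} q^{−1/2})^{3/2}/ε²` samples (`q = δ/(2(1+ε̃))`) is at most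
`δ` — eq. (28) with only the design bound (33) as input. [cite: HangleiterEtAl2019, Theorem 7b eq. (28) and §V.B eqs. (33)–(34), p. 8–9] [cite: ValiantValiant2017, Thm. 1 (lower bound)] -/
theorem design_certification_lower_bound_holds [Nontrivial ι] {Ω : Type*} [Fintype Ω]
    (μ : Ω → ℝ) (hμ : ∀ ω, 0 ≤ μ ω) (hμ1 : ∑ ω, μ ω = 1)
    (P : Ω → ι → ℝ) (hP : ∀ ω i, 0 ≤ P ω i) (hP1 : ∀ ω, ∑ i, P ω i = 1)
    {ε δ εd : ℝ} (hε : 0 < ε) (hδ : 0 < δ) (hεd : 0 ≤ εd)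
    (h33 : ∀ i, ∑ ω, μ ω * P ω i ^ 2 ≤
      2 * (1 + εd) / ((Fintype.card ι : ℝ) * (Fintype.card ι + 1)))
    (hfit : 2 * ε + (2 : ℝ) ^ (-Real.logb 2 (Fintype.card ι) / 2) *
      (δ / (2 * (1 + εd))) ^ (-(1 / 2) : ℝ) ≤ 1) :
    ∑ ω ∈ univ.filter (fun ω : Ω =>
        ¬ (∀ (s : ℕ) (T : (Fin s → ι) → Bool), IsCertTest (P ω) ε s T →
          (1 / 11 : ℝ) * ((2 : ℝ) ^ (Real.logb 2 (Fintype.card ι) / 4) *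
            (δ / (2 * (1 + εd))) ^ (1 / 4 : ℝ) *
            (1 - 2 * ε - (2 : ℝ) ^ (-Real.logb 2 (Fintype.card ι) / 2) *
              (δ / (2 * (1 + εd))) ^ (-(1 / 2) : ℝ)) ^ (3 / 2 : ℝ)) / ε ^ 2 ≤ s)), μ ω ≤ δ := by
  haveI : Nonempty ι := inferInstance
  have hε2 : ε ≤ 1 / 2 :=
    eps_le_half_of_fit (Real.rpow_pos_of_pos (by positivity) _) hfit
  exact design_certification_lower_bound μ hμ hμ1 P hP hP1 (by norm_num) hε hδ hεd h33 hfit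
    fun ω => vvLowerBoundAt_holds _ (hP ω) (hP1 ω) hε hε2

open Classical in
/-- **Theorem 7a for the `{Z, CZ, CCZ}` / `𝔽₂`-polynomial IQP family — UNCONDITIONAL** (Valiant–Valiant's
Theorem 2 discharged, `c₂ = 1/11`): for all but a `δ`-fraction of the coefficients `(β, γ)` of
`f = h + (degree ≤ 2 part)`, every `ε`-certification test of `p_f` uses at least
`(1/11)·2^{n/4}(δ/3)^{1/4}(1 − 2ε − 2^{−n/2}(δ/3)^{−1/2})^{3/2}/ε²` samples — eq. (27),
`s_min ∈ Ω(2^{n/4}δ^{1/4}/ϵ²)`, now with no hypothesis beyond “sufficiently large `n`” (`hfit`).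
[cite: HangleiterEtAl2019, Theorem 7a eq. (27) and its proof (“We use Theorem 2 and Lemmas 3–5 …”), p. 8] [cite: ValiantValiant2017, Thm. 1 (lower bound)] -/
theorem iqp_certification_lower_bound_holds {V : Type*} [Fintype V] [DecidableEq V] [Nonempty V]
    (h : (V → ZMod 2) → ZMod 2) {ε δ : ℝ} (hε : 0 < ε) (hδ : 0 < δ)
    (hfit : 2 * ε + (2 : ℝ) ^ (-(Fintype.card V : ℝ) / 2) * (δ / 3) ^ (-(1 / 2) : ℝ) ≤ 1) :
    ((univ.filter fun ω : (V → V → ZMod 2) × (V → ZMod 2) =>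
        ¬ (∀ (s : ℕ) (T : (Fin s → (V → ZMod 2)) → Bool), IsCertTest (iqpDist h ω) ε s T →
          (1 / 11 : ℝ) * ((2 : ℝ) ^ ((Fintype.card V : ℝ) / 4) * (δ / 3) ^ (1 / 4 : ℝ) *
            (1 - 2 * ε - (2 : ℝ) ^ (-(Fintype.card V : ℝ) / 2) * (δ / 3) ^ (-(1 / 2) : ℝ))
              ^ (3 / 2 : ℝ)) / ε ^ 2 ≤ s)).card : ℝ) ≤
      δ * Fintype.card ((V → V → ZMod 2) × (V → ZMod 2)) := by
  have hε2 : ε ≤ 1 / 2 := eps_le_half_of_fit (Real.rpow_pos_of_pos (by positivity) _) hfit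
  haveI : Fact (1 < 2) := ⟨by norm_num⟩
  haveI : Nontrivial (V → ZMod 2) := Function.nontrivial
  exact iqp_certification_lower_bound h (by norm_num) hε hδ hfit
    fun ω => vvLowerBoundAt_holds _ (iqpDist_nonneg h ω) (sum_iqpDist h ω) hε hε2

open IQPAnticoncentration GraphStateCutRank in
open Classical in
/-- **Theorem 7a for the IQP family (29) with `A = {0, π/8, …, 7π/8}` — UNCONDITIONAL** (`c₂ = 1/11`): for all
but a `δ`-fraction of the weights `W = (w, v)`, every `ε`-certification test of `P_{U_W}` uses at least
`(1/11)·2^{n/4}(δ/3)^{1/4}(1 − 2ε − 2^{−n/2}(δ/3)^{−1/2})^{3/2}/ε²` samples — eq. (27). [cite: HangleiterEtAl2019, Theorem 7a eq. (27) and §V.A, p. 8] [cite: ValiantValiant2017, Thm. 1 (lower bound)] -/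
theorem ising_certification_lower_bound_holds {V : Type*} [Fintype V] [DecidableEq V] [LinearOrder V]
    [Nonempty V] {ω : ℂ} (hω : IsPrimitiveRoot ω 16) {ε δ : ℝ} (hε : 0 < ε) (hδ : 0 < δ)
    (hfit : 2 * ε + (2 : ℝ) ^ (-(Fintype.card V : ℝ) / 2) * (δ / 3) ^ (-(1 / 2) : ℝ) ≤ 1) :
    ((univ.filter fun wv : (LtPair V → Fin 8) × (V → Fin 8) =>
        ¬ (∀ (s : ℕ) (T : (Fin s → (V → ZMod 2)) → Bool), IsCertTest (isingDist ω wv) ε s T →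
          (1 / 11 : ℝ) * ((2 : ℝ) ^ ((Fintype.card V : ℝ) / 4) * (δ / 3) ^ (1 / 4 : ℝ) *
            (1 - 2 * ε - (2 : ℝ) ^ (-(Fintype.card V : ℝ) / 2) * (δ / 3) ^ (-(1 / 2) : ℝ))
              ^ (3 / 2 : ℝ)) / ε ^ 2 ≤ s)).card : ℝ) ≤
      δ * Fintype.card ((LtPair V → Fin 8) × (V → Fin 8)) := by
  have hε2 : ε ≤ 1 / 2 := eps_le_half_of_fit (Real.rpow_pos_of_pos (by positivity) _) hfit
  haveI : Fact (1 < 2) := ⟨by norm_num⟩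
  haveI : Nontrivial (V → ZMod 2) := Function.nontrivial
  exact ising_certification_lower_bound hω (by norm_num) hε hδ hfit
    fun wv => vvLowerBoundAt_holds _ (isingDist_nonneg ω wv) (sum_isingDist hω wv) hε hε2

open DesignAnticoncentration in
open Classical in
/-- **Theorem 7b for an exact state 2-design — UNCONDITIONAL** (`c₂ = 1/11`, `ε̃ = 0`; neither Theorem 2 nor
(33) is a hypothesis any more): for a finite exact complex-projective 2-design `{ψ_j}` in `ℂ^V`, `|V| ≥ 2`,
the fraction of design states whose output distribution admits an `ε`-certification test from fewer than
`(1/11)·2^{(log₂N)/4}(δ/2)^{1/4}(1 − 2ε − 2^{−(log₂N)/2}(δ/2)^{−1/2})^{3/2}/ε²` samples is at most `δ` — eq. (28),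
`s_min ∈ Ω(2^{n/4}δ^{1/4}/ϵ²)` (the statement that a given circuit family IS a 2-design stays outside this
file). [cite: HangleiterEtAl2019, Theorem 7(b) eq. (28) and §V.B eqs. (33)–(34), p. 8–9] [cite: ValiantValiant2017, Thm. 1 (lower bound)] -/
theorem twoDesign_certification_lower_bound_holds {V : Type*} [Fintype V] [DecidableEq V] [Nontrivial V]
    {J : Type*} [Fintype J] {ψ : J → V → ℂ} (hψ : IsStateTwoDesign ψ) {ε δ : ℝ} (hε : 0 < ε)
    (hδ : 0 < δ)
    (hfit : 2 * ε + (2 : ℝ) ^ (-Real.logb 2 (Fintype.card V) / 2) * (δ / 2) ^ (-(1 / 2) : ℝ) ≤ 1) :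
    ((univ.filter (fun j : J =>
        ¬ (∀ (s : ℕ) (T : (Fin s → V) → Bool), IsCertTest (designDist ψ j) ε s T →
          (1 / 11 : ℝ) * ((2 : ℝ) ^ (Real.logb 2 (Fintype.card V) / 4) * (δ / 2) ^ (1 / 4 : ℝ) *
            (1 - 2 * ε - (2 : ℝ) ^ (-Real.logb 2 (Fintype.card V) / 2) *
              (δ / 2) ^ (-(1 / 2) : ℝ)) ^ (3 / 2 : ℝ)) / ε ^ 2 ≤ s))).card : ℝ) /
      (Fintype.card J : ℝ) ≤ δ := by
  haveI : Nonempty V := inferInstance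
  have hε2 : ε ≤ 1 / 2 := eps_le_half_of_fit (Real.rpow_pos_of_pos (by positivity) _) hfit
  exact twoDesign_certification_lower_bound hψ (by norm_num) hε hδ hfit
    fun j => vvLowerBoundAt_holds _ (designDist_nonneg ψ j) (hψ.norm_sq j) hε hε2

/-- **The `{0,1}^53`, `ϵ = 1/4` instance, now for ANY target**: no `1/4`-certification test of any probability
vector `P` on `{0,1}^53` works from fewer than `‖P^{−max}_{−1/2}‖_{2/3}/0.64` samples (`√104/16 < 0.64`);
for the flat target `‖U^{−max}_{−1/2}‖_{2/3} ≥ 2^{26.5}(1/2 − 2^{−53})^{3/2}` recovers the order `2^{27}` of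
v4. [cite: HangleiterEtAl2019, Theorem 2 and eq. (9), p. 5] [cite: ValiantValiant2017, Thm. 1 (lower bound)] -/
theorem certification53_quarter_needs_vvNorm_samples (P : (Fin 53 → Bool) → ℝ) (hP0 : ∀ i, 0 ≤ P i)
    (hP1 : ∑ i, P i = 1) {s : ℕ} {T : (Fin s → (Fin 53 → Bool)) → Bool}
    (hT : IsCertTest P (1 / 4) s T) : vvNorm (1 / 2) P ^ 2 ≤ (s : ℝ) ^ 2 * (104 / 256) := by
  have h := vvNorm_sq_le P hP0 hP1 (by norm_num : (0 : ℝ) < 1 / 4) hT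
  have e1 : (2 : ℝ) * (1 / 4) = 1 / 2 := by norm_num
  rw [e1] at h
  linarith

end generalVV

/-! ## (v12) Theorem 2 + Lemma 3 for a SINGLE target, unconditional: the min-entropy form of the lower bound -/

section minEntropyUnconditional

/-- **Theorem 2 + Lemma 3, UNCONDITIONAL** (`c₂ = 1/11`): every `ε`-certification test of ANY probability
vector `P` on `≥ 2` outcomes with `0 < ε ≤ 1/2` and `2ε + 2^{−H_∞(P)} ≤ 1` uses
`s ≥ (1/11)·2^{½H_∞(P)}(1 − 2ε − 2^{−H_∞(P)})^{3/2}/ε²` samples — the combination “We use Theorem 2 and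
Lemmas 3–5” of the source with Theorem 2 now supplied by `vvLowerBoundAt_holds` (Valiant–Valiant); no
ensemble, no design hypothesis: the only input is the min-entropy of the one target. [cite: HangleiterEtAl2019, Theorem 2 with Lemma 3 eq. (8) and §IV.B (“We use Theorem 2 and Lemmas 3–5”), pp. 5, 8] [cite: ValiantValiant2017, Thm. 1 (lower bound)] -/
theorem samples_ge_of_minEntropy [Nontrivial ι] {ε : ℝ} (hε : 0 < ε) (hε2 : ε ≤ 1 / 2) {P : ι → ℝ}
    (hP : ∀ i, 0 ≤ P i) (hP1 : ∑ i, P i = 1) (hfit : 2 * ε + (2 : ℝ) ^ (-minEntropy P) ≤ 1)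
    {s : ℕ} {T : (Fin s → ι) → Bool} (hT : IsCertTest P ε s T) :
    (1 / 11 : ℝ) * ((2 : ℝ) ^ (minEntropy P / 2) * (1 - 2 * ε - (2 : ℝ) ^ (-minEntropy P)) ^ (3 / 2 : ℝ))
      / ε ^ 2 ≤ s := by
  haveI : Nonempty ι := inferInstance
  exact samples_ge_of_vv (by norm_num) hε hP hP1 hfit (vvLowerBoundAt_holds P hP hP1 hε hε2) hT

/-- **The same bound in terms of the largest probability** `p_max = 2^{−H_∞(P)}`: every `ε`-certification
test of `P` (`≥ 2` outcomes, `0 < ε ≤ 1/2`, `2ε + p_max ≤ 1`) uses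
`s ≥ (1 − 2ε − p_max)^{3/2}/(11 ε² √p_max)` samples — eq. (9)'s “the sample complexity for certification thus
scales at least as the square root of [the inverse largest probability]” for an arbitrary single target, with
no Valiant–Valiant hypothesis. [cite: HangleiterEtAl2019, Theorem 2, Lemma 3 and eq. (9), p. 5] [cite: ValiantValiant2017, Thm. 1 (lower bound)] -/
theorem samples_ge_of_pmax [Nontrivial ι] {ε : ℝ} (hε : 0 < ε) (hε2 : ε ≤ 1 / 2) {P : ι → ℝ}
    (hP : ∀ i, 0 ≤ P i) (hP1 : ∑ i, P i = 1) (hfit : 2 * ε + pmax P ≤ 1)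
    {s : ℕ} {T : (Fin s → ι) → Bool} (hT : IsCertTest P ε s T) :
    (1 / 11 : ℝ) * ((pmax P) ^ (-(1 / 2) : ℝ) * (1 - 2 * ε - pmax P) ^ (3 / 2 : ℝ)) / ε ^ 2 ≤ s := by
  haveI : Nonempty ι := inferInstance
  have hM := pmax_pos hP hP1
  have hfit' : 2 * ε + (2 : ℝ) ^ (-minEntropy P) ≤ 1 := by rwa [two_rpow_neg_minEntropy hM]
  have h := samples_ge_of_minEntropy hε hε2 hP hP1 hfit' hT
  rwa [two_rpow_neg_minEntropy hM, two_rpow_half_minEntropy hM] at h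

end minEntropyUnconditional

/-! ## (v13) The single-target bound under an UPPER BOUND on `p_max`; dyadic form and numeric instances at `ε = 1/4` -/

section pmaxInstances

/-- `q ↦ q^{−1/2}(1 − 2ε − q)^{3/2}` is antitone on `(0, 1 − 2ε]`. [folklore] -/
private theorem pmaxBound_antitone {ε p q : ℝ} (hp : 0 < p) (hpq : p ≤ q) (hq : 2 * ε + q ≤ 1) :
    q ^ (-(1 / 2) : ℝ) * (1 - 2 * ε - q) ^ (3 / 2 : ℝ) ≤
      p ^ (-(1 / 2) : ℝ) * (1 - 2 * ε - p) ^ (3 / 2 : ℝ) := by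
  apply mul_le_mul
  · exact Real.rpow_le_rpow_of_nonpos hp hpq (by norm_num)
  · exact Real.rpow_le_rpow (by linarith) (by linarith) (by norm_num)
  · exact Real.rpow_nonneg (by linarith) _
  · exact Real.rpow_nonneg hp.le _

/-- `x^{3/2} = x·√x` for `x ≥ 0`. [folklore] -/
private theorem rpow_three_halves_eq_mul_sqrt {x : ℝ} (hx : 0 ≤ x) :
    x ^ (3 / 2 : ℝ) = x * Real.sqrt x := by
  rcases hx.eq_or_lt with h | h
  · rw [← h, Real.zero_rpow (by norm_num), zero_mul]
  · rw [show (3 / 2 : ℝ) = 1 + 1 / 2 by norm_num, Real.rpow_add h, Real.rpow_one, Real.sqrt_eq_rpow]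

/-- `(2^{−k})^{−1/2} = 2^{k/2}`. [folklore] -/
private theorem two_rpow_neg_rpow_neg_half (k : ℝ) :
    ((2 : ℝ) ^ (-k)) ^ (-(1 / 2) : ℝ) = (2 : ℝ) ^ (k / 2) := by
  rw [← Real.rpow_mul (by norm_num : (0 : ℝ) ≤ 2)]
  congr 1
  ring

/-- `2^{−k} ≤ 1/128` for `k ≥ 7`. [folklore] -/
private theorem two_rpow_neg_natCast_le (k : ℕ) (hk : 7 ≤ k) : (2 : ℝ) ^ (-(k : ℝ)) ≤ 1 / 128 := by
  rw [Real.rpow_neg (by norm_num), Real.rpow_natCast, one_div]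
  have h128 : (128 : ℝ) ≤ 2 ^ k :=
    calc (128 : ℝ) = 2 ^ 7 := by norm_num
      _ ≤ 2 ^ k := pow_le_pow_right₀ (by norm_num) hk
  exact inv_anti₀ (by norm_num) h128

/-- The arithmetic of the dyadic form: for `k ≥ 7`,
`2^{k/2 − 1} ≤ (1/11)·((2^{−k})^{−1/2}(1 − 2·¼ − 2^{−k})^{3/2})/(¼)²`
(uses `(1 − ½ − 2^{−k})^{3/2} ≥ (63/128)·0.7015 ≥ 0.345` and `16·0.345/11 ≥ ½`). [folklore] -/
private theorem quarter_dyadic_core (k : ℕ) (hk : 7 ≤ k) :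
    (2 : ℝ) ^ ((k : ℝ) / 2 - 1) ≤
      (1 / 11 : ℝ) * (((2 : ℝ) ^ (-(k : ℝ))) ^ (-(1 / 2) : ℝ) *
        (1 - 2 * (1 / 4) - (2 : ℝ) ^ (-(k : ℝ))) ^ (3 / 2 : ℝ)) / (1 / 4) ^ 2 := by
  have h2k := two_rpow_neg_natCast_le k hk
  rw [two_rpow_neg_rpow_neg_half]
  set q := (2 : ℝ) ^ (-(k : ℝ)) with hq
  have hx : 63 / 128 ≤ 1 - 2 * (1 / 4) - q := by linarith
  have hsqrt : (7015 / 10000 : ℝ) ≤ Real.sqrt (1 - 2 * (1 / 4) - q) :=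
    Real.le_sqrt_of_sq_le (by nlinarith)
  have h32 : (345 / 1000 : ℝ) ≤ (1 - 2 * (1 / 4) - q) ^ (3 / 2 : ℝ) := by
    rw [rpow_three_halves_eq_mul_sqrt (by linarith)]
    calc (345 / 1000 : ℝ) ≤ 63 / 128 * (7015 / 10000) := by norm_num
      _ ≤ _ := mul_le_mul hx hsqrt (by norm_num) (by linarith)
  have hA : 0 < (2 : ℝ) ^ ((k : ℝ) / 2) := Real.rpow_pos_of_pos (by norm_num) _
  have hpow : (2 : ℝ) ^ ((k : ℝ) / 2 - 1) = 2 ^ ((k : ℝ) / 2) / 2 := by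
    rw [Real.rpow_sub (by norm_num), Real.rpow_one]
  rw [hpow]
  calc (2 : ℝ) ^ ((k : ℝ) / 2) / 2
      ≤ (1 / 11 : ℝ) * (2 ^ ((k : ℝ) / 2) * (345 / 1000)) / (1 / 4) ^ 2 := by
        rw [div_le_div_iff₀ (by norm_num) (by norm_num)]
        nlinarith [hA]
    _ ≤ (1 / 11 : ℝ) * (2 ^ ((k : ℝ) / 2) * (1 - 2 * (1 / 4) - q) ^ (3 / 2 : ℝ)) / (1 / 4) ^ 2 := by
        gcongr

/-- **The single-target bound under an upper bound on the largest probability.** If `p_max(P) ≤ q`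
with `2ε + q ≤ 1` (and `0 < ε ≤ 1/2`, `≥ 2` outcomes), every `ε`-certification test of `P` uses
`s ≥ (1 − 2ε − q)^{3/2}/(11 ε² √q)` samples: `samples_ge_of_pmax` composed with the monotonicity of
`q ↦ q^{−1/2}(1 − 2ε − q)^{3/2}` — the form in which the bound is USED on an instance (“the sample
complexity for certification thus scales at least as the square root of” the inverse largest probability,
eq. (9)): only an upper bound on the largest ideal probability is ever available. [cite: HangleiterEtAl2019, Theorem 2, Lemma 3 eq. (8) and eq. (9), p. 5] [cite: ValiantValiant2017, Thm. 1 (lower bound)] -/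
theorem samples_ge_of_pmax_le [Nontrivial ι] {ε : ℝ} (hε : 0 < ε) (hε2 : ε ≤ 1 / 2) {P : ι → ℝ}
    (hP : ∀ i, 0 ≤ P i) (hP1 : ∑ i, P i = 1) {q : ℝ} (hq : pmax P ≤ q) (hfit : 2 * ε + q ≤ 1)
    {s : ℕ} {T : (Fin s → ι) → Bool} (hT : IsCertTest P ε s T) :
    (1 / 11 : ℝ) * (q ^ (-(1 / 2) : ℝ) * (1 - 2 * ε - q) ^ (3 / 2 : ℝ)) / ε ^ 2 ≤ s := by
  haveI : Nonempty ι := inferInstance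
  have hM := pmax_pos hP hP1
  refine le_trans ?_ (samples_ge_of_pmax hε hε2 hP hP1 (by linarith) hT)
  have hmono := pmaxBound_antitone (ε := ε) hM hq hfit
  exact div_le_div_of_nonneg_right (mul_le_mul_of_nonneg_left hmono (by norm_num)) (sq_nonneg ε)

/-- **Dyadic form at `ε = 1/4`.** If the largest probability of a target on `≥ 2` outcomes is at most
`2^{−k}` with `k ≥ 7` (min-entropy at least `k` bits), every `1/4`-certification test of it from samples
uses at least `2^{k/2 − 1}` samples (the constant: `(16/11)(½ − 2^{−k})^{3/2} ≥ ½` once `k ≥ 7`).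
[cite: HangleiterEtAl2019, Theorem 2, Lemma 3 and eq. (9), p. 5 (“scales at least as the square root of” the inverse largest probability)] [cite: ValiantValiant2017, Thm. 1 (lower bound)] -/
theorem samples_ge_two_rpow_of_pmax_le [Nontrivial ι] {P : ι → ℝ} (hP : ∀ i, 0 ≤ P i)
    (hP1 : ∑ i, P i = 1) {k : ℕ} (hk : 7 ≤ k) (hq : pmax P ≤ (2 : ℝ) ^ (-(k : ℝ)))
    {s : ℕ} {T : (Fin s → ι) → Bool} (hT : IsCertTest P (1 / 4) s T) :
    (2 : ℝ) ^ ((k : ℝ) / 2 - 1) ≤ s :=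
  (quarter_dyadic_core k hk).trans
    (samples_ge_of_pmax_le (by norm_num) (by norm_num) hP hP1 hq
      (by have := two_rpow_neg_natCast_le k hk; linarith) hT)

/-- **Numeric instance, `k = 48` (a target with `p_max ≤ 2^{−48}`, e.g. min-entropy ≥ 48 bits):** every
`1/4`-certification test from samples uses at least `2^{23} = 8 388 608` samples. (Orientation only: whether a
given experiment's ideal output distribution satisfies the hypothesis is a property of that instance, not
proved here.) [cite: HangleiterEtAl2019, Theorem 2, Lemma 3 and eq. (9), p. 5] [cite: ValiantValiant2017, Thm. 1 (lower bound)] -/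
theorem samples_ge_of_pmax_le_two_pow_neg_48 [Nontrivial ι] {P : ι → ℝ} (hP : ∀ i, 0 ≤ P i)
    (hP1 : ∑ i, P i = 1) (hq : pmax P ≤ (2 : ℝ) ^ (-(48 : ℝ)))
    {s : ℕ} {T : (Fin s → ι) → Bool} (hT : IsCertTest P (1 / 4) s T) :
    (8388608 : ℝ) ≤ s := by
  have h := samples_ge_two_rpow_of_pmax_le hP hP1 (k := 48) (by norm_num) (by exact_mod_cast hq) hT
  have e : (2 : ℝ) ^ (((48 : ℕ) : ℝ) / 2 - 1) = 8388608 := by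
    rw [show (((48 : ℕ) : ℝ) / 2 - 1) = ((23 : ℕ) : ℝ) by norm_num, Real.rpow_natCast]; norm_num
  rwa [e] at h

/-- **Numeric instance, `k = 61` (a target with `p_max ≤ 2^{−61}`, e.g. min-entropy ≥ 61 bits):** every
`1/4`-certification test from samples uses at least `7.5·10⁸` samples (`2^{59/2} ≈ 7.59·10⁸`).
(Orientation only, as above.) [cite: HangleiterEtAl2019, Theorem 2, Lemma 3 and eq. (9), p. 5] [cite: ValiantValiant2017, Thm. 1 (lower bound)] -/
theorem samples_ge_of_pmax_le_two_pow_neg_61 [Nontrivial ι] {P : ι → ℝ} (hP : ∀ i, 0 ≤ P i)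
    (hP1 : ∑ i, P i = 1) (hq : pmax P ≤ (2 : ℝ) ^ (-(61 : ℝ)))
    {s : ℕ} {T : (Fin s → ι) → Bool} (hT : IsCertTest P (1 / 4) s T) :
    (750000000 : ℝ) ≤ s := by
  have h := samples_ge_two_rpow_of_pmax_le hP hP1 (k := 61) (by norm_num) (by exact_mod_cast hq) hT
  have e : (2 : ℝ) ^ (((61 : ℕ) : ℝ) / 2 - 1) = 2 ^ (29 : ℕ) * Real.sqrt 2 := by
    rw [show (((61 : ℕ) : ℝ) / 2 - 1) = ((29 : ℕ) : ℝ) + 1 / 2 by norm_num, Real.rpow_add (by norm_num),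
      Real.rpow_natCast, Real.sqrt_eq_rpow]
  have hs : (14142 / 10000 : ℝ) ≤ Real.sqrt 2 := Real.le_sqrt_of_sq_le (by norm_num)
  rw [e] at h
  exact le_trans (le_trans (by norm_num) (by gcongr : (2 : ℝ) ^ (29 : ℕ) * (14142 / 10000) ≤ _)) h

end pmaxInstances

end Certification
end Literature.Computability.QuantumComplexity
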